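/-
Copyright (c) 2026 the pub-hodgecm-mathlib formalisation cell (harness21).  Prover seat hodgecm-mathlib-A-p16 (g32): road «S3-ram» (LEAD F0P3a-plan (g13); owner∕table
F0P3a-p06 (g15)), the (a2) JUNCTION (J★) of F0P3a-p01 (g17) — organ «(J★) HEAD modulo the CONFIGURATION COUNTS», FILE 5: the head's signed identity in the two ISOCELES
configurations from the pen's iso engine statement and the S45 pooled region data; 2026-09-02.
-/
import Literature.NumberTheory.Rogawski1990.DepthZeroKappaTransferTypeOneRamifiedLiteralTransport        -- FILE 3 (this seat, p847836): per-literal transport package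
import Literature.NumberTheory.Rogawski1990.DepthZeroKappaTransferTypeOneRamifiedKappaSumEquilateral     -- ★ J8-eq: `shellSum_P_pos_add_neg_{keep,flip}`
import Literature.NumberTheory.Rogawski1990.DepthZeroKappaTransferTypeOneRamifiedKappaSumIsoceles        -- ★ J8-iso (F0P3a-p01 (g16)): pools + `kappaSum_isoceles_eq` ∕ `_opposite_eq`
import Literature.NumberTheory.Automorphic.UnitaryLatticeTreeFixedGrandchildrenSliceCountRamified        -- ★ G3⁺ slice: the GC-set vocabulary of the iso texts
import Literature.NumberTheory.Automorphic.UnitaryLatticeTreeFixedFiniteModelTransport                   -- ★ p847574 (p05): `finite_setOf_latticeGraphIso_eq_of_eigenframe` (the region is finite)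
import Literature.NumberTheory.Automorphic.UnitaryLatticeTreeResidualTokens                             -- ★ p847953 (F0P3a-p05 (g17), DEAL T): the three residual tokens + twist character
import Literature.NumberTheory.Rogawski1990.DepthZeroKappaTransferTypeOneRamifiedIsocelesPooling         -- FILE 4 (this seat, p847964): four-literal pooling
import HarnessLib


/-!
# The ramified type-(1) `κ`-orbital integral: THE JUNCTION HEAD FROM THE PER-LITERAL STRATA COUNTS — isoceles configurations (Rogawski 1990 §4.9; Kottwitz 1986 §3;
# Labesse–Langlands 1979 §2, §5)

Topic `NumberTheory/Rogawski1990`; namespace `Literature.NumberTheory.Rogawski1990`.  THEOREMS ONLY (no definition, no instance, no notation, no named fact, no `sorry`); kernel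
lane `--supports stmt-HodgeConjecture-24833`; datum-free over the abstract lattice model (`K : Type` with `Valued K ℤᵐ⁰`, involution `σ` with `σϖ = −ϖ`, residually trivial,
finite residue field of odd characteristic).  Cell `pub/hodgecm-mathlib` (D-0151), crux H413; road «S3-ram» (Literature seeding, count-neutral), fold of record v7.7–v7.9 socket
(J★) `stub_typeOne_junction_ram` = the `hJ` hypothesis type of ★ p847532; junction pen F0P3a-p01 (g17), skeleton v11 (5af0312e): iso engine `strataCount_J₀_isoceles`
(:1187; S45-direct binders `sR hsR PE PP PM hPE hPP hPM`), S45 region data F0P3a-p02 (g17) v4 (bc98a4a1): `row_S45_hyperbolic` ∕ `row_S45_bare`.  ORGAN «(J★) HEAD modulo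
the CONFIGURATION COUNTS» (A-p16 (g32); p01 «=» 01:50:26Z (3) and 02:09:53Z «the head (equilateral + iso branches) = A-p16's»), FILE 5 (sequel of ★ p847798 FILE 2, the
EQUILATERAL configuration; uses ★ FILE 3 p847836 `exists_transport_typeOne_literal`, ★ FILE 4 `…IsocelesPooling`, ★ DEAL T p847953 `UnitaryLatticeTreeResidualTokens` (F0P3a-p05),
★ J8-iso, ★ J8-eq's `shellSum_P_pos_add_neg_{keep,flip}`).

* `odd_of_norm_one_of_v_sub_one`: the depth of a norm-one principal unit is ODD (`y + σy = −yσy`; at even depth `|w + σw| = |2w + (σw − w)| = 1` contradicts) — so the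
  head's `N₁, N₂` are odd and the isoceles gaps are even.
* `literal_count_isoceles` (internal step, one literal `b`): frame ∘ `u`-normalised `J₀`-literal ∘ D→J₀ transport (★ FILE 3) ∘ region finset (★ p847574 finiteness) ∘ the
  three S45 TOKENS in residual form (hyperbolic `χ(−d̄_jd̄_k) = 1`, BIG `χ(residue((−1)^{s'+1}τe′d_{i₀}d_k)) = 1`, lock `χ(−τ̄d̄_{i₀}c̄₀⁻¹) = 1` via ★ DEAL T and FILE 3's common
  residual class constant) ∘ `hHyp`∕`hBare` ∘ `hIso` ⇒ the head count of literal `b` = the S45 closed form in the literal's raw characters (both `IsSquare (−1)` variants).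
* **`signedStrataCount_typeOne_ram_isoceles_of_strataCount`**: for `¬ (N₁ = N ∧ N₂ = N)` the (J★) conclusion holds, by the trichotomy `N₁ < N₂` (`α` isolated,
  `i₀ = 0`, `(j,k) = (1,2)`, `d₀ = N = N₁`, `N₂ = N + 2s'`, `m = N + s'`, `n = mA + 1`; ★ `signedSum_isoTokens_opposite` ∘ ★ `kappaSum_isoceles_opposite_eq`, sign
  `χ((−1)^{s'+1}ĀC̄ū₀ū₂ū⁻²) = χ((−1)^m ū₀ū₂ĀC̄)`), `N₁ = N₂ < N` (`u` isolated, `i₀ = 1`, `(j,k) = (0,2)`, `d₀ = N₁ = 2mA + 3 = m`, `N = N₁ + 2s'`, `n = mA + 1 + s'`;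
  ★ `signedSum_isoTokens_shared` ∘ ★ `kappaSum_isoceles_eq`, sign `χ(−ū₀ū₂) = χ((−1)^m ū₀ū₂ĀC̄)` as `Ā = C̄` and `m` odd), `N₂ < N₁` (`γ` isolated, `i₀ = 2`, `(j,k) = (1,0)`,
  ★ `signedSum_isoTokens_opposite'`), each literal's raw tokens being the sign patterns `(−1)^{e(b)}·χ` of ★ `quadraticChar_residue_pow_mul`.
The hypotheses `hIso hHyp hBare` are the pen's ∕ p02's statements with their own binders VERBATIM (sliced programmatically from skeleton v11 :1187 and S45 v4), stated at
the head's `K σ ϖ` (so the ★ engine ∕ S45 theorems discharge them by name); together with ★ FILE 2 this gives the (J★) text by `by_cases N₁ = N ∧ N₂ = N`.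
HONEST LABEL: HC_CM is proved only modulo the 2 remaining named inputs (hLiu418 24832, h413 24833) until rung 0 closes; nothing printed is asserted here.

## References
* [Rogawski1990] J. D. Rogawski, *Automorphic Representations of Unitary Groups in Three Variables*, Ann. of Math. Stud. 123 (1990), §4.9 Prop. 4.9.1 (a)(b) p. 55, Lemma 4.9.3.
* [Kottwitz1986] R. E. Kottwitz, *Base change for unit elements of Hecke algebras*, Compositio Math. 60 (1986), §3 (counting fixed lattices shell by shell).
* [LabesseLanglands1979] J.-P. Labesse, R. P. Langlands, *L-indistinguishability for SL(2)*, Canad. J. Math. 31 (1979), §2 Lemma 2.1, §5 (κ-signed sums over the four twists).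
-/

set_option autoImplicit false

noncomputable section

open scoped Valued WithZero Matrix MatrixGroups
open Polynomial Finset Classical
open Literature.NumberTheory.Automorphic Literature.NumberTheory.Automorphic.HermitianLattice Literature.NumberTheory.Automorphic.UnitaryLatticeTree

namespace Literature.NumberTheory.Rogawski1990

/-- `|ϖ|^n = exp(−n)`. [folklore] -/
private theorem v_pow_eq_exp {K : Type*} [Field K] [Valued K ℤᵐ⁰] {ϖ : K} (hϖ : Valued.v ϖ = WithZero.exp (-1 : ℤ)) (n : ℕ) :
    Valued.v ϖ ^ n = WithZero.exp (-(n : ℤ)) := by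
  induction n with
  | zero => simp
  | succ n ih => rw [pow_succ, ih, hϖ, ← WithZero.exp_add]; congr 1; push_cast; ring

/-- Powers of `|ϖ|` are injective in the exponent. [folklore] -/
private theorem eq_of_v_pow_eq {K : Type*} [Field K] [Valued K ℤᵐ⁰] {ϖ : K} (hϖ : Valued.v ϖ = WithZero.exp (-1 : ℤ)) {a b : ℕ}
    (h : Valued.v ϖ ^ a = Valued.v ϖ ^ b) : a = b := by
  rw [v_pow_eq_exp hϖ, v_pow_eq_exp hϖ] at h
  have h1 := WithZero.exp_le_exp.1 h.le
  have h2 := WithZero.exp_le_exp.1 h.ge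
  omega

/-- `|ϖ|^b ≤ |ϖ|^a ↔ a ≤ b`. [folklore] -/
private theorem v_pow_le_iff {K : Type*} [Field K] [Valued K ℤᵐ⁰] {ϖ : K} (hϖ : Valued.v ϖ = WithZero.exp (-1 : ℤ)) {a b : ℕ} :
    Valued.v ϖ ^ b ≤ Valued.v ϖ ^ a ↔ a ≤ b := by
  rw [v_pow_eq_exp hϖ, v_pow_eq_exp hϖ, WithZero.exp_le_exp]
  omega

/-- `|ϖ|^b < |ϖ|^a ↔ a < b`. [folklore] -/
private theorem v_pow_lt_iff {K : Type*} [Field K] [Valued K ℤᵐ⁰] {ϖ : K} (hϖ : Valued.v ϖ = WithZero.exp (-1 : ℤ)) {a b : ℕ} :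
    Valued.v ϖ ^ b < Valued.v ϖ ^ a ↔ a < b := by
  rw [v_pow_eq_exp hϖ, v_pow_eq_exp hϖ, WithZero.exp_lt_exp]
  omega

/-- **THE DEPTH OF A NORM-ONE PRINCIPAL UNIT IS ODD** (ramified quadratic `σ`, `σϖ = −ϖ`, `σ` residually trivial, `2` a unit): if `x·σx = 1` and `|x − 1| = |ϖ|^M` with `M ≥ 1`
then `M` is odd.  (`y = x − 1` satisfies `y + σy = −yσy`, of valuation `|ϖ|^{2M}`; were `M` even, `y = wϖ^M` would give `y + σy = (w + σw)ϖ^M` of valuation `|ϖ|^M`,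
since `|w + σw| = |2w + (σw − w)| = 1`.) [cite: Rogawski1990, §4.9 p. 55] [cite: Kottwitz1986, §3] -/
theorem odd_of_norm_one_of_v_sub_one {K : Type*} [Field K] [Valued K ℤᵐ⁰] {σ : K →+* K} {ϖ : K}
    (hvσ : ∀ a, Valued.v (σ a) = Valued.v a) (hσϖ : σ ϖ = -ϖ) (hϖ : Valued.v ϖ = WithZero.exp (-1 : ℤ))
    (hres : ∀ x : K, Valued.v x ≤ 1 → Valued.v (σ x - x) < 1) (h2 : Valued.v (2 : K) = 1)
    {x : K} (hx : x * σ x = 1) {M : ℕ} (hM1 : 1 ≤ M) (hxM : Valued.v (x - 1) = Valued.v ϖ ^ M) : Odd M := by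
  by_contra hodd
  have hev : Even M := Nat.not_odd_iff_even.1 hodd
  have hϖ0 : ϖ ≠ 0 := fun h0 => by rw [h0, map_zero] at hϖ; exact WithZero.coe_ne_zero hϖ.symm
  have hvϖ0 : Valued.v ϖ ≠ 0 := (Valuation.ne_zero_iff _).2 hϖ0
  set y : K := x - 1 with hy
  have hsum : y + σ y = -(y * σ y) := by
    have h1 : (1 + y) * (1 + σ y) = 1 := by
      rw [hy, map_sub, map_one]; convert hx using 1; ring
    linear_combination h1
  -- `y = w ϖ^M` with `|w| = 1`
  set w : K := y / ϖ ^ M with hw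
  have hpow0 : ϖ ^ M ≠ 0 := pow_ne_zero _ hϖ0
  have hyw : y = w * ϖ ^ M := by rw [hw, div_mul_cancel₀ _ hpow0]
  have hwv : Valued.v w = 1 := by
    rw [hw, map_div₀, hxM, map_pow, div_self (pow_ne_zero _ hvϖ0)]
  have hσy : σ y = σ w * ϖ ^ M := by
    rw [hyw, map_mul, map_pow, hσϖ, Even.neg_pow hev]
  -- `|w + σw| = 1`
  have hws : Valued.v (w + σ w) = 1 := by
    have e : w + σ w = 2 * w + (σ w - w) := by ring
    have h2w : Valued.v (2 * w) = 1 := by rw [map_mul, h2, hwv, one_mul]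
    rw [e, Valuation.map_add_eq_of_lt_left]
    · exact h2w
    · rw [h2w]; exact hres w hwv.le
  -- compare the two valuations of `y + σy`
  have hv1 : Valued.v (y + σ y) = Valued.v ϖ ^ M := by
    rw [hσy, hyw, ← add_mul, map_mul, hws, one_mul, map_pow]
  have hv2 : Valued.v (y + σ y) = Valued.v ϖ ^ (2 * M) := by
    rw [hsum, Valuation.map_neg, map_mul, hvσ, hxM, ← pow_add, two_mul]
  have hM : M = 2 * M := eq_of_v_pow_eq hϖ (hv1.symm.trans hv2)
  omega

set_option maxHeartbeats 3200000 in
/-- **ONE LITERAL IN AN ISOCELES CONFIGURATION** (internal step): the head count of the literal `b` at stratum `jj` equals the iso engine's closed form fed with the S45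
region data, with the three S45 tokens rewritten as RAW residual characters of the literal's datum. [cite: Rogawski1990, §4.9 Prop. 4.9.1 (a) p. 55] [cite: Kottwitz1986, §3] -/
theorem literal_count_isoceles
    {K : Type} [Field K] [Valued K ℤᵐ⁰]
      {σ : K →+* K} {ϖ : K} (hσ : ∀ x, σ (σ x) = x) (hvσ : ∀ a, Valued.v (σ a) = Valued.v a) (hϖ : Valued.v ϖ = WithZero.exp (-1 : ℤ)) (hσϖ : σ ϖ = -ϖ)
      (hres : ∀ x : K, Valued.v x ≤ 1 → Valued.v (σ x - x) < 1) (h2 : Valued.v (2 : K) = 1)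
      (hnorm : ∀ u : K, σ u = u → Valued.v (u - 1) < 1 → ∃ z : K, z * σ z = u ∧ Valued.v (z - 1) ≤ Valued.v (u - 1)) [Fintype (Valued.ResidueField K)] [DecidableEq (Valued.ResidueField K)]
      -- the torus datum: σ-fixed INTEGERS `u₀ u₁ u₂` (units), `ε` (a unit, residually a non-square), `c₀` (a unit, the rank-one class constant)
      (u₀ u₁ u₂ ε c₀ : (Valued.integer K)) (hu₀ : Valued.v (u₀ : K) = 1) (hu₁ : Valued.v (u₁ : K) = 1) (hu₂ : Valued.v (u₂ : K) = 1) (hεv : Valued.v (ε : K) = 1) (hc₀ : Valued.v (c₀ : K) = 1)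
      (hσu₀ : σ u₀ = u₀) (hσu₁ : σ u₁ = u₁) (hσu₂ : σ u₂ = u₂) (hσε : σ ε = ε) (_hσc₀ : σ c₀ = c₀)
      (hε : ¬ IsSquare (IsLocalRing.residue (Valued.integer K) ε))
      -- the element: norm-one diagonal entries, `v`-deep (`≡ 1 (ϖ²)`), depths `N₁ = depth(α − u)`, `N₂ = depth(u − γ)` (`N₁ + N₂ = 2m`), `N = depth(α − γ) = 2n+1`, `n ≥ 1`,
      -- with the LEADING COEFFICIENTS `A = (α − u)∕ϖ^{N₁}`, `C = (γ − u)∕ϖ^{N₂}` (integers, units by `hN₁`, `hN₂`) that enter the sign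
      (α u γ : K) (hα : α * σ α = 1) (hu : u * σ u = 1) (hγ : γ * σ γ = 1)
      (hα2 : Valued.v (α - 1) ≤ Valued.v ϖ ^ 2) (hu2 : Valued.v (u - 1) ≤ Valued.v ϖ ^ 2) (hγ2 : Valued.v (γ - 1) ≤ Valued.v ϖ ^ 2)
      (T : GL (Fin 3) K) (hT : (T : Matrix (Fin 3) (Fin 3) K) = Matrix.diagonal ![α, u, γ])
      (N₁ N₂ N m n : ℕ) (_hN₁ : Valued.v (α - u) = Valued.v ϖ ^ N₁) (_hN₂ : Valued.v (u - γ) = Valued.v ϖ ^ N₂) (_hN : Valued.v (α - γ) = Valued.v ϖ ^ N)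
      (_hm : N₁ + N₂ = 2 * m) (_hn : N = 2 * n + 1) (_h1n : 1 ≤ n)
      (A C : (Valued.integer K)) (_hA : α - u = (A : K) * ϖ ^ N₁) (_hC : γ - u = (C : K) * ϖ ^ N₂)
    (hIso : ∀ [ValuativeRel K] [(Valued.v : Valuation K ℤᵐ⁰).Compatible]
    (hσ : ∀ x, σ (σ x) = x) (hvσ : ∀ a, Valued.v (σ a) = Valued.v a) (hσϖ : σ ϖ = -ϖ)
    (hϖ : Valued.v ϖ = WithZero.exp (-1 : ℤ)) (hres : ∀ x : K, Valued.v x ≤ 1 → Valued.v (σ x - x) < 1) (h2 : Valued.v (2 : K) = 1)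
    (hnorm : ∀ u : K, σ u = u → Valued.v (u - 1) < 1 → ∃ z : K, z * σ z = u ∧ Valued.v (z - 1) ≤ Valued.v (u - 1)) [Fintype 𝓀[K]] [DecidableEq 𝓀[K]]
    {γ : unitaryGroupOfForm σ ((StdForm.antidiagonal 3).over K)} (hγ0 : γ ∈ unitaryInt σ ((StdForm.antidiagonal 3).over K))
    (d : Fin 3 → K) (hd : ∀ i, Valued.v (d i) = 1) (hdσ : ∀ i, σ (d i) = d i)
    (A : GL (Fin 3) K) (hA : IsIntMatrix (A : Matrix (Fin 3) (Fin 3) K)) (hA' : IsIntMatrix ((A⁻¹ : GL (Fin 3) K) : Matrix (Fin 3) (Fin 3) K))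
    (hdA : Matrix.diagonal d = (-(Matrix.diagonal d).det) • formCongr σ A ((StdForm.antidiagonal 3).over K))
    (s : Fin 3 → K) (hs1 : s 1 = 1) (hsv : ∀ i, Valued.v (s i) = 1) (hsσ : ∀ i, s i * σ (s i) = 1)
    (hγA : ((γ : GL (Fin 3) K) : Matrix (Fin 3) (Fin 3) K) = (A : Matrix (Fin 3) (Fin 3) K) * Matrix.diagonal s * ((A⁻¹ : GL (Fin 3) K) : Matrix (Fin 3) (Fin 3) K))
    (i₀ : Fin 3) {d₀ : ℕ} (hd3 : 3 ≤ d₀) (he : ∀ i, Valued.v (s i - 1) ≤ Valued.v ϖ ^ d₀)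
    (hiso : ∀ j, j ≠ i₀ → Valued.v (s i₀ - s j) = Valued.v ϖ ^ d₀) (hclose : ∀ j k, j ≠ i₀ → k ≠ i₀ → Valued.v (s j - s k) ≤ Valued.v ϖ ^ (d₀ + 2))
    (hreg : ∀ i j, i ≠ j → s i ≠ s j)
    (mA : ℕ) (hmA : d₀ = 2 * mA + 3)
    (c₁ ε : K) (hc₁ : Valued.v c₁ = 1) (hεv : Valued.v ε = 1) (hε : ∀ z : K, Valued.v z ≤ 1 → Valued.v (z ^ 2 - ε) = 1)
    (q : ℕ) (hq : q = Fintype.card 𝓀[K])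
    (sR : Finset {M : Submodule 𝒪[K] (Fin 3 → K) // IsVertex σ ϖ ((StdForm.antidiagonal 3).over K) M}) (hsR : ∀ v, v ∈ sR ↔ v ∈ {v : {M : Submodule 𝒪[K] (Fin 3 → K) // IsVertex σ ϖ ((StdForm.antidiagonal 3).over K) M} | latticeGraphIso σ ϖ ((StdForm.antidiagonal 3).over K) γ v = v ∧ IsSelfDualLattice σ ϖ ((StdForm.antidiagonal 3).over K) v.1 ∧ v.1.map ((Matrix.toLin' (((γ : GL (Fin 3) K) : Matrix (Fin 3) (Fin 3) K) - 1)).restrictScalars 𝒪[K]) ≤ scaleLattice (ϖ ^ d₀) v.1})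
    (PE PP PM : ℕ)
    (hPE : ∑ v ∈ sR, ({w | w ∈ {w | ∃ c, ((latticeGraph σ ϖ ((StdForm.antidiagonal 3).over K)).Adj v c ∧ (latticeGraph σ ϖ ((StdForm.antidiagonal 3).over K)).dist ⟨stdLattice K 3, 0, isSelfDualLattice_stdLattice_three_of_v hϖ⟩ c = (latticeGraph σ ϖ ((StdForm.antidiagonal 3).over K)).dist ⟨stdLattice K 3, 0, isSelfDualLattice_stdLattice_three_of_v hϖ⟩ v + 1 ∧ latticeGraphIso σ ϖ ((StdForm.antidiagonal 3).over K) γ c = c) ∧ ((latticeGraph σ ϖ ((StdForm.antidiagonal 3).over K)).Adj c w ∧ (latticeGraph σ ϖ ((StdForm.antidiagonal 3).over K)).dist ⟨stdLattice K 3, 0, isSelfDualLattice_stdLattice_three_of_v hϖ⟩ w = (latticeGraph σ ϖ ((StdForm.antidiagonal 3).over K)).dist ⟨stdLattice K 3, 0, isSelfDualLattice_stdLattice_three_of_v hϖ⟩ c + 1 ∧ latticeGraphIso σ ϖ ((StdForm.antidiagonal 3).over K) γ w = w)} ∧ (¬ w.1.map ((Matrix.toLin' (((γ : GL (Fin 3)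 K) : Matrix (Fin 3) (Fin 3) K) - 1)).restrictScalars 𝒪[K]) ≤ scaleLattice (ϖ ^ d₀) w.1 ∧ (w.1.map ((Matrix.toLin' (((γ : GL (Fin 3) K) : Matrix (Fin 3) (Fin 3) K) - 1)).restrictScalars 𝒪[K]) ≤ scaleLattice (ϖ ^ (d₀ - 1)) w.1 ∧ ¬ w.1.map ((Matrix.toLin' (((γ : GL (Fin 3) K) : Matrix (Fin 3) (Fin 3) K) - 1)).restrictScalars 𝒪[K]) ≤ scaleLattice (ϖ ^ d₀) w.1))}).ncard = q * PE)
    (hPP : ∑ v ∈ sR, ({w | w ∈ {w | ∃ c, ((latticeGraph σ ϖ ((StdForm.antidiagonal 3).over K)).Adj v c ∧ (latticeGraph σ ϖ ((StdForm.antidiagonal 3).over K)).dist ⟨stdLattice K 3, 0, isSelfDualLattice_stdLattice_three_of_v hϖ⟩ c = (latticeGraph σ ϖ ((StdForm.antidiagonal 3).over K)).dist ⟨stdLattice K 3, 0, isSelfDualLattice_stdLattice_three_of_v hϖ⟩ v + 1 ∧ latticeGraphIso σ ϖ ((StdForm.antidiagonal 3).over K) γ c = c) ∧ ((latticeGraph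 σ ϖ ((StdForm.antidiagonal 3).over K)).Adj c w ∧ (latticeGraph σ ϖ ((StdForm.antidiagonal 3).over K)).dist ⟨stdLattice K 3, 0, isSelfDualLattice_stdLattice_three_of_v hϖ⟩ w = (latticeGraph σ ϖ ((StdForm.antidiagonal 3).over K)).dist ⟨stdLattice K 3, 0, isSelfDualLattice_stdLattice_three_of_v hϖ⟩ c + 1 ∧ latticeGraphIso σ ϖ ((StdForm.antidiagonal 3).over K) γ w = w)} ∧ (¬ w.1.map ((Matrix.toLin' (((γ : GL (Fin 3) K) : Matrix (Fin 3) (Fin 3) K) - 1)).restrictScalars 𝒪[K]) ≤ scaleLattice (ϖ ^ d₀) w.1 ∧ (w.1.map ((Matrix.toLin' (((γ : GL (Fin 3) K) : Matrix (Fin 3) (Fin 3) K) - 1)).restrictScalars 𝒪[K]) ≤ scaleLattice (ϖ ^ (d₀ - 2)) w.1 ∧ ¬ w.1.map ((Matrix.toLin' (((γ : GL (Fin 3) K) : Matrix (Fin 3) (Fin 3) K) - 1)).restrictScalars 𝒪[K]) ≤ scaleLattice (ϖ ^ (d₀ - 1)) w.1) ∧ ∃ y ∈ w.1, ∃ a :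 K, Valued.v a = 1 ∧ Valued.v ((ϖ ^ (d₀ - 2))⁻¹ * pairing σ ((StdForm.antidiagonal 3).over K) y ((((γ : GL (Fin 3) K) : Matrix (Fin 3) (Fin 3) K) - 1) *ᵥ y) - (c₁) * a ^ 2) < 1)}).ncard = q * PP)
    (hPM : ∑ v ∈ sR, ({w | w ∈ {w | ∃ c, ((latticeGraph σ ϖ ((StdForm.antidiagonal 3).over K)).Adj v c ∧ (latticeGraph σ ϖ ((StdForm.antidiagonal 3).over K)).dist ⟨stdLattice K 3, 0, isSelfDualLattice_stdLattice_three_of_v hϖ⟩ c = (latticeGraph σ ϖ ((StdForm.antidiagonal 3).over K)).dist ⟨stdLattice K 3, 0, isSelfDualLattice_stdLattice_three_of_v hϖ⟩ v + 1 ∧ latticeGraphIso σ ϖ ((StdForm.antidiagonal 3).over K) γ c = c) ∧ ((latticeGraph σ ϖ ((StdForm.antidiagonal 3).over K)).Adj c w ∧ (latticeGraph σ ϖ ((StdForm.antidiagonal 3).over K)).dist ⟨stdLattice K 3, 0, isSelfDualLattice_stdLattice_three_of_v hϖ⟩ w = (latticeGraph σ ϖ ((StdForm.antidiagonal 3).over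 K)).dist ⟨stdLattice K 3, 0, isSelfDualLattice_stdLattice_three_of_v hϖ⟩ c + 1 ∧ latticeGraphIso σ ϖ ((StdForm.antidiagonal 3).over K) γ w = w)} ∧ (¬ w.1.map ((Matrix.toLin' (((γ : GL (Fin 3) K) : Matrix (Fin 3) (Fin 3) K) - 1)).restrictScalars 𝒪[K]) ≤ scaleLattice (ϖ ^ d₀) w.1 ∧ (w.1.map ((Matrix.toLin' (((γ : GL (Fin 3) K) : Matrix (Fin 3) (Fin 3) K) - 1)).restrictScalars 𝒪[K]) ≤ scaleLattice (ϖ ^ (d₀ - 2)) w.1 ∧ ¬ w.1.map ((Matrix.toLin' (((γ : GL (Fin 3) K) : Matrix (Fin 3) (Fin 3) K) - 1)).restrictScalars 𝒪[K]) ≤ scaleLattice (ϖ ^ (d₀ - 1)) w.1) ∧ ¬ (∃ y ∈ w.1, ∃ a : K, Valued.v a = 1 ∧ Valued.v ((ϖ ^ (d₀ - 2))⁻¹ * pairing σ ((StdForm.antidiagonal 3).over K) y ((((γ : GL (Fin 3) K) : Matrix (Fin 3) (Fin 3) K) - 1) *ᵥ y) - (c₁) * a ^ 2) < 1))}).ncard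 = q * PM) (j : Fin 5),
      ({M : Submodule 𝒪[K] (Fin 3 → K) | IsSelfDualLattice σ ϖ ((StdForm.antidiagonal 3).over K) M ∧ mapGL (γ : GL (Fin 3) K) M = M ∧
        (![¬ M.map ((Matrix.toLin' (((γ : GL (Fin 3) K) : Matrix (Fin 3) (Fin 3) K) - 1)).restrictScalars 𝒪[K]) ≤ scaleLattice ϖ M,
                  M.map ((Matrix.toLin' (((γ : GL (Fin 3) K) : Matrix (Fin 3) (Fin 3) K) - 1)).restrictScalars 𝒪[K]) ≤ scaleLattice ϖ M ∧
                    ¬ M.map ((Matrix.toLin' (((γ : GL (Fin 3) K) : Matrix (Fin 3) (Fin 3) K) - 1)).restrictScalars 𝒪[K]) ≤ scaleLattice (ϖ ^ 2) M ∧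
                    ¬ M.map ((Matrix.toLin' ((((γ : GL (Fin 3) K) : Matrix (Fin 3) (Fin 3) K) - 1) ^ 2)).restrictScalars 𝒪[K]) ≤ scaleLattice (ϖ ^ 3) M,
                  M.map ((Matrix.toLin' (((γ : GL (Fin 3) K) : Matrix (Fin 3) (Fin 3) K) - 1)).restrictScalars 𝒪[K]) ≤ scaleLattice ϖ M ∧
                    ¬ M.map ((Matrix.toLin' (((γ : GL (Fin 3) K) : Matrix (Fin 3) (Fin 3) K) - 1)).restrictScalars 𝒪[K]) ≤ scaleLattice (ϖ ^ 2) M ∧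
                    M.map ((Matrix.toLin' ((((γ : GL (Fin 3) K) : Matrix (Fin 3) (Fin 3) K) - 1) ^ 2)).restrictScalars 𝒪[K]) ≤ scaleLattice (ϖ ^ 3) M ∧
                    ∃ y ∈ M, ∃ a : K, Valued.v a = 1 ∧
                      Valued.v (ϖ⁻¹ * pairing σ (((StdForm.antidiagonal 3).over K)) y
                        ((((γ : GL (Fin 3) K) : Matrix (Fin 3) (Fin 3) K) - 1) *ᵥ y) - c₁ * a ^ 2) < 1,
                  M.map ((Matrix.toLin' (((γ : GL (Fin 3) K) : Matrix (Fin 3) (Fin 3) K) - 1)).restrictScalars 𝒪[K]) ≤ scaleLattice ϖ M ∧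
                    ¬ M.map ((Matrix.toLin' (((γ : GL (Fin 3) K) : Matrix (Fin 3) (Fin 3) K) - 1)).restrictScalars 𝒪[K]) ≤ scaleLattice (ϖ ^ 2) M ∧
                    M.map ((Matrix.toLin' ((((γ : GL (Fin 3) K) : Matrix (Fin 3) (Fin 3) K) - 1) ^ 2)).restrictScalars 𝒪[K]) ≤ scaleLattice (ϖ ^ 3) M ∧
                    ∃ y ∈ M, ∃ a : K, Valued.v a = 1 ∧
                      Valued.v (ϖ⁻¹ * pairing σ (((StdForm.antidiagonal 3).over K)) y
                        ((((γ : GL (Fin 3) K) : Matrix (Fin 3) (Fin 3) K) - 1) *ᵥ y) - c₁ * ε * a ^ 2) < 1,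
                  M.map ((Matrix.toLin' (((γ : GL (Fin 3) K) : Matrix (Fin 3) (Fin 3) K) - 1)).restrictScalars 𝒪[K]) ≤ scaleLattice (ϖ ^ 2) M] : Fin 5 → Prop) j}.ncard) =
      (if IsSquare (-1 : 𝓀[K]) then
          (sR.card • (![0, 0, 0, 0, 1] : Fin 5 → ℕ) + (q * PE) • (![q ^ (3 * mA + 3), q ^ (3 * mA + 2), q.choose 2 * q ^ (2 * mA) * ∑ i ∈ Finset.range mA, q ^ i, q.choose 2 * q ^ (2 * mA) * ∑ i ∈ Finset.range mA, q ^ i,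
          ∑ i ∈ Finset.range (mA + 1), q ^ (2 * i) + ∑ i ∈ Finset.range mA, q ^ (2 * mA + 1 + i)] : Fin 5 → ℕ) + (q * PP) • (![0, 0, q ^ (2 * mA), 0, ∑ i ∈ Finset.range mA, q ^ (2 * i)] : Fin 5 → ℕ) + (q * PM) • (![0, 0, 0, q ^ (2 * mA), ∑ i ∈ Finset.range mA, q ^ (2 * i)] : Fin 5 → ℕ)) j
        else
          (sR.card • (![0, 0, 0, 0, 1] : Fin 5 → ℕ) + (q * PE) • (![q ^ (3 * mA + 3), q ^ (3 * mA + 2), q.choose 2 * q ^ (2 * mA) * ∑ i ∈ Finset.range mA, q ^ i, q.choose 2 * q ^ (2 * mA) * ∑ i ∈ Finset.range mA, q ^ i,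
          ∑ i ∈ Finset.range (mA + 1), q ^ (2 * i) + ∑ i ∈ Finset.range mA, q ^ (2 * mA + 1 + i)] : Fin 5 → ℕ) + (q * PP) • (![0, 0, if Even mA then q ^ (2 * mA) else 0, if Even mA then 0 else q ^ (2 * mA), ∑ i ∈ Finset.range mA, q ^ (2 * i)] : Fin 5 → ℕ) + (q * PM) • (![0, 0, if Even mA then 0 else q ^ (2 * mA), if Even mA then q ^ (2 * mA) else 0, ∑ i ∈ Finset.range mA, q ^ (2 * i)] : Fin 5 → ℕ)) j))
    (hHyp : ∀ [ValuativeRel K] [(Valued.v : Valuation K ℤᵐ⁰).Compatible]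
    (hσ : ∀ x, σ (σ x) = x) (hvσ : ∀ a, Valued.v (σ a) = Valued.v a) (hσϖ : σ ϖ = -ϖ)
    (hϖ : Valued.v ϖ = WithZero.exp (-1 : ℤ)) (hres : ∀ x : K, Valued.v x ≤ 1 → Valued.v (σ x - x) < 1) (h2 : Valued.v (2 : K) = 1)
    (hnorm : ∀ u : K, σ u = u → Valued.v (u - 1) < 1 → ∃ z : K, z * σ z = u ∧ Valued.v (z - 1) ≤ Valued.v (u - 1)) [Fintype 𝓀[K]] [DecidableEq 𝓀[K]]
    {γ : unitaryGroupOfForm σ ((StdForm.antidiagonal 3).over K)} (hγ0 : γ ∈ unitaryInt σ ((StdForm.antidiagonal 3).over K))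
    (d : Fin 3 → K) (hd : ∀ i, Valued.v (d i) = 1) (hdσ : ∀ i, σ (d i) = d i)
    (A : GL (Fin 3) K) (hA : IsIntMatrix (A : Matrix (Fin 3) (Fin 3) K)) (hA' : IsIntMatrix ((A⁻¹ : GL (Fin 3) K) : Matrix (Fin 3) (Fin 3) K))
    (hdA : Matrix.diagonal d = (-(Matrix.diagonal d).det) • formCongr σ A ((StdForm.antidiagonal 3).over K))
    (s : Fin 3 → K) (hs1 : s 1 = 1) (hsv : ∀ i, Valued.v (s i) = 1) (hsσ : ∀ i, s i * σ (s i) = 1)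
    (hγA : ((γ : GL (Fin 3) K) : Matrix (Fin 3) (Fin 3) K) = (A : Matrix (Fin 3) (Fin 3) K) * Matrix.diagonal s * ((A⁻¹ : GL (Fin 3) K) : Matrix (Fin 3) (Fin 3) K))
    (i₀ : Fin 3) {d₀ : ℕ} (hd3 : 3 ≤ d₀) (he : ∀ i, Valued.v (s i - 1) ≤ Valued.v ϖ ^ d₀)
    (hiso : ∀ j, j ≠ i₀ → Valued.v (s i₀ - s j) = Valued.v ϖ ^ d₀) (hclose : ∀ j k, j ≠ i₀ → k ≠ i₀ → Valued.v (s j - s k) ≤ Valued.v ϖ ^ (d₀ + 2))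
    (hreg : ∀ i j, i ≠ j → s i ≠ s j)
    (mA : ℕ) (hmA : d₀ = 2 * mA + 3)
    (c₁ ε : K) (hc₁ : Valued.v c₁ = 1) (hεv : Valued.v ε = 1) (hε : ∀ z : K, Valued.v z ≤ 1 → Valued.v (z ^ 2 - ε) = 1)
    (q : ℕ) (hq : q = Fintype.card 𝓀[K])
    (sR : Finset {M : Submodule 𝒪[K] (Fin 3 → K) // IsVertex σ ϖ ((StdForm.antidiagonal 3).over K) M}) (hsR : ∀ v, v ∈ sR ↔ v ∈ {v : {M : Submodule 𝒪[K] (Fin 3 → K) // IsVertex σ ϖ ((StdForm.antidiagonal 3).over K) M} | latticeGraphIso σ ϖ ((StdForm.antidiagonal 3).over K) γ v = v ∧ IsSelfDualLattice σ ϖ ((StdForm.antidiagonal 3).over K) v.1 ∧ v.1.map ((Matrix.toLin' (((γ : GL (Fin 3) K) : Matrix (Fin 3) (Fin 3) K) - 1)).restrictScalars 𝒪[K]) ≤ scaleLattice (ϖ ^ d₀) v.1})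
    (s' : ℕ) (hs' : 1 ≤ s') (hgap : ∀ j k, j ≠ i₀ → k ≠ i₀ → j ≠ k → Valued.v (s j - s k) = Valued.v ϖ ^ (d₀ + 2 * s'))
    {j k : Fin 3} (hj : j ≠ i₀) (hk : k ≠ i₀) (hjk : j ≠ k)
    (hhyp : ∃ t : K, Valued.v t = 1 ∧ Valued.v (d j + t * σ t * d k) < 1),
      sR.card = 1 + 2 * q * ∑ i ∈ Finset.range s', q ^ i ∧
    ∑ v ∈ sR, ({w | w ∈ {w | ∃ c, ((latticeGraph σ ϖ ((StdForm.antidiagonal 3).over K)).Adj v c ∧ (latticeGraph σ ϖ ((StdForm.antidiagonal 3).over K)).dist ⟨stdLattice K 3, 0, isSelfDualLattice_stdLattice_three_of_v hϖ⟩ c = (latticeGraph σ ϖ ((StdForm.antidiagonal 3).over K)).dist ⟨stdLattice K 3, 0, isSelfDualLattice_stdLattice_three_of_v hϖ⟩ v + 1 ∧ latticeGraphIso σ ϖ ((StdForm.antidiagonal 3).over K) γ c = c) ∧ ((latticeGraph σ ϖ ((StdForm.antidiagonal 3).over K)).Adj c w ∧ (latticeGraph σ ϖ ((StdForm.antidiagonal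 3).over K)).dist ⟨stdLattice K 3, 0, isSelfDualLattice_stdLattice_three_of_v hϖ⟩ w = (latticeGraph σ ϖ ((StdForm.antidiagonal 3).over K)).dist ⟨stdLattice K 3, 0, isSelfDualLattice_stdLattice_three_of_v hϖ⟩ c + 1 ∧ latticeGraphIso σ ϖ ((StdForm.antidiagonal 3).over K) γ w = w)} ∧ (¬ w.1.map ((Matrix.toLin' (((γ : GL (Fin 3) K) : Matrix (Fin 3) (Fin 3) K) - 1)).restrictScalars 𝒪[K]) ≤ scaleLattice (ϖ ^ d₀) w.1 ∧ (w.1.map ((Matrix.toLin' (((γ : GL (Fin 3) K) : Matrix (Fin 3) (Fin 3) K) - 1)).restrictScalars 𝒪[K]) ≤ scaleLattice (ϖ ^ (d₀ - 1)) w.1 ∧ ¬ w.1.map ((Matrix.toLin' (((γ : GL (Fin 3) K) : Matrix (Fin 3) (Fin 3) K) - 1)).restrictScalars 𝒪[K]) ≤ scaleLattice (ϖ ^ d₀) w.1))}).ncard = q * (if (∃ t : K, Valued.v t = 1 ∧ Valued.v (t ^ 2 - ((-1) ^ (s' + 1) * ((ϖ ^ d₀)⁻¹ * (s i₀ - s j))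 * ((ϖ ^ (d₀ + 2 * s'))⁻¹ * (s k - s j)) * (d i₀ * d k))) < 1) then 4 * q ^ s' else 0) ∧
    ∑ v ∈ sR, ({w | w ∈ {w | ∃ c, ((latticeGraph σ ϖ ((StdForm.antidiagonal 3).over K)).Adj v c ∧ (latticeGraph σ ϖ ((StdForm.antidiagonal 3).over K)).dist ⟨stdLattice K 3, 0, isSelfDualLattice_stdLattice_three_of_v hϖ⟩ c = (latticeGraph σ ϖ ((StdForm.antidiagonal 3).over K)).dist ⟨stdLattice K 3, 0, isSelfDualLattice_stdLattice_three_of_v hϖ⟩ v + 1 ∧ latticeGraphIso σ ϖ ((StdForm.antidiagonal 3).over K) γ c = c) ∧ ((latticeGraph σ ϖ ((StdForm.antidiagonal 3).over K)).Adj c w ∧ (latticeGraph σ ϖ ((StdForm.antidiagonal 3).over K)).dist ⟨stdLattice K 3, 0, isSelfDualLattice_stdLattice_three_of_v hϖ⟩ w = (latticeGraph σ ϖ ((StdForm.antidiagonal 3).over K)).dist ⟨stdLattice K 3, 0, isSelfDualLattice_stdLattice_three_of_v hϖ⟩ c + 1 ∧ latticeGraphIso σ ϖ ((StdForm.antidiagonal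 3).over K) γ w = w)} ∧ (¬ w.1.map ((Matrix.toLin' (((γ : GL (Fin 3) K) : Matrix (Fin 3) (Fin 3) K) - 1)).restrictScalars 𝒪[K]) ≤ scaleLattice (ϖ ^ d₀) w.1 ∧ (w.1.map ((Matrix.toLin' (((γ : GL (Fin 3) K) : Matrix (Fin 3) (Fin 3) K) - 1)).restrictScalars 𝒪[K]) ≤ scaleLattice (ϖ ^ (d₀ - 2)) w.1 ∧ ¬ w.1.map ((Matrix.toLin' (((γ : GL (Fin 3) K) : Matrix (Fin 3) (Fin 3) K) - 1)).restrictScalars 𝒪[K]) ≤ scaleLattice (ϖ ^ (d₀ - 1)) w.1) ∧ ∃ y ∈ w.1, ∃ a : K, Valued.v a = 1 ∧ Valued.v ((ϖ ^ (d₀ - 2))⁻¹ * pairing σ ((StdForm.antidiagonal 3).over K) y ((((γ : GL (Fin 3) K) : Matrix (Fin 3) (Fin 3) K) - 1) *ᵥ y) - (c₁) * a ^ 2) < 1)}).ncard = q * (if (∃ a : K, Valued.v a = 1 ∧ Valued.v (((ϖ ^ d₀)⁻¹ * (s i₀ - s j) * (d i₀ * (-(Matrix.diagonal d).det)⁻¹))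 + c₁ * a ^ 2) < 1) then (if (∃ t : K, Valued.v t = 1 ∧ Valued.v (t ^ 2 - ((-1) ^ (s' + 1) * ((ϖ ^ d₀)⁻¹ * (s i₀ - s j)) * ((ϖ ^ (d₀ + 2 * s'))⁻¹ * (s k - s j)) * (d i₀ * d k))) < 1) then (q - 1) * (1 + 2 * q * ∑ i ∈ Finset.range (s' - 1), q ^ i) + q ^ s' * (q - 3) else (q - 1) * (1 + 2 * q * ∑ i ∈ Finset.range (s' - 1), q ^ i) + q ^ s' * (q - 1)) else (if (∃ t : K, Valued.v t = 1 ∧ Valued.v (t ^ 2 - ((-1) ^ (s' + 1) * ((ϖ ^ d₀)⁻¹ * (s i₀ - s j)) * ((ϖ ^ (d₀ + 2 * s'))⁻¹ * (s k - s j)) * (d i₀ * d k))) < 1) then q ^ s' * (q - 1) else q ^ s' * (q + 1))) ∧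
    ∑ v ∈ sR, ({w | w ∈ {w | ∃ c, ((latticeGraph σ ϖ ((StdForm.antidiagonal 3).over K)).Adj v c ∧ (latticeGraph σ ϖ ((StdForm.antidiagonal 3).over K)).dist ⟨stdLattice K 3, 0, isSelfDualLattice_stdLattice_three_of_v hϖ⟩ c = (latticeGraph σ ϖ ((StdForm.antidiagonal 3).over K)).dist ⟨stdLattice K 3, 0, isSelfDualLattice_stdLattice_three_of_v hϖ⟩ v + 1 ∧ latticeGraphIso σ ϖ ((StdForm.antidiagonal 3).over K) γ c = c) ∧ ((latticeGraph σ ϖ ((StdForm.antidiagonal 3).over K)).Adj c w ∧ (latticeGraph σ ϖ ((StdForm.antidiagonal 3).over K)).dist ⟨stdLattice K 3, 0, isSelfDualLattice_stdLattice_three_of_v hϖ⟩ w = (latticeGraph σ ϖ ((StdForm.antidiagonal 3).over K)).dist ⟨stdLattice K 3, 0, isSelfDualLattice_stdLattice_three_of_v hϖ⟩ c + 1 ∧ latticeGraphIso σ ϖ ((StdForm.antidiagonal 3).over K) γ w = w)} ∧ (¬ w.1.map ((Matrix.toLin' (((γ : GL (Fin 3) K) : Matrix (Fin 3) (Fin 3)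 K) - 1)).restrictScalars 𝒪[K]) ≤ scaleLattice (ϖ ^ d₀) w.1 ∧ (w.1.map ((Matrix.toLin' (((γ : GL (Fin 3) K) : Matrix (Fin 3) (Fin 3) K) - 1)).restrictScalars 𝒪[K]) ≤ scaleLattice (ϖ ^ (d₀ - 2)) w.1 ∧ ¬ w.1.map ((Matrix.toLin' (((γ : GL (Fin 3) K) : Matrix (Fin 3) (Fin 3) K) - 1)).restrictScalars 𝒪[K]) ≤ scaleLattice (ϖ ^ (d₀ - 1)) w.1) ∧ ¬ (∃ y ∈ w.1, ∃ a : K, Valued.v a = 1 ∧ Valued.v ((ϖ ^ (d₀ - 2))⁻¹ * pairing σ ((StdForm.antidiagonal 3).over K) y ((((γ : GL (Fin 3) K) : Matrix (Fin 3) (Fin 3) K) - 1) *ᵥ y) - (c₁) * a ^ 2) < 1))}).ncard = q * (if (∃ a : K, Valued.v a = 1 ∧ Valued.v (((ϖ ^ d₀)⁻¹ * (s i₀ - s j) * (d i₀ * (-(Matrix.diagonal d).det)⁻¹)) + c₁ * a ^ 2) < 1) then (if (∃ t : K, Valued.v t = 1 ∧ Valued.v (t ^ 2 - ((-1) ^ (s'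 + 1) * ((ϖ ^ d₀)⁻¹ * (s i₀ - s j)) * ((ϖ ^ (d₀ + 2 * s'))⁻¹ * (s k - s j)) * (d i₀ * d k))) < 1) then q ^ s' * (q - 1) else q ^ s' * (q + 1)) else (if (∃ t : K, Valued.v t = 1 ∧ Valued.v (t ^ 2 - ((-1) ^ (s' + 1) * ((ϖ ^ d₀)⁻¹ * (s i₀ - s j)) * ((ϖ ^ (d₀ + 2 * s'))⁻¹ * (s k - s j)) * (d i₀ * d k))) < 1) then (q - 1) * (1 + 2 * q * ∑ i ∈ Finset.range (s' - 1), q ^ i) + q ^ s' * (q - 3) else (q - 1) * (1 + 2 * q * ∑ i ∈ Finset.range (s' - 1), q ^ i) + q ^ s' * (q - 1))))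
    (hBare : ∀ [ValuativeRel K] [(Valued.v : Valuation K ℤᵐ⁰).Compatible]
    (hσ : ∀ x, σ (σ x) = x) (hvσ : ∀ a, Valued.v (σ a) = Valued.v a) (hσϖ : σ ϖ = -ϖ)
    (hϖ : Valued.v ϖ = WithZero.exp (-1 : ℤ)) (hres : ∀ x : K, Valued.v x ≤ 1 → Valued.v (σ x - x) < 1) (h2 : Valued.v (2 : K) = 1)
    (hnorm : ∀ u : K, σ u = u → Valued.v (u - 1) < 1 → ∃ z : K, z * σ z = u ∧ Valued.v (z - 1) ≤ Valued.v (u - 1)) [Fintype 𝓀[K]] [DecidableEq 𝓀[K]]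
    {γ : unitaryGroupOfForm σ ((StdForm.antidiagonal 3).over K)} (hγ0 : γ ∈ unitaryInt σ ((StdForm.antidiagonal 3).over K))
    (d : Fin 3 → K) (hd : ∀ i, Valued.v (d i) = 1) (hdσ : ∀ i, σ (d i) = d i)
    (A : GL (Fin 3) K) (hA : IsIntMatrix (A : Matrix (Fin 3) (Fin 3) K)) (hA' : IsIntMatrix ((A⁻¹ : GL (Fin 3) K) : Matrix (Fin 3) (Fin 3) K))
    (hdA : Matrix.diagonal d = (-(Matrix.diagonal d).det) • formCongr σ A ((StdForm.antidiagonal 3).over K))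
    (s : Fin 3 → K) (hs1 : s 1 = 1) (hsv : ∀ i, Valued.v (s i) = 1) (hsσ : ∀ i, s i * σ (s i) = 1)
    (hγA : ((γ : GL (Fin 3) K) : Matrix (Fin 3) (Fin 3) K) = (A : Matrix (Fin 3) (Fin 3) K) * Matrix.diagonal s * ((A⁻¹ : GL (Fin 3) K) : Matrix (Fin 3) (Fin 3) K))
    (i₀ : Fin 3) {d₀ : ℕ} (hd3 : 3 ≤ d₀) (he : ∀ i, Valued.v (s i - 1) ≤ Valued.v ϖ ^ d₀)
    (hiso : ∀ j, j ≠ i₀ → Valued.v (s i₀ - s j) = Valued.v ϖ ^ d₀) (hclose : ∀ j k, j ≠ i₀ → k ≠ i₀ → Valued.v (s j - s k) ≤ Valued.v ϖ ^ (d₀ + 2))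
    (hreg : ∀ i j, i ≠ j → s i ≠ s j)
    (mA : ℕ) (hmA : d₀ = 2 * mA + 3)
    (c₁ ε : K) (hc₁ : Valued.v c₁ = 1) (hεv : Valued.v ε = 1) (hε : ∀ z : K, Valued.v z ≤ 1 → Valued.v (z ^ 2 - ε) = 1)
    (q : ℕ) (hq : q = Fintype.card 𝓀[K])
    (sR : Finset {M : Submodule 𝒪[K] (Fin 3 → K) // IsVertex σ ϖ ((StdForm.antidiagonal 3).over K) M}) (hsR : ∀ v, v ∈ sR ↔ v ∈ {v : {M : Submodule 𝒪[K] (Fin 3 → K) // IsVertex σ ϖ ((StdForm.antidiagonal 3).over K) M} | latticeGraphIso σ ϖ ((StdForm.antidiagonal 3).over K) γ v = v ∧ IsSelfDualLattice σ ϖ ((StdForm.antidiagonal 3).over K) v.1 ∧ v.1.map ((Matrix.toLin' (((γ : GL (Fin 3) K) : Matrix (Fin 3) (Fin 3) K) - 1)).restrictScalars 𝒪[K]) ≤ scaleLattice (ϖ ^ d₀) v.1})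
    (s' : ℕ) (hs' : 1 ≤ s') (hgap : ∀ j k, j ≠ i₀ → k ≠ i₀ → j ≠ k → Valued.v (s j - s k) = Valued.v ϖ ^ (d₀ + 2 * s'))
    {j k : Fin 3} (hj : j ≠ i₀) (hk : k ≠ i₀) (hjk : j ≠ k)
    (haniso : ¬ ∃ t : K, Valued.v t = 1 ∧ Valued.v (d j + t * σ t * d k) < 1),
      sR.card = 1 ∧
    ∑ v ∈ sR, ({w | w ∈ {w | ∃ c, ((latticeGraph σ ϖ ((StdForm.antidiagonal 3).over K)).Adj v c ∧ (latticeGraph σ ϖ ((StdForm.antidiagonal 3).over K)).dist ⟨stdLattice K 3, 0, isSelfDualLattice_stdLattice_three_of_v hϖ⟩ c = (latticeGraph σ ϖ ((StdForm.antidiagonal 3).over K)).dist ⟨stdLattice K 3, 0, isSelfDualLattice_stdLattice_three_of_v hϖ⟩ v + 1 ∧ latticeGraphIso σ ϖ ((StdForm.antidiagonal 3).over K) γ c = c) ∧ ((latticeGraph σ ϖ ((StdForm.antidiagonal 3).over K)).Adj c w ∧ (latticeGraph σ ϖ ((StdForm.antidiagonal 3).over K)).dist ⟨stdLattice K 3,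 0, isSelfDualLattice_stdLattice_three_of_v hϖ⟩ w = (latticeGraph σ ϖ ((StdForm.antidiagonal 3).over K)).dist ⟨stdLattice K 3, 0, isSelfDualLattice_stdLattice_three_of_v hϖ⟩ c + 1 ∧ latticeGraphIso σ ϖ ((StdForm.antidiagonal 3).over K) γ w = w)} ∧ (¬ w.1.map ((Matrix.toLin' (((γ : GL (Fin 3) K) : Matrix (Fin 3) (Fin 3) K) - 1)).restrictScalars 𝒪[K]) ≤ scaleLattice (ϖ ^ d₀) w.1 ∧ (w.1.map ((Matrix.toLin' (((γ : GL (Fin 3) K) : Matrix (Fin 3) (Fin 3) K) - 1)).restrictScalars 𝒪[K]) ≤ scaleLattice (ϖ ^ (d₀ - 1)) w.1 ∧ ¬ w.1.map ((Matrix.toLin' (((γ : GL (Fin 3) K) : Matrix (Fin 3) (Fin 3) K) - 1)).restrictScalars 𝒪[K]) ≤ scaleLattice (ϖ ^ d₀) w.1))}).ncard = q * 0 ∧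
    ∑ v ∈ sR, ({w | w ∈ {w | ∃ c, ((latticeGraph σ ϖ ((StdForm.antidiagonal 3).over K)).Adj v c ∧ (latticeGraph σ ϖ ((StdForm.antidiagonal 3).over K)).dist ⟨stdLattice K 3, 0, isSelfDualLattice_stdLattice_three_of_v hϖ⟩ c = (latticeGraph σ ϖ ((StdForm.antidiagonal 3).over K)).dist ⟨stdLattice K 3, 0, isSelfDualLattice_stdLattice_three_of_v hϖ⟩ v + 1 ∧ latticeGraphIso σ ϖ ((StdForm.antidiagonal 3).over K) γ c = c) ∧ ((latticeGraph σ ϖ ((StdForm.antidiagonal 3).over K)).Adj c w ∧ (latticeGraph σ ϖ ((StdForm.antidiagonal 3).over K)).dist ⟨stdLattice K 3, 0, isSelfDualLattice_stdLattice_three_of_v hϖ⟩ w = (latticeGraph σ ϖ ((StdForm.antidiagonal 3).over K)).dist ⟨stdLattice K 3, 0, isSelfDualLattice_stdLattice_three_of_v hϖ⟩ c + 1 ∧ latticeGraphIso σ ϖ ((StdForm.antidiagonal 3).over K) γ w = w)} ∧ (¬ w.1.map ((Matrix.toLin' (((γ : GL (Fin 3) K) : Matrix (Fin 3) (Fin 3)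 K) - 1)).restrictScalars 𝒪[K]) ≤ scaleLattice (ϖ ^ d₀) w.1 ∧ (w.1.map ((Matrix.toLin' (((γ : GL (Fin 3) K) : Matrix (Fin 3) (Fin 3) K) - 1)).restrictScalars 𝒪[K]) ≤ scaleLattice (ϖ ^ (d₀ - 2)) w.1 ∧ ¬ w.1.map ((Matrix.toLin' (((γ : GL (Fin 3) K) : Matrix (Fin 3) (Fin 3) K) - 1)).restrictScalars 𝒪[K]) ≤ scaleLattice (ϖ ^ (d₀ - 1)) w.1) ∧ ∃ y ∈ w.1, ∃ a : K, Valued.v a = 1 ∧ Valued.v ((ϖ ^ (d₀ - 2))⁻¹ * pairing σ ((StdForm.antidiagonal 3).over K) y ((((γ : GL (Fin 3) K) : Matrix (Fin 3) (Fin 3) K) - 1) *ᵥ y) - (c₁) * a ^ 2) < 1)}).ncard = q * (if (∃ a : K, Valued.v a = 1 ∧ Valued.v (((ϖ ^ d₀)⁻¹ * (s i₀ - s j) * (d i₀ * (-(Matrix.diagonal d).det)⁻¹)) + c₁ * a ^ 2) < 1) then q + 1 else 0) ∧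
    ∑ v ∈ sR, ({w | w ∈ {w | ∃ c, ((latticeGraph σ ϖ ((StdForm.antidiagonal 3).over K)).Adj v c ∧ (latticeGraph σ ϖ ((StdForm.antidiagonal 3).over K)).dist ⟨stdLattice K 3, 0, isSelfDualLattice_stdLattice_three_of_v hϖ⟩ c = (latticeGraph σ ϖ ((StdForm.antidiagonal 3).over K)).dist ⟨stdLattice K 3, 0, isSelfDualLattice_stdLattice_three_of_v hϖ⟩ v + 1 ∧ latticeGraphIso σ ϖ ((StdForm.antidiagonal 3).over K) γ c = c) ∧ ((latticeGraph σ ϖ ((StdForm.antidiagonal 3).over K)).Adj c w ∧ (latticeGraph σ ϖ ((StdForm.antidiagonal 3).over K)).dist ⟨stdLattice K 3, 0, isSelfDualLattice_stdLattice_three_of_v hϖ⟩ w = (latticeGraph σ ϖ ((StdForm.antidiagonal 3).over K)).dist ⟨stdLattice K 3, 0, isSelfDualLattice_stdLattice_three_of_v hϖ⟩ c + 1 ∧ latticeGraphIso σ ϖ ((StdForm.antidiagonal 3).over K) γ w = w)} ∧ (¬ w.1.map ((Matrix.toLin' (((γ : GL (Fin 3) K) : Matrix (Fin 3) (Fin 3)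 K) - 1)).restrictScalars 𝒪[K]) ≤ scaleLattice (ϖ ^ d₀) w.1 ∧ (w.1.map ((Matrix.toLin' (((γ : GL (Fin 3) K) : Matrix (Fin 3) (Fin 3) K) - 1)).restrictScalars 𝒪[K]) ≤ scaleLattice (ϖ ^ (d₀ - 2)) w.1 ∧ ¬ w.1.map ((Matrix.toLin' (((γ : GL (Fin 3) K) : Matrix (Fin 3) (Fin 3) K) - 1)).restrictScalars 𝒪[K]) ≤ scaleLattice (ϖ ^ (d₀ - 1)) w.1) ∧ ¬ (∃ y ∈ w.1, ∃ a : K, Valued.v a = 1 ∧ Valued.v ((ϖ ^ (d₀ - 2))⁻¹ * pairing σ ((StdForm.antidiagonal 3).over K) y ((((γ : GL (Fin 3) K) : Matrix (Fin 3) (Fin 3) K) - 1) *ᵥ y) - (c₁) * a ^ 2) < 1))}).ncard = q * (if (∃ a : K, Valued.v a = 1 ∧ Valued.v (((ϖ ^ d₀)⁻¹ * (s i₀ - s j) * (d i₀ * (-(Matrix.diagonal d).det)⁻¹)) + c₁ * a ^ 2) < 1) then 0 else q + 1))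
    (i₀ j k : Fin 3) (hj : j ≠ i₀) (hk : k ≠ i₀) (hjk : j ≠ k) {d₀ : ℕ} (hd3 : 3 ≤ d₀) (mA : ℕ) (hmA : d₀ = 2 * mA + 3) (s' : ℕ) (hs' : 1 ≤ s')
    (he : ∀ i, Valued.v ((![α / u, 1, γ / u] : Fin 3 → K) i - 1) ≤ Valued.v ϖ ^ d₀)
    (hiso : ∀ j', j' ≠ i₀ → Valued.v ((![α / u, 1, γ / u] : Fin 3 → K) i₀ - (![α / u, 1, γ / u] : Fin 3 → K) j') = Valued.v ϖ ^ d₀)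
    (hclose : ∀ j' k', j' ≠ i₀ → k' ≠ i₀ → Valued.v ((![α / u, 1, γ / u] : Fin 3 → K) j' - (![α / u, 1, γ / u] : Fin 3 → K) k') ≤ Valued.v ϖ ^ (d₀ + 2))
    (hreg : ∀ i j', i ≠ j' → (![α / u, 1, γ / u] : Fin 3 → K) i ≠ (![α / u, 1, γ / u] : Fin 3 → K) j')
    (hgap : ∀ j' k', j' ≠ i₀ → k' ≠ i₀ → j' ≠ k' → Valued.v ((![α / u, 1, γ / u] : Fin 3 → K) j' - (![α / u, 1, γ / u] : Fin 3 → K) k') = Valued.v ϖ ^ (d₀ + 2 * s'))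
    (τ e' sg : 𝒪[K]) (hτ : (τ : K) = (ϖ ^ d₀)⁻¹ * ((![α / u, 1, γ / u] : Fin 3 → K) i₀ - (![α / u, 1, γ / u] : Fin 3 → K) j)) (hτv : Valued.v (τ : K) = 1)
    (he' : (e' : K) = (ϖ ^ (d₀ + 2 * s'))⁻¹ * ((![α / u, 1, γ / u] : Fin 3 → K) k - (![α / u, 1, γ / u] : Fin 3 → K) j)) (he'v : Valued.v (e' : K) = 1) (hsg : (sg : K) = (-1) ^ (s' + 1))
    (b : Fin 2 × Fin 2) (jj : Fin 5) :
    ((({M : Submodule (Valued.integer K) (Fin 3 → K) |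
              IsSelfDualLattice σ ϖ (Matrix.diagonal ![((ε : K)) ^ (b.1 : ℕ) * (u₀ : K), (ε : K) ^ (b.2 : ℕ) * (u₁ : K), (ε : K) ^ ((b.1 : ℕ) + (b.2 : ℕ)) * (u₂ : K)]) M ∧ mapGL T M = M ∧
                (![-- bd : `¬ (T − 1)M ⊆ ϖM`
                    ¬ M.map ((Matrix.toLin' ((T : Matrix (Fin 3) (Fin 3) K) - 1)).restrictScalars (Valued.integer K)) ≤ scaleLattice ϖ M,
                  -- reg : depth 1, rank 2
                    M.map ((Matrix.toLin' ((T : Matrix (Fin 3) (Fin 3) K) - 1)).restrictScalars (Valued.integer K)) ≤ scaleLattice ϖ M ∧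
                      ¬ M.map ((Matrix.toLin' ((T : Matrix (Fin 3) (Fin 3) K) - 1)).restrictScalars (Valued.integer K)) ≤ scaleLattice (ϖ ^ 2) M ∧
                      ¬ M.map ((Matrix.toLin' (((T : Matrix (Fin 3) (Fin 3) K) - 1) ^ 2)).restrictScalars (Valued.integer K)) ≤ scaleLattice (ϖ ^ 3) M,
                  -- 1s : depth 1, rank 1, class `c₀`
                    M.map ((Matrix.toLin' ((T : Matrix (Fin 3) (Fin 3) K) - 1)).restrictScalars (Valued.integer K)) ≤ scaleLattice ϖ M ∧
                      ¬ M.map ((Matrix.toLin' ((T : Matrix (Fin 3) (Fin 3) K) - 1)).restrictScalars (Valued.integer K)) ≤ scaleLattice (ϖ ^ 2) M ∧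
                      M.map ((Matrix.toLin' (((T : Matrix (Fin 3) (Fin 3) K) - 1) ^ 2)).restrictScalars (Valued.integer K)) ≤ scaleLattice (ϖ ^ 3) M ∧
                      ∃ y ∈ M, ∃ a : K, Valued.v a = 1 ∧
                        Valued.v (ϖ⁻¹ * pairing σ (Matrix.diagonal ![((ε : K)) ^ (b.1 : ℕ) * (u₀ : K), (ε : K) ^ (b.2 : ℕ) * (u₁ : K), (ε : K) ^ ((b.1 : ℕ) + (b.2 : ℕ)) * (u₂ : K)]) y
                          (((T : Matrix (Fin 3) (Fin 3) K) - 1) *ᵥ y) - (c₀ : K) * a ^ 2) < 1,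
                  -- 1n : depth 1, rank 1, class `c₀·ε`
                    M.map ((Matrix.toLin' ((T : Matrix (Fin 3) (Fin 3) K) - 1)).restrictScalars (Valued.integer K)) ≤ scaleLattice ϖ M ∧
                      ¬ M.map ((Matrix.toLin' ((T : Matrix (Fin 3) (Fin 3) K) - 1)).restrictScalars (Valued.integer K)) ≤ scaleLattice (ϖ ^ 2) M ∧
                      M.map ((Matrix.toLin' (((T : Matrix (Fin 3) (Fin 3) K) - 1) ^ 2)).restrictScalars (Valued.integer K)) ≤ scaleLattice (ϖ ^ 3) M ∧
                      ∃ y ∈ M, ∃ a : K, Valued.v a = 1 ∧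
                        Valued.v (ϖ⁻¹ * pairing σ (Matrix.diagonal ![((ε : K)) ^ (b.1 : ℕ) * (u₀ : K), (ε : K) ^ (b.2 : ℕ) * (u₁ : K), (ε : K) ^ ((b.1 : ℕ) + (b.2 : ℕ)) * (u₂ : K)]) y
                          (((T : Matrix (Fin 3) (Fin 3) K) - 1) *ᵥ y) - (c₀ : K) * (ε : K) * a ^ 2) < 1,
                  -- 0 : depth ≥ 2
                    M.map ((Matrix.toLin' ((T : Matrix (Fin 3) (Fin 3) K) - 1)).restrictScalars (Valued.integer K)) ≤ scaleLattice (ϖ ^ 2) M] : Fin 5 → Prop) jj}).ncard : ℕ) : ℚ) = (if IsSquare (-1 : 𝓀[K]) then (if quadraticChar 𝓀[K] (-(IsLocalRing.residue 𝒪[K] ((![ε ^ (b.1 : ℕ) * u₀, ε ^ (b.2 : ℕ) * u₁, ε ^ ((b.1 : ℕ) + (b.2 : ℕ)) * u₂] : Fin 3 → 𝒪[K]) j) * IsLocalRing.residue 𝒪[K] ((![ε ^ (b.1 : ℕ) * u₀, ε ^ (b.2 : ℕ) * u₁, ε ^ ((b.1 : ℕ) + (b.2 : ℕ)) * u₂]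 : Fin 3 → 𝒪[K]) k))) = 1 then ((1 + 2 * (Fintype.card 𝓀[K] : ℚ) * ∑ i ∈ Finset.range s', (Fintype.card 𝓀[K] : ℚ) ^ i) * (((![0, 0, 0, 0, 1] : Fin 5 → ℕ) jj : ℕ) : ℚ) + (Fintype.card 𝓀[K] : ℚ) * (if quadraticChar 𝓀[K] (IsLocalRing.residue 𝒪[K] (sg * τ * e' * (![ε ^ (b.1 : ℕ) * u₀, ε ^ (b.2 : ℕ) * u₁, ε ^ ((b.1 : ℕ) + (b.2 : ℕ)) * u₂] : Fin 3 → 𝒪[K]) i₀ * (![ε ^ (b.1 : ℕ) * u₀, ε ^ (b.2 : ℕ) * u₁, ε ^ ((b.1 : ℕ) + (b.2 : ℕ)) * u₂] : Fin 3 → 𝒪[K]) k)) = 1 then 4 * (Fintype.card 𝓀[K] : ℚ) ^ s' else 0) * (((![(Fintype.card 𝓀[K]) ^ (3 * mA + 3), (Fintype.card 𝓀[K]) ^ (3 * mA + 2), (Fintype.card 𝓀[K]).choose 2 * (Fintype.card 𝓀[K]) ^ (2 * mA) * ∑ i ∈ Finset.range mA, (Fintype.card 𝓀[K]) ^ i,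 (Fintype.card 𝓀[K]).choose 2 * (Fintype.card 𝓀[K]) ^ (2 * mA) * ∑ i ∈ Finset.range mA, (Fintype.card 𝓀[K]) ^ i,
          ∑ i ∈ Finset.range (mA + 1), (Fintype.card 𝓀[K]) ^ (2 * i) + ∑ i ∈ Finset.range mA, (Fintype.card 𝓀[K]) ^ (2 * mA + 1 + i)] : Fin 5 → ℕ) jj : ℕ) : ℚ) + (Fintype.card 𝓀[K] : ℚ) * (if quadraticChar 𝓀[K] (-(IsLocalRing.residue 𝒪[K] (τ * (![ε ^ (b.1 : ℕ) * u₀, ε ^ (b.2 : ℕ) * u₁, ε ^ ((b.1 : ℕ) + (b.2 : ℕ)) * u₂] : Fin 3 → 𝒪[K]) i₀) * (IsLocalRing.residue 𝒪[K] c₀)⁻¹)) = 1 then (if quadraticChar 𝓀[K] (IsLocalRing.residue 𝒪[K] (sg * τ * e' * (![ε ^ (b.1 : ℕ) * u₀, ε ^ (b.2 : ℕ) * u₁, ε ^ ((b.1 : ℕ) + (b.2 : ℕ)) * u₂] : Fin 3 → 𝒪[K]) i₀ * (![ε ^ (b.1 : ℕ) * u₀, ε ^ (b.2 : ℕ) *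 u₁, ε ^ ((b.1 : ℕ) + (b.2 : ℕ)) * u₂] : Fin 3 → 𝒪[K]) k)) = 1 then (((Fintype.card 𝓀[K] : ℚ) - 1) * (1 + 2 * (Fintype.card 𝓀[K] : ℚ) * ∑ i ∈ Finset.range (s' - 1), (Fintype.card 𝓀[K] : ℚ) ^ i) + (Fintype.card 𝓀[K] : ℚ) ^ s' * ((Fintype.card 𝓀[K] : ℚ) - 3)) else (((Fintype.card 𝓀[K] : ℚ) - 1) * (1 + 2 * (Fintype.card 𝓀[K] : ℚ) * ∑ i ∈ Finset.range (s' - 1), (Fintype.card 𝓀[K] : ℚ) ^ i) + (Fintype.card 𝓀[K] : ℚ) ^ s' * ((Fintype.card 𝓀[K] : ℚ) - 1))) else (if quadraticChar 𝓀[K] (IsLocalRing.residue 𝒪[K] (sg * τ * e' * (![ε ^ (b.1 : ℕ) * u₀, ε ^ (b.2 : ℕ) * u₁, ε ^ ((b.1 : ℕ) + (b.2 : ℕ)) * u₂] : Fin 3 → 𝒪[K]) i₀ * (![ε ^ (b.1 : ℕ) * u₀, ε ^ (b.2 : ℕ) * u₁, ε ^ ((b.1 : ℕ) + (b.2 : ℕ))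 * u₂] : Fin 3 → 𝒪[K]) k)) = 1 then ((Fintype.card 𝓀[K] : ℚ) ^ s' * ((Fintype.card 𝓀[K] : ℚ) - 1)) else ((Fintype.card 𝓀[K] : ℚ) ^ s' * ((Fintype.card 𝓀[K] : ℚ) + 1)))) * (((![0, 0, (Fintype.card 𝓀[K]) ^ (2 * mA), 0, ∑ i ∈ Finset.range mA, (Fintype.card 𝓀[K]) ^ (2 * i)] : Fin 5 → ℕ) jj : ℕ) : ℚ) + (Fintype.card 𝓀[K] : ℚ) * (if quadraticChar 𝓀[K] (-(IsLocalRing.residue 𝒪[K] (τ * (![ε ^ (b.1 : ℕ) * u₀, ε ^ (b.2 : ℕ) * u₁, ε ^ ((b.1 : ℕ) + (b.2 : ℕ)) * u₂] : Fin 3 → 𝒪[K]) i₀) * (IsLocalRing.residue 𝒪[K] c₀)⁻¹)) = 1 then (if quadraticChar 𝓀[K] (IsLocalRing.residue 𝒪[K] (sg * τ * e' * (![ε ^ (b.1 : ℕ) * u₀, ε ^ (b.2 : ℕ) * u₁, ε ^ ((b.1 : ℕ) + (b.2 : ℕ)) * u₂] : Fin 3 → 𝒪[K]) i₀ * (![ε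 ^ (b.1 : ℕ) * u₀, ε ^ (b.2 : ℕ) * u₁, ε ^ ((b.1 : ℕ) + (b.2 : ℕ)) * u₂] : Fin 3 → 𝒪[K]) k)) = 1 then ((Fintype.card 𝓀[K] : ℚ) ^ s' * ((Fintype.card 𝓀[K] : ℚ) - 1)) else ((Fintype.card 𝓀[K] : ℚ) ^ s' * ((Fintype.card 𝓀[K] : ℚ) + 1))) else (if quadraticChar 𝓀[K] (IsLocalRing.residue 𝒪[K] (sg * τ * e' * (![ε ^ (b.1 : ℕ) * u₀, ε ^ (b.2 : ℕ) * u₁, ε ^ ((b.1 : ℕ) + (b.2 : ℕ)) * u₂] : Fin 3 → 𝒪[K]) i₀ * (![ε ^ (b.1 : ℕ) * u₀, ε ^ (b.2 : ℕ) * u₁, ε ^ ((b.1 : ℕ) + (b.2 : ℕ)) * u₂] : Fin 3 → 𝒪[K]) k)) = 1 then (((Fintype.card 𝓀[K] : ℚ) - 1) * (1 + 2 * (Fintype.card 𝓀[K] : ℚ) * ∑ i ∈ Finset.range (s' - 1), (Fintype.card 𝓀[K] : ℚ) ^ i) + (Fintype.card 𝓀[K] : ℚ) ^ s' * ((Fintype.card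 𝓀[K] : ℚ) - 3)) else (((Fintype.card 𝓀[K] : ℚ) - 1) * (1 + 2 * (Fintype.card 𝓀[K] : ℚ) * ∑ i ∈ Finset.range (s' - 1), (Fintype.card 𝓀[K] : ℚ) ^ i) + (Fintype.card 𝓀[K] : ℚ) ^ s' * ((Fintype.card 𝓀[K] : ℚ) - 1)))) * (((![0, 0, 0, (Fintype.card 𝓀[K]) ^ (2 * mA), ∑ i ∈ Finset.range mA, (Fintype.card 𝓀[K]) ^ (2 * i)] : Fin 5 → ℕ) jj : ℕ) : ℚ)) else ((((![0, 0, 0, 0, 1] : Fin 5 → ℕ) jj : ℕ) : ℚ) + (Fintype.card 𝓀[K] : ℚ) * (if quadraticChar 𝓀[K] (-(IsLocalRing.residue 𝒪[K] (τ * (![ε ^ (b.1 : ℕ) * u₀, ε ^ (b.2 : ℕ) * u₁, ε ^ ((b.1 : ℕ) + (b.2 : ℕ)) * u₂] : Fin 3 → 𝒪[K]) i₀) * (IsLocalRing.residue 𝒪[K] c₀)⁻¹)) = 1 then ((Fintype.card 𝓀[K] : ℚ) + 1) else 0) * (((![0, 0, (Fintype.card 𝓀[K]) ^ (2 * mA),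 0, ∑ i ∈ Finset.range mA, (Fintype.card 𝓀[K]) ^ (2 * i)] : Fin 5 → ℕ) jj : ℕ) : ℚ) + (Fintype.card 𝓀[K] : ℚ) * (if quadraticChar 𝓀[K] (-(IsLocalRing.residue 𝒪[K] (τ * (![ε ^ (b.1 : ℕ) * u₀, ε ^ (b.2 : ℕ) * u₁, ε ^ ((b.1 : ℕ) + (b.2 : ℕ)) * u₂] : Fin 3 → 𝒪[K]) i₀) * (IsLocalRing.residue 𝒪[K] c₀)⁻¹)) = 1 then 0 else ((Fintype.card 𝓀[K] : ℚ) + 1)) * (((![0, 0, 0, (Fintype.card 𝓀[K]) ^ (2 * mA), ∑ i ∈ Finset.range mA, (Fintype.card 𝓀[K]) ^ (2 * i)] : Fin 5 → ℕ) jj : ℕ) : ℚ))) else (if quadraticChar 𝓀[K] (-(IsLocalRing.residue 𝒪[K] ((![ε ^ (b.1 : ℕ) * u₀, ε ^ (b.2 : ℕ) * u₁, ε ^ ((b.1 : ℕ) + (b.2 : ℕ)) * u₂] : Fin 3 → 𝒪[K]) j) * IsLocalRing.residue 𝒪[K] ((![ε ^ (b.1 : ℕ) * u₀, ε ^ (b.2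 : ℕ) * u₁, ε ^ ((b.1 : ℕ) + (b.2 : ℕ)) * u₂] : Fin 3 → 𝒪[K]) k))) = 1 then ((1 + 2 * (Fintype.card 𝓀[K] : ℚ) * ∑ i ∈ Finset.range s', (Fintype.card 𝓀[K] : ℚ) ^ i) * (((![0, 0, 0, 0, 1] : Fin 5 → ℕ) jj : ℕ) : ℚ) + (Fintype.card 𝓀[K] : ℚ) * (if quadraticChar 𝓀[K] (IsLocalRing.residue 𝒪[K] (sg * τ * e' * (![ε ^ (b.1 : ℕ) * u₀, ε ^ (b.2 : ℕ) * u₁, ε ^ ((b.1 : ℕ) + (b.2 : ℕ)) * u₂] : Fin 3 → 𝒪[K]) i₀ * (![ε ^ (b.1 : ℕ) * u₀, ε ^ (b.2 : ℕ) * u₁, ε ^ ((b.1 : ℕ) + (b.2 : ℕ)) * u₂] : Fin 3 → 𝒪[K]) k)) = 1 then 4 * (Fintype.card 𝓀[K] : ℚ) ^ s' else 0) * (((![(Fintype.card 𝓀[K]) ^ (3 * mA + 3), (Fintype.card 𝓀[K]) ^ (3 * mA + 2), (Fintype.card 𝓀[K]).choose 2 * (Fintype.card 𝓀[K]) ^ (2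 * mA) * ∑ i ∈ Finset.range mA, (Fintype.card 𝓀[K]) ^ i, (Fintype.card 𝓀[K]).choose 2 * (Fintype.card 𝓀[K]) ^ (2 * mA) * ∑ i ∈ Finset.range mA, (Fintype.card 𝓀[K]) ^ i,
          ∑ i ∈ Finset.range (mA + 1), (Fintype.card 𝓀[K]) ^ (2 * i) + ∑ i ∈ Finset.range mA, (Fintype.card 𝓀[K]) ^ (2 * mA + 1 + i)] : Fin 5 → ℕ) jj : ℕ) : ℚ) + (Fintype.card 𝓀[K] : ℚ) * (if quadraticChar 𝓀[K] (-(IsLocalRing.residue 𝒪[K] (τ * (![ε ^ (b.1 : ℕ) * u₀, ε ^ (b.2 : ℕ) * u₁, ε ^ ((b.1 : ℕ) + (b.2 : ℕ)) * u₂] : Fin 3 → 𝒪[K]) i₀) * (IsLocalRing.residue 𝒪[K] c₀)⁻¹)) = 1 then (if quadraticChar 𝓀[K] (IsLocalRing.residue 𝒪[K] (sg * τ * e' * (![ε ^ (b.1 : ℕ) * u₀, ε ^ (b.2 : ℕ) * u₁, ε ^ ((b.1 : ℕ) + (b.2 : ℕ)) * u₂] : Fin 3 → 𝒪[K]) i₀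 * (![ε ^ (b.1 : ℕ) * u₀, ε ^ (b.2 : ℕ) * u₁, ε ^ ((b.1 : ℕ) + (b.2 : ℕ)) * u₂] : Fin 3 → 𝒪[K]) k)) = 1 then (((Fintype.card 𝓀[K] : ℚ) - 1) * (1 + 2 * (Fintype.card 𝓀[K] : ℚ) * ∑ i ∈ Finset.range (s' - 1), (Fintype.card 𝓀[K] : ℚ) ^ i) + (Fintype.card 𝓀[K] : ℚ) ^ s' * ((Fintype.card 𝓀[K] : ℚ) - 3)) else (((Fintype.card 𝓀[K] : ℚ) - 1) * (1 + 2 * (Fintype.card 𝓀[K] : ℚ) * ∑ i ∈ Finset.range (s' - 1), (Fintype.card 𝓀[K] : ℚ) ^ i) + (Fintype.card 𝓀[K] : ℚ) ^ s' * ((Fintype.card 𝓀[K] : ℚ) - 1))) else (if quadraticChar 𝓀[K] (IsLocalRing.residue 𝒪[K] (sg * τ * e' * (![ε ^ (b.1 : ℕ) * u₀, ε ^ (b.2 : ℕ) * u₁, ε ^ ((b.1 : ℕ) + (b.2 : ℕ)) * u₂] : Fin 3 → 𝒪[K]) i₀ * (![ε ^ (b.1 : ℕ) * u₀, ε ^ (b.2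 : ℕ) * u₁, ε ^ ((b.1 : ℕ) + (b.2 : ℕ)) * u₂] : Fin 3 → 𝒪[K]) k)) = 1 then ((Fintype.card 𝓀[K] : ℚ) ^ s' * ((Fintype.card 𝓀[K] : ℚ) - 1)) else ((Fintype.card 𝓀[K] : ℚ) ^ s' * ((Fintype.card 𝓀[K] : ℚ) + 1)))) * (((![0, 0, if Even mA then (Fintype.card 𝓀[K]) ^ (2 * mA) else 0, if Even mA then 0 else (Fintype.card 𝓀[K]) ^ (2 * mA), ∑ i ∈ Finset.range mA, (Fintype.card 𝓀[K]) ^ (2 * i)] : Fin 5 → ℕ) jj : ℕ) : ℚ) + (Fintype.card 𝓀[K] : ℚ) * (if quadraticChar 𝓀[K] (-(IsLocalRing.residue 𝒪[K] (τ * (![ε ^ (b.1 : ℕ) * u₀, ε ^ (b.2 : ℕ) * u₁, ε ^ ((b.1 : ℕ) + (b.2 : ℕ)) * u₂] : Fin 3 → 𝒪[K]) i₀) * (IsLocalRing.residue 𝒪[K] c₀)⁻¹)) = 1 then (if quadraticChar 𝓀[K] (IsLocalRing.residue 𝒪[K] (sg * τ * e' * (![ε ^ (b.1 : ℕ) * u₀,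 ε ^ (b.2 : ℕ) * u₁, ε ^ ((b.1 : ℕ) + (b.2 : ℕ)) * u₂] : Fin 3 → 𝒪[K]) i₀ * (![ε ^ (b.1 : ℕ) * u₀, ε ^ (b.2 : ℕ) * u₁, ε ^ ((b.1 : ℕ) + (b.2 : ℕ)) * u₂] : Fin 3 → 𝒪[K]) k)) = 1 then ((Fintype.card 𝓀[K] : ℚ) ^ s' * ((Fintype.card 𝓀[K] : ℚ) - 1)) else ((Fintype.card 𝓀[K] : ℚ) ^ s' * ((Fintype.card 𝓀[K] : ℚ) + 1))) else (if quadraticChar 𝓀[K] (IsLocalRing.residue 𝒪[K] (sg * τ * e' * (![ε ^ (b.1 : ℕ) * u₀, ε ^ (b.2 : ℕ) * u₁, ε ^ ((b.1 : ℕ) + (b.2 : ℕ)) * u₂] : Fin 3 → 𝒪[K]) i₀ * (![ε ^ (b.1 : ℕ) * u₀, ε ^ (b.2 : ℕ) * u₁, ε ^ ((b.1 : ℕ) + (b.2 : ℕ)) * u₂] : Fin 3 → 𝒪[K]) k)) = 1 then (((Fintype.card 𝓀[K] : ℚ) - 1) * (1 + 2 * (Fintype.card 𝓀[K] : ℚ)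 * ∑ i ∈ Finset.range (s' - 1), (Fintype.card 𝓀[K] : ℚ) ^ i) + (Fintype.card 𝓀[K] : ℚ) ^ s' * ((Fintype.card 𝓀[K] : ℚ) - 3)) else (((Fintype.card 𝓀[K] : ℚ) - 1) * (1 + 2 * (Fintype.card 𝓀[K] : ℚ) * ∑ i ∈ Finset.range (s' - 1), (Fintype.card 𝓀[K] : ℚ) ^ i) + (Fintype.card 𝓀[K] : ℚ) ^ s' * ((Fintype.card 𝓀[K] : ℚ) - 1)))) * (((![0, 0, if Even mA then 0 else (Fintype.card 𝓀[K]) ^ (2 * mA), if Even mA then (Fintype.card 𝓀[K]) ^ (2 * mA) else 0, ∑ i ∈ Finset.range mA, (Fintype.card 𝓀[K]) ^ (2 * i)] : Fin 5 → ℕ) jj : ℕ) : ℚ)) else ((((![0, 0, 0, 0, 1] : Fin 5 → ℕ) jj : ℕ) : ℚ) + (Fintype.card 𝓀[K] : ℚ) * (if quadraticChar 𝓀[K] (-(IsLocalRing.residue 𝒪[K] (τ * (![ε ^ (b.1 : ℕ) * u₀, ε ^ (b.2 : ℕ) * u₁, ε ^ ((b.1 : ℕ) + (b.2 : ℕ))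 * u₂] : Fin 3 → 𝒪[K]) i₀) * (IsLocalRing.residue 𝒪[K] c₀)⁻¹)) = 1 then ((Fintype.card 𝓀[K] : ℚ) + 1) else 0) * (((![0, 0, if Even mA then (Fintype.card 𝓀[K]) ^ (2 * mA) else 0, if Even mA then 0 else (Fintype.card 𝓀[K]) ^ (2 * mA), ∑ i ∈ Finset.range mA, (Fintype.card 𝓀[K]) ^ (2 * i)] : Fin 5 → ℕ) jj : ℕ) : ℚ) + (Fintype.card 𝓀[K] : ℚ) * (if quadraticChar 𝓀[K] (-(IsLocalRing.residue 𝒪[K] (τ * (![ε ^ (b.1 : ℕ) * u₀, ε ^ (b.2 : ℕ) * u₁, ε ^ ((b.1 : ℕ) + (b.2 : ℕ)) * u₂] : Fin 3 → 𝒪[K]) i₀) * (IsLocalRing.residue 𝒪[K] c₀)⁻¹)) = 1 then 0 else ((Fintype.card 𝓀[K] : ℚ) + 1)) * (((![0, 0, if Even mA then 0 else (Fintype.card 𝓀[K]) ^ (2 * mA), if Even mA then (Fintype.card 𝓀[K]) ^ (2 * mA) else 0, ∑ i ∈ Finset.range mA, (Fintype.card 𝓀[K]) ^ (2 * i)] :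 Fin 5 → ℕ) jj : ℕ) : ℚ)))) := by
  classical
  letI : ValuativeRel K := ValuativeRel.ofValuation (Valued.v : Valuation K ℤᵐ⁰)
  haveI : (Valued.v : Valuation K ℤᵐ⁰).Compatible := Valuation.Compatible.ofValuation _
  -- basic facts
  have hϖ0 : ϖ ≠ 0 := fun h0 => by rw [h0, map_zero] at hϖ; exact WithZero.coe_ne_zero hϖ.symm
  have hres0 : ∀ x : 𝒪[K], Valued.v (x : K) = 1 → IsLocalRing.residue 𝒪[K] x ≠ 0 := fun x hx h => by
    rw [residue_eq_zero_iff_v_lt_one, hx] at h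
    exact lt_irrefl _ h
  have huv : Valued.v u = 1 := v_eq_one_of_mul_map_eq_one hvσ hu
  have hεns : ∀ z : K, Valued.v z ≤ 1 → Valued.v (z ^ 2 - ε) = 1 := by
    intro z hz
    have hzO : z ∈ 𝒪[K] := (Valuation.mem_integer_iff _ _).2 hz
    have hint : Valued.v (z ^ 2 - (ε : K)) ≤ 1 := by
      have : ((⟨z, hzO⟩ ^ 2 - ε : 𝒪[K]) : K) = z ^ 2 - (ε : K) := by push_cast; rfl
      rw [← this]; exact ((⟨z, hzO⟩ ^ 2 - ε : 𝒪[K])).2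
    rcases hint.lt_or_eq with hlt | heq
    · exfalso
      apply hε
      have h0 : IsLocalRing.residue 𝒪[K] (⟨z, hzO⟩ ^ 2 - ε) = 0 := by
        rw [residue_eq_zero_iff_v_lt_one]; push_cast; exact hlt
      rw [map_sub, map_pow, sub_eq_zero] at h0
      exact ⟨IsLocalRing.residue 𝒪[K] ⟨z, hzO⟩, by rw [← h0, pow_two]⟩
    · exact heq
  -- the per-literal transport package (FILE 3)
  obtain ⟨Ab, γ', c₁, cP, cM, hAb, hAb', hdA, hγ'0, hγ'A, hs1, hsv, hsσ, hc₁v, hcP, hcM, hconstP, -, htr⟩ :=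
    exists_transport_typeOne_literal hσ hvσ hϖ hres h2 hnorm u₀ u₁ u₂ ε c₀ hu₀ hu₁ hu₂ hεv hc₀ hσu₀ hσu₁ hσu₂ hσε α u γ hα hu hγ hα2 hu2 hγ2 T hT b
  rw [htr jj]
  -- the literal's diagonal datum
  have hd := v_literalDiag_eq_one u₀ u₁ u₂ ε b hu₀ hu₁ hu₂ hεv
  have hdσ := map_literalDiag_eq σ (u₀ : K) (u₁ : K) (u₂ : K) (ε : K) b hσu₀ hσu₁ hσu₂ hσε
  let D : Fin 3 → 𝒪[K] := (![ε ^ (b.1 : ℕ) * u₀, ε ^ (b.2 : ℕ) * u₁, ε ^ ((b.1 : ℕ) + (b.2 : ℕ)) * u₂] : Fin 3 → 𝒪[K])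
  have hD0 : D 0 = ε ^ (b.1 : ℕ) * u₀ := rfl
  have hD1 : D 1 = ε ^ (b.2 : ℕ) * u₁ := rfl
  have hD2 : D 2 = ε ^ ((b.1 : ℕ) + (b.2 : ℕ)) * u₂ := rfl
  have hD : ∀ i, (D i : K) = (![((ε : K)) ^ (b.1 : ℕ) * (u₀ : K), (ε : K) ^ (b.2 : ℕ) * (u₁ : K), (ε : K) ^ ((b.1 : ℕ) + (b.2 : ℕ)) * (u₂ : K)] : Fin 3 → K) i := by
    intro i
    fin_cases i
    · show ((D 0 : 𝒪[K]) : K) = (ε : K) ^ (b.1 : ℕ) * (u₀ : K)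
      rw [hD0]; push_cast; rfl
    · show ((D 1 : 𝒪[K]) : K) = (ε : K) ^ (b.2 : ℕ) * (u₁ : K)
      rw [hD1]; push_cast; rfl
    · show ((D 2 : 𝒪[K]) : K) = (ε : K) ^ ((b.1 : ℕ) + (b.2 : ℕ)) * (u₂ : K)
      rw [hD2]; push_cast; rfl
  have hDv : ∀ i, Valued.v ((D i : 𝒪[K]) : K) = 1 := fun i => by rw [hD i]; exact hd i
  -- the determinant unit and `c₁` as elements of `𝒪`
  have hprod : (((-∏ i, D i : 𝒪[K])) : K) = -(Matrix.diagonal (![((ε : K)) ^ (b.1 : ℕ) * (u₀ : K), (ε : K) ^ (b.2 : ℕ) * (u₁ : K), (ε : K) ^ ((b.1 : ℕ) + (b.2 : ℕ)) * (u₂ : K)] : Fin 3 → K)).det := by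
    rw [Matrix.det_diagonal]
    push_cast
    exact congrArg Neg.neg (Finset.prod_congr rfl fun i _ => hD i)
  have hDetv : Valued.v (((-∏ i, D i : 𝒪[K])) : K) = 1 := by
    push_cast
    rw [Valuation.map_neg, map_prod]
    exact Finset.prod_eq_one fun i _ => hDv i
  have hDet0 : (((-∏ i, D i : 𝒪[K])) : K) ≠ 0 := fun h => by rw [h, map_zero] at hDetv; exact zero_ne_one hDetv
  have hDet' := hres0 _ hDetv
  -- `(−det)⁻¹` and `c₁` as elements of `𝒪`
  have hwv : Valued.v ((((-∏ i, D i : 𝒪[K])) : K))⁻¹ = 1 := by rw [map_inv₀, hDetv, inv_one]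
  let w : 𝒪[K] := ⟨((((-∏ i, D i : 𝒪[K])) : K))⁻¹, (Valuation.mem_integer_iff _ _).2 hwv.le⟩
  have hwD : w * (-∏ i, D i) = 1 := by
    apply Subtype.ext; push_cast; show ((((-∏ i, D i : 𝒪[K])) : K))⁻¹ * (((-∏ i, D i : 𝒪[K])) : K) = 1; exact inv_mul_cancel₀ hDet0
  have hw' : IsLocalRing.residue 𝒪[K] w ≠ 0 := hres0 w hwv
  let cO : 𝒪[K] := ⟨c₁, (Valuation.mem_integer_iff _ _).2 hc₁v.le⟩
  have hc₀' := hres0 c₀ hc₀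
  have hcO' : IsLocalRing.residue 𝒪[K] cO ≠ 0 := hres0 cO hc₁v
  have hcPO : cP = -cO := Subtype.ext (by rw [hcP]; rfl)
  have hwres : IsLocalRing.residue 𝒪[K] w * IsLocalRing.residue 𝒪[K] (-∏ i, D i) = 1 := by rw [← map_mul, hwD, map_one]
  have hcOres : (IsLocalRing.residue 𝒪[K] cO)⁻¹ = (IsLocalRing.residue 𝒪[K] c₀)⁻¹ * (IsLocalRing.residue 𝒪[K] w)⁻¹ := by
    rw [hcPO, map_neg, inv_neg, neg_mul, neg_inj] at hconstP
    have h1 : (IsLocalRing.residue 𝒪[K] w)⁻¹ = IsLocalRing.residue 𝒪[K] (-∏ i, D i) := by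
      rw [← mul_eq_one_iff_inv_eq₀ hw', hwres]
    rw [h1]
    calc (IsLocalRing.residue 𝒪[K] cO)⁻¹
        = (IsLocalRing.residue 𝒪[K] cO)⁻¹ * (IsLocalRing.residue 𝒪[K] (-∏ i, D i))⁻¹ * IsLocalRing.residue 𝒪[K] (-∏ i, D i) := by
          rw [mul_assoc, inv_mul_cancel₀ hDet', mul_one]
      _ = (IsLocalRing.residue 𝒪[K] c₀)⁻¹ * IsLocalRing.residue 𝒪[K] (-∏ i, D i) := by rw [hconstP]
  -- finiteness of the region, its finset
  have hfin := finite_setOf_latticeGraphIso_eq_of_eigenframe hvσ hϖ _ hd hdσ Ab hdA _ hsv hsσ hγ'A hreg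
  have hRfin : ({v : {M : Submodule 𝒪[K] (Fin 3 → K) // IsVertex σ ϖ ((StdForm.antidiagonal 3).over K) M} |
      latticeGraphIso σ ϖ ((StdForm.antidiagonal 3).over K) γ' v = v ∧ IsSelfDualLattice σ ϖ ((StdForm.antidiagonal 3).over K) v.1 ∧
        v.1.map ((Matrix.toLin' (((γ' : GL (Fin 3) K) : Matrix (Fin 3) (Fin 3) K) - 1)).restrictScalars 𝒪[K]) ≤ scaleLattice (ϖ ^ d₀) v.1}).Finite :=
    hfin.subset fun v hv => hv.1
  have hsR : ∀ v, v ∈ hRfin.toFinset ↔ v ∈ {v : {M : Submodule 𝒪[K] (Fin 3 → K) // IsVertex σ ϖ ((StdForm.antidiagonal 3).over K) M} |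
      latticeGraphIso σ ϖ ((StdForm.antidiagonal 3).over K) γ' v = v ∧ IsSelfDualLattice σ ϖ ((StdForm.antidiagonal 3).over K) v.1 ∧
        v.1.map ((Matrix.toLin' (((γ' : GL (Fin 3) K) : Matrix (Fin 3) (Fin 3) K) - 1)).restrictScalars 𝒪[K]) ≤ scaleLattice (ϖ ^ d₀) v.1} :=
    fun v => Set.Finite.mem_toFinset hRfin
  -- the three S45 tokens of this literal in residual form (★ DEAL T, F0P3a-p05)
  have hHYP : (∃ t : K, Valued.v t = 1 ∧ Valued.v ((![((ε : K)) ^ (b.1 : ℕ) * (u₀ : K), (ε : K) ^ (b.2 : ℕ) * (u₁ : K), (ε : K) ^ ((b.1 : ℕ) + (b.2 : ℕ)) * (u₂ : K)] : Fin 3 → K) j + t * σ t * (![((ε : K)) ^ (b.1 : ℕ) * (u₀ : K), (ε : K) ^ (b.2 : ℕ) * (u₁ : K), (ε : K) ^ ((b.1 : ℕ) + (b.2 : ℕ)) * (u₂ : K)] : Fin 3 → K) k) < 1) ↔ quadraticChar 𝓀[K] (-(IsLocalRing.residue 𝒪[K] ((![ε ^ (b.1 : ℕ) * u₀, ε ^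 (b.2 : ℕ) * u₁, ε ^ ((b.1 : ℕ) + (b.2 : ℕ)) * u₂] : Fin 3 → 𝒪[K]) j) * IsLocalRing.residue 𝒪[K] ((![ε ^ (b.1 : ℕ) * u₀, ε ^ (b.2 : ℕ) * u₁, ε ^ ((b.1 : ℕ) + (b.2 : ℕ)) * u₂] : Fin 3 → 𝒪[K]) k))) = 1 := by
    rw [← hD j, ← hD k]
    exact exists_unit_v_add_mul_norm_mul_lt_one_iff_quadraticChar hvσ hres (D j) (D k) (hDv j) (hDv k)
  have hB₀ : ((sg * τ * e' * D i₀ * D k : 𝒪[K]) : K) = ((-1) ^ (s' + 1) * ((ϖ ^ d₀)⁻¹ * ((![α / u, 1, γ / u] : Fin 3 → K) i₀ - (![α / u, 1, γ / u] : Fin 3 → K) j)) * ((ϖ ^ (d₀ + 2 * s'))⁻¹ * ((![α / u, 1, γ / u] : Fin 3 → K) k - (![α / u, 1, γ / u] : Fin 3 → K) j)) * ((![((ε : K)) ^ (b.1 : ℕ) * (u₀ : K), (ε : K) ^ (b.2 : ℕ) * (u₁ : K), (ε : K) ^ ((b.1 : ℕ) + (b.2 : ℕ)) * (u₂ : K)]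 : Fin 3 → K) i₀ * (![((ε : K)) ^ (b.1 : ℕ) * (u₀ : K), (ε : K) ^ (b.2 : ℕ) * (u₁ : K), (ε : K) ^ ((b.1 : ℕ) + (b.2 : ℕ)) * (u₂ : K)] : Fin 3 → K) k)) := by
    push_cast
    rw [hsg, hτ, he', hD i₀, hD k]
    ring
  have hB₀v : Valued.v ((sg * τ * e' * D i₀ * D k : 𝒪[K]) : K) = 1 := by
    push_cast
    rw [map_mul, map_mul, map_mul, map_mul, hsg, hτv, he'v, hDv i₀, hDv k, map_pow, Valuation.map_neg, map_one, one_pow]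
    simp
  have hBIG : (∃ t : K, Valued.v t = 1 ∧ Valued.v (t ^ 2 - ((-1) ^ (s' + 1) * ((ϖ ^ d₀)⁻¹ * ((![α / u, 1, γ / u] : Fin 3 → K) i₀ - (![α / u, 1, γ / u] : Fin 3 → K) j)) * ((ϖ ^ (d₀ + 2 * s'))⁻¹ * ((![α / u, 1, γ / u] : Fin 3 → K) k - (![α / u, 1, γ / u] : Fin 3 → K) j)) * ((![((ε : K)) ^ (b.1 : ℕ) * (u₀ : K), (ε : K) ^ (b.2 : ℕ) * (u₁ : K), (ε : K) ^ ((b.1 : ℕ) + (b.2 : ℕ)) * (u₂ : K)] : Fin 3 → K) i₀ * (![((ε : K)) ^ (b.1 : ℕ) * (u₀ : K), (ε : K) ^ (b.2 : ℕ) * (u₁ : K), (ε : K) ^ ((b.1 : ℕ) + (b.2 : ℕ)) * (u₂ : K)] : Fin 3 → K) k))) < 1) ↔ quadraticChar 𝓀[K] (IsLocalRing.residue 𝒪[K] (sg * τ * e' * (![ε ^ (b.1 : ℕ) * u₀, ε ^ (b.2 : ℕ) * u₁, ε ^ ((b.1 : ℕ) + (b.2 : ℕ)) * u₂] : Fin 3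 → 𝒪[K]) i₀ * (![ε ^ (b.1 : ℕ) * u₀, ε ^ (b.2 : ℕ) * u₁, ε ^ ((b.1 : ℕ) + (b.2 : ℕ)) * u₂] : Fin 3 → 𝒪[K]) k)) = 1 := by
    rw [← hB₀]
    exact exists_unit_v_sq_sub_lt_one_iff_quadraticChar _ hB₀v
  have hX₀ : ((τ * D i₀ * w : 𝒪[K]) : K) = (ϖ ^ d₀)⁻¹ * ((![α / u, 1, γ / u] : Fin 3 → K) i₀ - (![α / u, 1, γ / u] : Fin 3 → K) j) * ((![((ε : K)) ^ (b.1 : ℕ) * (u₀ : K), (ε : K) ^ (b.2 : ℕ) * (u₁ : K), (ε : K) ^ ((b.1 : ℕ) + (b.2 : ℕ)) * (u₂ : K)] : Fin 3 → K) i₀ * (-(Matrix.diagonal (![((ε : K)) ^ (b.1 : ℕ) * (u₀ : K), (ε : K) ^ (b.2 : ℕ) * (u₁ : K), (ε : K) ^ ((b.1 : ℕ) + (b.2 : ℕ)) * (u₂ : K)] : Fin 3 → K)).det)⁻¹) := by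
    have hwK : ((w : 𝒪[K]) : K) = ((((-∏ i, D i : 𝒪[K])) : K))⁻¹ := rfl
    rw [← hprod]
    push_cast
    rw [hτ, hD i₀, hwK]
    push_cast
    ring
  have hX₀v : Valued.v ((τ * D i₀ * w : 𝒪[K]) : K) = 1 := by
    push_cast
    rw [map_mul, map_mul, hτv, hDv i₀, one_mul, one_mul]
    exact hwv
  have hLOCK : (∃ a : K, Valued.v a = 1 ∧ Valued.v (((ϖ ^ d₀)⁻¹ * ((![α / u, 1, γ / u] : Fin 3 → K) i₀ - (![α / u, 1, γ / u] : Fin 3 → K) j) * ((![((ε : K)) ^ (b.1 : ℕ) * (u₀ : K), (ε : K) ^ (b.2 : ℕ) * (u₁ : K), (ε : K) ^ ((b.1 : ℕ) + (b.2 : ℕ)) * (u₂ : K)] : Fin 3 → K) i₀ * (-(Matrix.diagonal (![((ε : K)) ^ (b.1 : ℕ) * (u₀ : K), (ε : K) ^ (b.2 : ℕ) * (u₁ : K), (ε : K) ^ ((b.1 : ℕ) + (b.2 : ℕ)) * (u₂ : K)] : Fin 3 → K)).det)⁻¹)) + c₁ * a ^ 2) < 1) ↔ quadraticChar 𝓀[K]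 (-(IsLocalRing.residue 𝒪[K] (τ * (![ε ^ (b.1 : ℕ) * u₀, ε ^ (b.2 : ℕ) * u₁, ε ^ ((b.1 : ℕ) + (b.2 : ℕ)) * u₂] : Fin 3 → 𝒪[K]) i₀) * (IsLocalRing.residue 𝒪[K] c₀)⁻¹)) = 1 := by
    rw [← hX₀, show c₁ = ((cO : 𝒪[K]) : K) from rfl, exists_unit_v_add_mul_sq_lt_one_iff_quadraticChar _ cO hX₀v hc₁v]
    have e : -(IsLocalRing.residue 𝒪[K] (τ * D i₀ * w) * (IsLocalRing.residue 𝒪[K] cO)⁻¹) =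
        -(IsLocalRing.residue 𝒪[K] (τ * D i₀) * (IsLocalRing.residue 𝒪[K] c₀)⁻¹) := by
      rw [hcOres, map_mul (IsLocalRing.residue 𝒪[K]) (τ * D i₀) w]
      field_simp
    rw [e]
  -- `3 ≤ q` (odd characteristic) for the `q − 3` casts
  have hk2 : ringChar 𝓀[K] ≠ 2 := ringChar_residueField_ne_two h2
  have hq3 : 3 ≤ Fintype.card 𝓀[K] := by
    have h1 : 1 < Fintype.card 𝓀[K] := Fintype.one_lt_card
    have hodd : Fintype.card 𝓀[K] % 2 ≠ 0 := fun h => hk2 (FiniteField.even_card_iff_char_two.2 h)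
    omega
  have hq1 : 1 ≤ Fintype.card 𝓀[K] := by omega
  by_cases hh : ∃ t : K, Valued.v t = 1 ∧ Valued.v ((![((ε : K)) ^ (b.1 : ℕ) * (u₀ : K), (ε : K) ^ (b.2 : ℕ) * (u₁ : K), (ε : K) ^ ((b.1 : ℕ) + (b.2 : ℕ)) * (u₂ : K)] : Fin 3 → K) j + t * σ t * (![((ε : K)) ^ (b.1 : ℕ) * (u₀ : K), (ε : K) ^ (b.2 : ℕ) * (u₁ : K), (ε : K) ^ ((b.1 : ℕ) + (b.2 : ℕ)) * (u₂ : K)] : Fin 3 → K) k) < 1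
  · obtain ⟨hcard, hE, hP, hM⟩ := hHyp hσ hvσ hσϖ hϖ hres h2 hnorm hγ'0 _ hd hdσ Ab hAb hAb' hdA _ hs1 hsv hsσ hγ'A i₀ hd3 he hiso hclose hreg mA hmA c₁ (ε : K) hc₁v hεv hεns (Fintype.card 𝓀[K]) rfl _ hsR s' hs' hgap hj hk hjk hh
    have hcnt := hIso hσ hvσ hσϖ hϖ hres h2 hnorm hγ'0 _ hd hdσ Ab hAb hAb' hdA _ hs1 hsv hsσ hγ'A i₀ hd3 he hiso hclose hreg mA hmA c₁ (ε : K) hc₁v hεv hεns (Fintype.card 𝓀[K]) rfl _ hsR _ _ _ hE hP hM jj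
    rw [hcnt]
    simp only [if_pos (hHYP.1 hh), hcard, hBIG, hLOCK]
    split_ifs <;> (simp only [Pi.add_apply, Pi.smul_apply, smul_eq_mul]; push_cast [Nat.cast_sub hq3, Nat.cast_sub hq1]; ring)
  · obtain ⟨hcard, hE, hP, hM⟩ := hBare hσ hvσ hσϖ hϖ hres h2 hnorm hγ'0 _ hd hdσ Ab hAb hAb' hdA _ hs1 hsv hsσ hγ'A i₀ hd3 he hiso hclose hreg mA hmA c₁ (ε : K) hc₁v hεv hεns (Fintype.card 𝓀[K]) rfl _ hsR s' hs' hgap hj hk hjk hh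
    have hcnt := hIso hσ hvσ hσϖ hϖ hres h2 hnorm hγ'0 _ hd hdσ Ab hAb hAb' hdA _ hs1 hsv hsσ hγ'A i₀ hd3 he hiso hclose hreg mA hmA c₁ (ε : K) hc₁v hεv hεns (Fintype.card 𝓀[K]) rfl _ hsR _ _ _ hE hP hM jj
    rw [hcnt]
    simp only [if_neg (fun h => hh (hHYP.2 h)), hcard, hLOCK]
    split_ifs <;> (simp only [Pi.add_apply, Pi.smul_apply, smul_eq_mul]; push_cast [Nat.cast_sub hq3, Nat.cast_sub hq1]; ring)

set_option maxHeartbeats 3200000 in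
/-- **THE JUNCTION HEAD IN THE ISOCELES CONFIGURATIONS, FROM THE PEN'S ISO ENGINE STATEMENT AND THE S45 POOLED REGION DATA**: `hIso` = junction skeleton v11
(5af0312e) :1187 `strataCount_J₀_isoceles`, `hHyp`∕`hBare` = S45 v4 (bc98a4a1) `row_S45_hyperbolic`∕`row_S45_bare`, all three stated at the head's own `K σ ϖ` with the
pen's binders VERBATIM (sliced programmatically); binders = the (J★) head's VERBATIM (`_hσc₀` unused) + `hconf : ¬ (N₁ = N ∧ N₂ = N)`; conclusion = the head's VERBATIM.
[cite: Rogawski1990, §4.9 Prop. 4.9.1 (a) p. 55] [cite: Kottwitz1986, §3] [cite: LabesseLanglands1979, §2 Lemma 2.1, §5] -/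
theorem signedStrataCount_typeOne_ram_isoceles_of_strataCount
    {K : Type} [Field K] [Valued K ℤᵐ⁰]
      {σ : K →+* K} {ϖ : K} (hσ : ∀ x, σ (σ x) = x) (hvσ : ∀ a, Valued.v (σ a) = Valued.v a) (hϖ : Valued.v ϖ = WithZero.exp (-1 : ℤ)) (hσϖ : σ ϖ = -ϖ)
      (hres : ∀ x : K, Valued.v x ≤ 1 → Valued.v (σ x - x) < 1) (h2 : Valued.v (2 : K) = 1)
      (hnorm : ∀ u : K, σ u = u → Valued.v (u - 1) < 1 → ∃ z : K, z * σ z = u ∧ Valued.v (z - 1) ≤ Valued.v (u - 1)) [Fintype (Valued.ResidueField K)] [DecidableEq (Valued.ResidueField K)]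
      -- the torus datum: σ-fixed INTEGERS `u₀ u₁ u₂` (units), `ε` (a unit, residually a non-square), `c₀` (a unit, the rank-one class constant)
      (u₀ u₁ u₂ ε c₀ : (Valued.integer K)) (hu₀ : Valued.v (u₀ : K) = 1) (hu₁ : Valued.v (u₁ : K) = 1) (hu₂ : Valued.v (u₂ : K) = 1) (hεv : Valued.v (ε : K) = 1) (hc₀ : Valued.v (c₀ : K) = 1)
      (hσu₀ : σ u₀ = u₀) (hσu₁ : σ u₁ = u₁) (hσu₂ : σ u₂ = u₂) (hσε : σ ε = ε) (_hσc₀ : σ c₀ = c₀)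
      (hε : ¬ IsSquare (IsLocalRing.residue (Valued.integer K) ε))
      -- the element: norm-one diagonal entries, `v`-deep (`≡ 1 (ϖ²)`), depths `N₁ = depth(α − u)`, `N₂ = depth(u − γ)` (`N₁ + N₂ = 2m`), `N = depth(α − γ) = 2n+1`, `n ≥ 1`,
      -- with the LEADING COEFFICIENTS `A = (α − u)∕ϖ^{N₁}`, `C = (γ − u)∕ϖ^{N₂}` (integers, units by `hN₁`, `hN₂`) that enter the sign
      (α u γ : K) (hα : α * σ α = 1) (hu : u * σ u = 1) (hγ : γ * σ γ = 1)
      (hα2 : Valued.v (α - 1) ≤ Valued.v ϖ ^ 2) (hu2 : Valued.v (u - 1) ≤ Valued.v ϖ ^ 2) (hγ2 : Valued.v (γ - 1) ≤ Valued.v ϖ ^ 2)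
      (T : GL (Fin 3) K) (hT : (T : Matrix (Fin 3) (Fin 3) K) = Matrix.diagonal ![α, u, γ])
      (N₁ N₂ N m n : ℕ) (hN₁ : Valued.v (α - u) = Valued.v ϖ ^ N₁) (hN₂ : Valued.v (u - γ) = Valued.v ϖ ^ N₂) (hN : Valued.v (α - γ) = Valued.v ϖ ^ N)
      (hm : N₁ + N₂ = 2 * m) (hn : N = 2 * n + 1) (h1n : 1 ≤ n)
      (A C : (Valued.integer K)) (hA : α - u = (A : K) * ϖ ^ N₁) (hC : γ - u = (C : K) * ϖ ^ N₂)
    (hIso : ∀ [ValuativeRel K] [(Valued.v : Valuation K ℤᵐ⁰).Compatible]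
    (hσ : ∀ x, σ (σ x) = x) (hvσ : ∀ a, Valued.v (σ a) = Valued.v a) (hσϖ : σ ϖ = -ϖ)
    (hϖ : Valued.v ϖ = WithZero.exp (-1 : ℤ)) (hres : ∀ x : K, Valued.v x ≤ 1 → Valued.v (σ x - x) < 1) (h2 : Valued.v (2 : K) = 1)
    (hnorm : ∀ u : K, σ u = u → Valued.v (u - 1) < 1 → ∃ z : K, z * σ z = u ∧ Valued.v (z - 1) ≤ Valued.v (u - 1)) [Fintype 𝓀[K]] [DecidableEq 𝓀[K]]
    {γ : unitaryGroupOfForm σ ((StdForm.antidiagonal 3).over K)} (hγ0 : γ ∈ unitaryInt σ ((StdForm.antidiagonal 3).over K))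
    (d : Fin 3 → K) (hd : ∀ i, Valued.v (d i) = 1) (hdσ : ∀ i, σ (d i) = d i)
    (A : GL (Fin 3) K) (hA : IsIntMatrix (A : Matrix (Fin 3) (Fin 3) K)) (hA' : IsIntMatrix ((A⁻¹ : GL (Fin 3) K) : Matrix (Fin 3) (Fin 3) K))
    (hdA : Matrix.diagonal d = (-(Matrix.diagonal d).det) • formCongr σ A ((StdForm.antidiagonal 3).over K))
    (s : Fin 3 → K) (hs1 : s 1 = 1) (hsv : ∀ i, Valued.v (s i) = 1) (hsσ : ∀ i, s i * σ (s i) = 1)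
    (hγA : ((γ : GL (Fin 3) K) : Matrix (Fin 3) (Fin 3) K) = (A : Matrix (Fin 3) (Fin 3) K) * Matrix.diagonal s * ((A⁻¹ : GL (Fin 3) K) : Matrix (Fin 3) (Fin 3) K))
    (i₀ : Fin 3) {d₀ : ℕ} (hd3 : 3 ≤ d₀) (he : ∀ i, Valued.v (s i - 1) ≤ Valued.v ϖ ^ d₀)
    (hiso : ∀ j, j ≠ i₀ → Valued.v (s i₀ - s j) = Valued.v ϖ ^ d₀) (hclose : ∀ j k, j ≠ i₀ → k ≠ i₀ → Valued.v (s j - s k) ≤ Valued.v ϖ ^ (d₀ + 2))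
    (hreg : ∀ i j, i ≠ j → s i ≠ s j)
    (mA : ℕ) (hmA : d₀ = 2 * mA + 3)
    (c₁ ε : K) (hc₁ : Valued.v c₁ = 1) (hεv : Valued.v ε = 1) (hε : ∀ z : K, Valued.v z ≤ 1 → Valued.v (z ^ 2 - ε) = 1)
    (q : ℕ) (hq : q = Fintype.card 𝓀[K])
    (sR : Finset {M : Submodule 𝒪[K] (Fin 3 → K) // IsVertex σ ϖ ((StdForm.antidiagonal 3).over K) M}) (hsR : ∀ v, v ∈ sR ↔ v ∈ {v : {M : Submodule 𝒪[K] (Fin 3 → K) // IsVertex σ ϖ ((StdForm.antidiagonal 3).over K) M} | latticeGraphIso σ ϖ ((StdForm.antidiagonal 3).over K) γ v = v ∧ IsSelfDualLattice σ ϖ ((StdForm.antidiagonal 3).over K) v.1 ∧ v.1.map ((Matrix.toLin' (((γ : GL (Fin 3) K) : Matrix (Fin 3) (Fin 3) K) - 1)).restrictScalars 𝒪[K]) ≤ scaleLattice (ϖ ^ d₀) v.1})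
    (PE PP PM : ℕ)
    (hPE : ∑ v ∈ sR, ({w | w ∈ {w | ∃ c, ((latticeGraph σ ϖ ((StdForm.antidiagonal 3).over K)).Adj v c ∧ (latticeGraph σ ϖ ((StdForm.antidiagonal 3).over K)).dist ⟨stdLattice K 3, 0, isSelfDualLattice_stdLattice_three_of_v hϖ⟩ c = (latticeGraph σ ϖ ((StdForm.antidiagonal 3).over K)).dist ⟨stdLattice K 3, 0, isSelfDualLattice_stdLattice_three_of_v hϖ⟩ v + 1 ∧ latticeGraphIso σ ϖ ((StdForm.antidiagonal 3).over K) γ c = c) ∧ ((latticeGraph σ ϖ ((StdForm.antidiagonal 3).over K)).Adj c w ∧ (latticeGraph σ ϖ ((StdForm.antidiagonal 3).over K)).dist ⟨stdLattice K 3, 0, isSelfDualLattice_stdLattice_three_of_v hϖ⟩ w = (latticeGraph σ ϖ ((StdForm.antidiagonal 3).over K)).dist ⟨stdLattice K 3, 0, isSelfDualLattice_stdLattice_three_of_v hϖ⟩ c + 1 ∧ latticeGraphIso σ ϖ ((StdForm.antidiagonal 3).over K) γ w = w)} ∧ (¬ w.1.map ((Matrix.toLin' (((γ : GL (Fin 3)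 K) : Matrix (Fin 3) (Fin 3) K) - 1)).restrictScalars 𝒪[K]) ≤ scaleLattice (ϖ ^ d₀) w.1 ∧ (w.1.map ((Matrix.toLin' (((γ : GL (Fin 3) K) : Matrix (Fin 3) (Fin 3) K) - 1)).restrictScalars 𝒪[K]) ≤ scaleLattice (ϖ ^ (d₀ - 1)) w.1 ∧ ¬ w.1.map ((Matrix.toLin' (((γ : GL (Fin 3) K) : Matrix (Fin 3) (Fin 3) K) - 1)).restrictScalars 𝒪[K]) ≤ scaleLattice (ϖ ^ d₀) w.1))}).ncard = q * PE)
    (hPP : ∑ v ∈ sR, ({w | w ∈ {w | ∃ c, ((latticeGraph σ ϖ ((StdForm.antidiagonal 3).over K)).Adj v c ∧ (latticeGraph σ ϖ ((StdForm.antidiagonal 3).over K)).dist ⟨stdLattice K 3, 0, isSelfDualLattice_stdLattice_three_of_v hϖ⟩ c = (latticeGraph σ ϖ ((StdForm.antidiagonal 3).over K)).dist ⟨stdLattice K 3, 0, isSelfDualLattice_stdLattice_three_of_v hϖ⟩ v + 1 ∧ latticeGraphIso σ ϖ ((StdForm.antidiagonal 3).over K) γ c = c) ∧ ((latticeGraph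 σ ϖ ((StdForm.antidiagonal 3).over K)).Adj c w ∧ (latticeGraph σ ϖ ((StdForm.antidiagonal 3).over K)).dist ⟨stdLattice K 3, 0, isSelfDualLattice_stdLattice_three_of_v hϖ⟩ w = (latticeGraph σ ϖ ((StdForm.antidiagonal 3).over K)).dist ⟨stdLattice K 3, 0, isSelfDualLattice_stdLattice_three_of_v hϖ⟩ c + 1 ∧ latticeGraphIso σ ϖ ((StdForm.antidiagonal 3).over K) γ w = w)} ∧ (¬ w.1.map ((Matrix.toLin' (((γ : GL (Fin 3) K) : Matrix (Fin 3) (Fin 3) K) - 1)).restrictScalars 𝒪[K]) ≤ scaleLattice (ϖ ^ d₀) w.1 ∧ (w.1.map ((Matrix.toLin' (((γ : GL (Fin 3) K) : Matrix (Fin 3) (Fin 3) K) - 1)).restrictScalars 𝒪[K]) ≤ scaleLattice (ϖ ^ (d₀ - 2)) w.1 ∧ ¬ w.1.map ((Matrix.toLin' (((γ : GL (Fin 3) K) : Matrix (Fin 3) (Fin 3) K) - 1)).restrictScalars 𝒪[K]) ≤ scaleLattice (ϖ ^ (d₀ - 1)) w.1) ∧ ∃ y ∈ w.1, ∃ a :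 K, Valued.v a = 1 ∧ Valued.v ((ϖ ^ (d₀ - 2))⁻¹ * pairing σ ((StdForm.antidiagonal 3).over K) y ((((γ : GL (Fin 3) K) : Matrix (Fin 3) (Fin 3) K) - 1) *ᵥ y) - (c₁) * a ^ 2) < 1)}).ncard = q * PP)
    (hPM : ∑ v ∈ sR, ({w | w ∈ {w | ∃ c, ((latticeGraph σ ϖ ((StdForm.antidiagonal 3).over K)).Adj v c ∧ (latticeGraph σ ϖ ((StdForm.antidiagonal 3).over K)).dist ⟨stdLattice K 3, 0, isSelfDualLattice_stdLattice_three_of_v hϖ⟩ c = (latticeGraph σ ϖ ((StdForm.antidiagonal 3).over K)).dist ⟨stdLattice K 3, 0, isSelfDualLattice_stdLattice_three_of_v hϖ⟩ v + 1 ∧ latticeGraphIso σ ϖ ((StdForm.antidiagonal 3).over K) γ c = c) ∧ ((latticeGraph σ ϖ ((StdForm.antidiagonal 3).over K)).Adj c w ∧ (latticeGraph σ ϖ ((StdForm.antidiagonal 3).over K)).dist ⟨stdLattice K 3, 0, isSelfDualLattice_stdLattice_three_of_v hϖ⟩ w = (latticeGraph σ ϖ ((StdForm.antidiagonal 3).over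 K)).dist ⟨stdLattice K 3, 0, isSelfDualLattice_stdLattice_three_of_v hϖ⟩ c + 1 ∧ latticeGraphIso σ ϖ ((StdForm.antidiagonal 3).over K) γ w = w)} ∧ (¬ w.1.map ((Matrix.toLin' (((γ : GL (Fin 3) K) : Matrix (Fin 3) (Fin 3) K) - 1)).restrictScalars 𝒪[K]) ≤ scaleLattice (ϖ ^ d₀) w.1 ∧ (w.1.map ((Matrix.toLin' (((γ : GL (Fin 3) K) : Matrix (Fin 3) (Fin 3) K) - 1)).restrictScalars 𝒪[K]) ≤ scaleLattice (ϖ ^ (d₀ - 2)) w.1 ∧ ¬ w.1.map ((Matrix.toLin' (((γ : GL (Fin 3) K) : Matrix (Fin 3) (Fin 3) K) - 1)).restrictScalars 𝒪[K]) ≤ scaleLattice (ϖ ^ (d₀ - 1)) w.1) ∧ ¬ (∃ y ∈ w.1, ∃ a : K, Valued.v a = 1 ∧ Valued.v ((ϖ ^ (d₀ - 2))⁻¹ * pairing σ ((StdForm.antidiagonal 3).over K) y ((((γ : GL (Fin 3) K) : Matrix (Fin 3) (Fin 3) K) - 1) *ᵥ y) - (c₁) * a ^ 2) < 1))}).ncard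 = q * PM) (j : Fin 5),
      ({M : Submodule 𝒪[K] (Fin 3 → K) | IsSelfDualLattice σ ϖ ((StdForm.antidiagonal 3).over K) M ∧ mapGL (γ : GL (Fin 3) K) M = M ∧
        (![¬ M.map ((Matrix.toLin' (((γ : GL (Fin 3) K) : Matrix (Fin 3) (Fin 3) K) - 1)).restrictScalars 𝒪[K]) ≤ scaleLattice ϖ M,
                  M.map ((Matrix.toLin' (((γ : GL (Fin 3) K) : Matrix (Fin 3) (Fin 3) K) - 1)).restrictScalars 𝒪[K]) ≤ scaleLattice ϖ M ∧
                    ¬ M.map ((Matrix.toLin' (((γ : GL (Fin 3) K) : Matrix (Fin 3) (Fin 3) K) - 1)).restrictScalars 𝒪[K]) ≤ scaleLattice (ϖ ^ 2) M ∧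
                    ¬ M.map ((Matrix.toLin' ((((γ : GL (Fin 3) K) : Matrix (Fin 3) (Fin 3) K) - 1) ^ 2)).restrictScalars 𝒪[K]) ≤ scaleLattice (ϖ ^ 3) M,
                  M.map ((Matrix.toLin' (((γ : GL (Fin 3) K) : Matrix (Fin 3) (Fin 3) K) - 1)).restrictScalars 𝒪[K]) ≤ scaleLattice ϖ M ∧
                    ¬ M.map ((Matrix.toLin' (((γ : GL (Fin 3) K) : Matrix (Fin 3) (Fin 3) K) - 1)).restrictScalars 𝒪[K]) ≤ scaleLattice (ϖ ^ 2) M ∧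
                    M.map ((Matrix.toLin' ((((γ : GL (Fin 3) K) : Matrix (Fin 3) (Fin 3) K) - 1) ^ 2)).restrictScalars 𝒪[K]) ≤ scaleLattice (ϖ ^ 3) M ∧
                    ∃ y ∈ M, ∃ a : K, Valued.v a = 1 ∧
                      Valued.v (ϖ⁻¹ * pairing σ (((StdForm.antidiagonal 3).over K)) y
                        ((((γ : GL (Fin 3) K) : Matrix (Fin 3) (Fin 3) K) - 1) *ᵥ y) - c₁ * a ^ 2) < 1,
                  M.map ((Matrix.toLin' (((γ : GL (Fin 3) K) : Matrix (Fin 3) (Fin 3) K) - 1)).restrictScalars 𝒪[K]) ≤ scaleLattice ϖ M ∧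
                    ¬ M.map ((Matrix.toLin' (((γ : GL (Fin 3) K) : Matrix (Fin 3) (Fin 3) K) - 1)).restrictScalars 𝒪[K]) ≤ scaleLattice (ϖ ^ 2) M ∧
                    M.map ((Matrix.toLin' ((((γ : GL (Fin 3) K) : Matrix (Fin 3) (Fin 3) K) - 1) ^ 2)).restrictScalars 𝒪[K]) ≤ scaleLattice (ϖ ^ 3) M ∧
                    ∃ y ∈ M, ∃ a : K, Valued.v a = 1 ∧
                      Valued.v (ϖ⁻¹ * pairing σ (((StdForm.antidiagonal 3).over K)) y
                        ((((γ : GL (Fin 3) K) : Matrix (Fin 3) (Fin 3) K) - 1) *ᵥ y) - c₁ * ε * a ^ 2) < 1,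
                  M.map ((Matrix.toLin' (((γ : GL (Fin 3) K) : Matrix (Fin 3) (Fin 3) K) - 1)).restrictScalars 𝒪[K]) ≤ scaleLattice (ϖ ^ 2) M] : Fin 5 → Prop) j}.ncard) =
      (if IsSquare (-1 : 𝓀[K]) then
          (sR.card • (![0, 0, 0, 0, 1] : Fin 5 → ℕ) + (q * PE) • (![q ^ (3 * mA + 3), q ^ (3 * mA + 2), q.choose 2 * q ^ (2 * mA) * ∑ i ∈ Finset.range mA, q ^ i, q.choose 2 * q ^ (2 * mA) * ∑ i ∈ Finset.range mA, q ^ i,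
          ∑ i ∈ Finset.range (mA + 1), q ^ (2 * i) + ∑ i ∈ Finset.range mA, q ^ (2 * mA + 1 + i)] : Fin 5 → ℕ) + (q * PP) • (![0, 0, q ^ (2 * mA), 0, ∑ i ∈ Finset.range mA, q ^ (2 * i)] : Fin 5 → ℕ) + (q * PM) • (![0, 0, 0, q ^ (2 * mA), ∑ i ∈ Finset.range mA, q ^ (2 * i)] : Fin 5 → ℕ)) j
        else
          (sR.card • (![0, 0, 0, 0, 1] : Fin 5 → ℕ) + (q * PE) • (![q ^ (3 * mA + 3), q ^ (3 * mA + 2), q.choose 2 * q ^ (2 * mA) * ∑ i ∈ Finset.range mA, q ^ i, q.choose 2 * q ^ (2 * mA) * ∑ i ∈ Finset.range mA, q ^ i,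
          ∑ i ∈ Finset.range (mA + 1), q ^ (2 * i) + ∑ i ∈ Finset.range mA, q ^ (2 * mA + 1 + i)] : Fin 5 → ℕ) + (q * PP) • (![0, 0, if Even mA then q ^ (2 * mA) else 0, if Even mA then 0 else q ^ (2 * mA), ∑ i ∈ Finset.range mA, q ^ (2 * i)] : Fin 5 → ℕ) + (q * PM) • (![0, 0, if Even mA then 0 else q ^ (2 * mA), if Even mA then q ^ (2 * mA) else 0, ∑ i ∈ Finset.range mA, q ^ (2 * i)] : Fin 5 → ℕ)) j))
    (hHyp : ∀ [ValuativeRel K] [(Valued.v : Valuation K ℤᵐ⁰).Compatible]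
    (hσ : ∀ x, σ (σ x) = x) (hvσ : ∀ a, Valued.v (σ a) = Valued.v a) (hσϖ : σ ϖ = -ϖ)
    (hϖ : Valued.v ϖ = WithZero.exp (-1 : ℤ)) (hres : ∀ x : K, Valued.v x ≤ 1 → Valued.v (σ x - x) < 1) (h2 : Valued.v (2 : K) = 1)
    (hnorm : ∀ u : K, σ u = u → Valued.v (u - 1) < 1 → ∃ z : K, z * σ z = u ∧ Valued.v (z - 1) ≤ Valued.v (u - 1)) [Fintype 𝓀[K]] [DecidableEq 𝓀[K]]
    {γ : unitaryGroupOfForm σ ((StdForm.antidiagonal 3).over K)} (hγ0 : γ ∈ unitaryInt σ ((StdForm.antidiagonal 3).over K))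
    (d : Fin 3 → K) (hd : ∀ i, Valued.v (d i) = 1) (hdσ : ∀ i, σ (d i) = d i)
    (A : GL (Fin 3) K) (hA : IsIntMatrix (A : Matrix (Fin 3) (Fin 3) K)) (hA' : IsIntMatrix ((A⁻¹ : GL (Fin 3) K) : Matrix (Fin 3) (Fin 3) K))
    (hdA : Matrix.diagonal d = (-(Matrix.diagonal d).det) • formCongr σ A ((StdForm.antidiagonal 3).over K))
    (s : Fin 3 → K) (hs1 : s 1 = 1) (hsv : ∀ i, Valued.v (s i) = 1) (hsσ : ∀ i, s i * σ (s i) = 1)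
    (hγA : ((γ : GL (Fin 3) K) : Matrix (Fin 3) (Fin 3) K) = (A : Matrix (Fin 3) (Fin 3) K) * Matrix.diagonal s * ((A⁻¹ : GL (Fin 3) K) : Matrix (Fin 3) (Fin 3) K))
    (i₀ : Fin 3) {d₀ : ℕ} (hd3 : 3 ≤ d₀) (he : ∀ i, Valued.v (s i - 1) ≤ Valued.v ϖ ^ d₀)
    (hiso : ∀ j, j ≠ i₀ → Valued.v (s i₀ - s j) = Valued.v ϖ ^ d₀) (hclose : ∀ j k, j ≠ i₀ → k ≠ i₀ → Valued.v (s j - s k) ≤ Valued.v ϖ ^ (d₀ + 2))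
    (hreg : ∀ i j, i ≠ j → s i ≠ s j)
    (mA : ℕ) (hmA : d₀ = 2 * mA + 3)
    (c₁ ε : K) (hc₁ : Valued.v c₁ = 1) (hεv : Valued.v ε = 1) (hε : ∀ z : K, Valued.v z ≤ 1 → Valued.v (z ^ 2 - ε) = 1)
    (q : ℕ) (hq : q = Fintype.card 𝓀[K])
    (sR : Finset {M : Submodule 𝒪[K] (Fin 3 → K) // IsVertex σ ϖ ((StdForm.antidiagonal 3).over K) M}) (hsR : ∀ v, v ∈ sR ↔ v ∈ {v : {M : Submodule 𝒪[K] (Fin 3 → K) // IsVertex σ ϖ ((StdForm.antidiagonal 3).over K) M} | latticeGraphIso σ ϖ ((StdForm.antidiagonal 3).over K) γ v = v ∧ IsSelfDualLattice σ ϖ ((StdForm.antidiagonal 3).over K) v.1 ∧ v.1.map ((Matrix.toLin' (((γ : GL (Fin 3) K) : Matrix (Fin 3) (Fin 3) K) - 1)).restrictScalars 𝒪[K]) ≤ scaleLattice (ϖ ^ d₀) v.1})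
    (s' : ℕ) (hs' : 1 ≤ s') (hgap : ∀ j k, j ≠ i₀ → k ≠ i₀ → j ≠ k → Valued.v (s j - s k) = Valued.v ϖ ^ (d₀ + 2 * s'))
    {j k : Fin 3} (hj : j ≠ i₀) (hk : k ≠ i₀) (hjk : j ≠ k)
    (hhyp : ∃ t : K, Valued.v t = 1 ∧ Valued.v (d j + t * σ t * d k) < 1),
      sR.card = 1 + 2 * q * ∑ i ∈ Finset.range s', q ^ i ∧
    ∑ v ∈ sR, ({w | w ∈ {w | ∃ c, ((latticeGraph σ ϖ ((StdForm.antidiagonal 3).over K)).Adj v c ∧ (latticeGraph σ ϖ ((StdForm.antidiagonal 3).over K)).dist ⟨stdLattice K 3, 0, isSelfDualLattice_stdLattice_three_of_v hϖ⟩ c = (latticeGraph σ ϖ ((StdForm.antidiagonal 3).over K)).dist ⟨stdLattice K 3, 0, isSelfDualLattice_stdLattice_three_of_v hϖ⟩ v + 1 ∧ latticeGraphIso σ ϖ ((StdForm.antidiagonal 3).over K) γ c = c) ∧ ((latticeGraph σ ϖ ((StdForm.antidiagonal 3).over K)).Adj c w ∧ (latticeGraph σ ϖ ((StdForm.antidiagonal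 3).over K)).dist ⟨stdLattice K 3, 0, isSelfDualLattice_stdLattice_three_of_v hϖ⟩ w = (latticeGraph σ ϖ ((StdForm.antidiagonal 3).over K)).dist ⟨stdLattice K 3, 0, isSelfDualLattice_stdLattice_three_of_v hϖ⟩ c + 1 ∧ latticeGraphIso σ ϖ ((StdForm.antidiagonal 3).over K) γ w = w)} ∧ (¬ w.1.map ((Matrix.toLin' (((γ : GL (Fin 3) K) : Matrix (Fin 3) (Fin 3) K) - 1)).restrictScalars 𝒪[K]) ≤ scaleLattice (ϖ ^ d₀) w.1 ∧ (w.1.map ((Matrix.toLin' (((γ : GL (Fin 3) K) : Matrix (Fin 3) (Fin 3) K) - 1)).restrictScalars 𝒪[K]) ≤ scaleLattice (ϖ ^ (d₀ - 1)) w.1 ∧ ¬ w.1.map ((Matrix.toLin' (((γ : GL (Fin 3) K) : Matrix (Fin 3) (Fin 3) K) - 1)).restrictScalars 𝒪[K]) ≤ scaleLattice (ϖ ^ d₀) w.1))}).ncard = q * (if (∃ t : K, Valued.v t = 1 ∧ Valued.v (t ^ 2 - ((-1) ^ (s' + 1) * ((ϖ ^ d₀)⁻¹ * (s i₀ - s j))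 * ((ϖ ^ (d₀ + 2 * s'))⁻¹ * (s k - s j)) * (d i₀ * d k))) < 1) then 4 * q ^ s' else 0) ∧
    ∑ v ∈ sR, ({w | w ∈ {w | ∃ c, ((latticeGraph σ ϖ ((StdForm.antidiagonal 3).over K)).Adj v c ∧ (latticeGraph σ ϖ ((StdForm.antidiagonal 3).over K)).dist ⟨stdLattice K 3, 0, isSelfDualLattice_stdLattice_three_of_v hϖ⟩ c = (latticeGraph σ ϖ ((StdForm.antidiagonal 3).over K)).dist ⟨stdLattice K 3, 0, isSelfDualLattice_stdLattice_three_of_v hϖ⟩ v + 1 ∧ latticeGraphIso σ ϖ ((StdForm.antidiagonal 3).over K) γ c = c) ∧ ((latticeGraph σ ϖ ((StdForm.antidiagonal 3).over K)).Adj c w ∧ (latticeGraph σ ϖ ((StdForm.antidiagonal 3).over K)).dist ⟨stdLattice K 3, 0, isSelfDualLattice_stdLattice_three_of_v hϖ⟩ w = (latticeGraph σ ϖ ((StdForm.antidiagonal 3).over K)).dist ⟨stdLattice K 3, 0, isSelfDualLattice_stdLattice_three_of_v hϖ⟩ c + 1 ∧ latticeGraphIso σ ϖ ((StdForm.antidiagonal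 3).over K) γ w = w)} ∧ (¬ w.1.map ((Matrix.toLin' (((γ : GL (Fin 3) K) : Matrix (Fin 3) (Fin 3) K) - 1)).restrictScalars 𝒪[K]) ≤ scaleLattice (ϖ ^ d₀) w.1 ∧ (w.1.map ((Matrix.toLin' (((γ : GL (Fin 3) K) : Matrix (Fin 3) (Fin 3) K) - 1)).restrictScalars 𝒪[K]) ≤ scaleLattice (ϖ ^ (d₀ - 2)) w.1 ∧ ¬ w.1.map ((Matrix.toLin' (((γ : GL (Fin 3) K) : Matrix (Fin 3) (Fin 3) K) - 1)).restrictScalars 𝒪[K]) ≤ scaleLattice (ϖ ^ (d₀ - 1)) w.1) ∧ ∃ y ∈ w.1, ∃ a : K, Valued.v a = 1 ∧ Valued.v ((ϖ ^ (d₀ - 2))⁻¹ * pairing σ ((StdForm.antidiagonal 3).over K) y ((((γ : GL (Fin 3) K) : Matrix (Fin 3) (Fin 3) K) - 1) *ᵥ y) - (c₁) * a ^ 2) < 1)}).ncard = q * (if (∃ a : K, Valued.v a = 1 ∧ Valued.v (((ϖ ^ d₀)⁻¹ * (s i₀ - s j) * (d i₀ * (-(Matrix.diagonal d).det)⁻¹))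 + c₁ * a ^ 2) < 1) then (if (∃ t : K, Valued.v t = 1 ∧ Valued.v (t ^ 2 - ((-1) ^ (s' + 1) * ((ϖ ^ d₀)⁻¹ * (s i₀ - s j)) * ((ϖ ^ (d₀ + 2 * s'))⁻¹ * (s k - s j)) * (d i₀ * d k))) < 1) then (q - 1) * (1 + 2 * q * ∑ i ∈ Finset.range (s' - 1), q ^ i) + q ^ s' * (q - 3) else (q - 1) * (1 + 2 * q * ∑ i ∈ Finset.range (s' - 1), q ^ i) + q ^ s' * (q - 1)) else (if (∃ t : K, Valued.v t = 1 ∧ Valued.v (t ^ 2 - ((-1) ^ (s' + 1) * ((ϖ ^ d₀)⁻¹ * (s i₀ - s j)) * ((ϖ ^ (d₀ + 2 * s'))⁻¹ * (s k - s j)) * (d i₀ * d k))) < 1) then q ^ s' * (q - 1) else q ^ s' * (q + 1))) ∧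
    ∑ v ∈ sR, ({w | w ∈ {w | ∃ c, ((latticeGraph σ ϖ ((StdForm.antidiagonal 3).over K)).Adj v c ∧ (latticeGraph σ ϖ ((StdForm.antidiagonal 3).over K)).dist ⟨stdLattice K 3, 0, isSelfDualLattice_stdLattice_three_of_v hϖ⟩ c = (latticeGraph σ ϖ ((StdForm.antidiagonal 3).over K)).dist ⟨stdLattice K 3, 0, isSelfDualLattice_stdLattice_three_of_v hϖ⟩ v + 1 ∧ latticeGraphIso σ ϖ ((StdForm.antidiagonal 3).over K) γ c = c) ∧ ((latticeGraph σ ϖ ((StdForm.antidiagonal 3).over K)).Adj c w ∧ (latticeGraph σ ϖ ((StdForm.antidiagonal 3).over K)).dist ⟨stdLattice K 3, 0, isSelfDualLattice_stdLattice_three_of_v hϖ⟩ w = (latticeGraph σ ϖ ((StdForm.antidiagonal 3).over K)).dist ⟨stdLattice K 3, 0, isSelfDualLattice_stdLattice_three_of_v hϖ⟩ c + 1 ∧ latticeGraphIso σ ϖ ((StdForm.antidiagonal 3).over K) γ w = w)} ∧ (¬ w.1.map ((Matrix.toLin' (((γ : GL (Fin 3) K) : Matrix (Fin 3) (Fin 3)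 K) - 1)).restrictScalars 𝒪[K]) ≤ scaleLattice (ϖ ^ d₀) w.1 ∧ (w.1.map ((Matrix.toLin' (((γ : GL (Fin 3) K) : Matrix (Fin 3) (Fin 3) K) - 1)).restrictScalars 𝒪[K]) ≤ scaleLattice (ϖ ^ (d₀ - 2)) w.1 ∧ ¬ w.1.map ((Matrix.toLin' (((γ : GL (Fin 3) K) : Matrix (Fin 3) (Fin 3) K) - 1)).restrictScalars 𝒪[K]) ≤ scaleLattice (ϖ ^ (d₀ - 1)) w.1) ∧ ¬ (∃ y ∈ w.1, ∃ a : K, Valued.v a = 1 ∧ Valued.v ((ϖ ^ (d₀ - 2))⁻¹ * pairing σ ((StdForm.antidiagonal 3).over K) y ((((γ : GL (Fin 3) K) : Matrix (Fin 3) (Fin 3) K) - 1) *ᵥ y) - (c₁) * a ^ 2) < 1))}).ncard = q * (if (∃ a : K, Valued.v a = 1 ∧ Valued.v (((ϖ ^ d₀)⁻¹ * (s i₀ - s j) * (d i₀ * (-(Matrix.diagonal d).det)⁻¹)) + c₁ * a ^ 2) < 1) then (if (∃ t : K, Valued.v t = 1 ∧ Valued.v (t ^ 2 - ((-1) ^ (s'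 + 1) * ((ϖ ^ d₀)⁻¹ * (s i₀ - s j)) * ((ϖ ^ (d₀ + 2 * s'))⁻¹ * (s k - s j)) * (d i₀ * d k))) < 1) then q ^ s' * (q - 1) else q ^ s' * (q + 1)) else (if (∃ t : K, Valued.v t = 1 ∧ Valued.v (t ^ 2 - ((-1) ^ (s' + 1) * ((ϖ ^ d₀)⁻¹ * (s i₀ - s j)) * ((ϖ ^ (d₀ + 2 * s'))⁻¹ * (s k - s j)) * (d i₀ * d k))) < 1) then (q - 1) * (1 + 2 * q * ∑ i ∈ Finset.range (s' - 1), q ^ i) + q ^ s' * (q - 3) else (q - 1) * (1 + 2 * q * ∑ i ∈ Finset.range (s' - 1), q ^ i) + q ^ s' * (q - 1))))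
    (hBare : ∀ [ValuativeRel K] [(Valued.v : Valuation K ℤᵐ⁰).Compatible]
    (hσ : ∀ x, σ (σ x) = x) (hvσ : ∀ a, Valued.v (σ a) = Valued.v a) (hσϖ : σ ϖ = -ϖ)
    (hϖ : Valued.v ϖ = WithZero.exp (-1 : ℤ)) (hres : ∀ x : K, Valued.v x ≤ 1 → Valued.v (σ x - x) < 1) (h2 : Valued.v (2 : K) = 1)
    (hnorm : ∀ u : K, σ u = u → Valued.v (u - 1) < 1 → ∃ z : K, z * σ z = u ∧ Valued.v (z - 1) ≤ Valued.v (u - 1)) [Fintype 𝓀[K]] [DecidableEq 𝓀[K]]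
    {γ : unitaryGroupOfForm σ ((StdForm.antidiagonal 3).over K)} (hγ0 : γ ∈ unitaryInt σ ((StdForm.antidiagonal 3).over K))
    (d : Fin 3 → K) (hd : ∀ i, Valued.v (d i) = 1) (hdσ : ∀ i, σ (d i) = d i)
    (A : GL (Fin 3) K) (hA : IsIntMatrix (A : Matrix (Fin 3) (Fin 3) K)) (hA' : IsIntMatrix ((A⁻¹ : GL (Fin 3) K) : Matrix (Fin 3) (Fin 3) K))
    (hdA : Matrix.diagonal d = (-(Matrix.diagonal d).det) • formCongr σ A ((StdForm.antidiagonal 3).over K))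
    (s : Fin 3 → K) (hs1 : s 1 = 1) (hsv : ∀ i, Valued.v (s i) = 1) (hsσ : ∀ i, s i * σ (s i) = 1)
    (hγA : ((γ : GL (Fin 3) K) : Matrix (Fin 3) (Fin 3) K) = (A : Matrix (Fin 3) (Fin 3) K) * Matrix.diagonal s * ((A⁻¹ : GL (Fin 3) K) : Matrix (Fin 3) (Fin 3) K))
    (i₀ : Fin 3) {d₀ : ℕ} (hd3 : 3 ≤ d₀) (he : ∀ i, Valued.v (s i - 1) ≤ Valued.v ϖ ^ d₀)
    (hiso : ∀ j, j ≠ i₀ → Valued.v (s i₀ - s j) = Valued.v ϖ ^ d₀) (hclose : ∀ j k, j ≠ i₀ → k ≠ i₀ → Valued.v (s j - s k) ≤ Valued.v ϖ ^ (d₀ + 2))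
    (hreg : ∀ i j, i ≠ j → s i ≠ s j)
    (mA : ℕ) (hmA : d₀ = 2 * mA + 3)
    (c₁ ε : K) (hc₁ : Valued.v c₁ = 1) (hεv : Valued.v ε = 1) (hε : ∀ z : K, Valued.v z ≤ 1 → Valued.v (z ^ 2 - ε) = 1)
    (q : ℕ) (hq : q = Fintype.card 𝓀[K])
    (sR : Finset {M : Submodule 𝒪[K] (Fin 3 → K) // IsVertex σ ϖ ((StdForm.antidiagonal 3).over K) M}) (hsR : ∀ v, v ∈ sR ↔ v ∈ {v : {M : Submodule 𝒪[K] (Fin 3 → K) // IsVertex σ ϖ ((StdForm.antidiagonal 3).over K) M} | latticeGraphIso σ ϖ ((StdForm.antidiagonal 3).over K) γ v = v ∧ IsSelfDualLattice σ ϖ ((StdForm.antidiagonal 3).over K) v.1 ∧ v.1.map ((Matrix.toLin' (((γ : GL (Fin 3) K) : Matrix (Fin 3) (Fin 3) K) - 1)).restrictScalars 𝒪[K]) ≤ scaleLattice (ϖ ^ d₀) v.1})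
    (s' : ℕ) (hs' : 1 ≤ s') (hgap : ∀ j k, j ≠ i₀ → k ≠ i₀ → j ≠ k → Valued.v (s j - s k) = Valued.v ϖ ^ (d₀ + 2 * s'))
    {j k : Fin 3} (hj : j ≠ i₀) (hk : k ≠ i₀) (hjk : j ≠ k)
    (haniso : ¬ ∃ t : K, Valued.v t = 1 ∧ Valued.v (d j + t * σ t * d k) < 1),
      sR.card = 1 ∧
    ∑ v ∈ sR, ({w | w ∈ {w | ∃ c, ((latticeGraph σ ϖ ((StdForm.antidiagonal 3).over K)).Adj v c ∧ (latticeGraph σ ϖ ((StdForm.antidiagonal 3).over K)).dist ⟨stdLattice K 3, 0, isSelfDualLattice_stdLattice_three_of_v hϖ⟩ c = (latticeGraph σ ϖ ((StdForm.antidiagonal 3).over K)).dist ⟨stdLattice K 3, 0, isSelfDualLattice_stdLattice_three_of_v hϖ⟩ v + 1 ∧ latticeGraphIso σ ϖ ((StdForm.antidiagonal 3).over K) γ c = c) ∧ ((latticeGraph σ ϖ ((StdForm.antidiagonal 3).over K)).Adj c w ∧ (latticeGraph σ ϖ ((StdForm.antidiagonal 3).over K)).dist ⟨stdLattice K 3,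 0, isSelfDualLattice_stdLattice_three_of_v hϖ⟩ w = (latticeGraph σ ϖ ((StdForm.antidiagonal 3).over K)).dist ⟨stdLattice K 3, 0, isSelfDualLattice_stdLattice_three_of_v hϖ⟩ c + 1 ∧ latticeGraphIso σ ϖ ((StdForm.antidiagonal 3).over K) γ w = w)} ∧ (¬ w.1.map ((Matrix.toLin' (((γ : GL (Fin 3) K) : Matrix (Fin 3) (Fin 3) K) - 1)).restrictScalars 𝒪[K]) ≤ scaleLattice (ϖ ^ d₀) w.1 ∧ (w.1.map ((Matrix.toLin' (((γ : GL (Fin 3) K) : Matrix (Fin 3) (Fin 3) K) - 1)).restrictScalars 𝒪[K]) ≤ scaleLattice (ϖ ^ (d₀ - 1)) w.1 ∧ ¬ w.1.map ((Matrix.toLin' (((γ : GL (Fin 3) K) : Matrix (Fin 3) (Fin 3) K) - 1)).restrictScalars 𝒪[K]) ≤ scaleLattice (ϖ ^ d₀) w.1))}).ncard = q * 0 ∧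
    ∑ v ∈ sR, ({w | w ∈ {w | ∃ c, ((latticeGraph σ ϖ ((StdForm.antidiagonal 3).over K)).Adj v c ∧ (latticeGraph σ ϖ ((StdForm.antidiagonal 3).over K)).dist ⟨stdLattice K 3, 0, isSelfDualLattice_stdLattice_three_of_v hϖ⟩ c = (latticeGraph σ ϖ ((StdForm.antidiagonal 3).over K)).dist ⟨stdLattice K 3, 0, isSelfDualLattice_stdLattice_three_of_v hϖ⟩ v + 1 ∧ latticeGraphIso σ ϖ ((StdForm.antidiagonal 3).over K) γ c = c) ∧ ((latticeGraph σ ϖ ((StdForm.antidiagonal 3).over K)).Adj c w ∧ (latticeGraph σ ϖ ((StdForm.antidiagonal 3).over K)).dist ⟨stdLattice K 3, 0, isSelfDualLattice_stdLattice_three_of_v hϖ⟩ w = (latticeGraph σ ϖ ((StdForm.antidiagonal 3).over K)).dist ⟨stdLattice K 3, 0, isSelfDualLattice_stdLattice_three_of_v hϖ⟩ c + 1 ∧ latticeGraphIso σ ϖ ((StdForm.antidiagonal 3).over K) γ w = w)} ∧ (¬ w.1.map ((Matrix.toLin' (((γ : GL (Fin 3) K) : Matrix (Fin 3) (Fin 3)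 K) - 1)).restrictScalars 𝒪[K]) ≤ scaleLattice (ϖ ^ d₀) w.1 ∧ (w.1.map ((Matrix.toLin' (((γ : GL (Fin 3) K) : Matrix (Fin 3) (Fin 3) K) - 1)).restrictScalars 𝒪[K]) ≤ scaleLattice (ϖ ^ (d₀ - 2)) w.1 ∧ ¬ w.1.map ((Matrix.toLin' (((γ : GL (Fin 3) K) : Matrix (Fin 3) (Fin 3) K) - 1)).restrictScalars 𝒪[K]) ≤ scaleLattice (ϖ ^ (d₀ - 1)) w.1) ∧ ∃ y ∈ w.1, ∃ a : K, Valued.v a = 1 ∧ Valued.v ((ϖ ^ (d₀ - 2))⁻¹ * pairing σ ((StdForm.antidiagonal 3).over K) y ((((γ : GL (Fin 3) K) : Matrix (Fin 3) (Fin 3) K) - 1) *ᵥ y) - (c₁) * a ^ 2) < 1)}).ncard = q * (if (∃ a : K, Valued.v a = 1 ∧ Valued.v (((ϖ ^ d₀)⁻¹ * (s i₀ - s j) * (d i₀ * (-(Matrix.diagonal d).det)⁻¹)) + c₁ * a ^ 2) < 1) then q + 1 else 0) ∧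
    ∑ v ∈ sR, ({w | w ∈ {w | ∃ c, ((latticeGraph σ ϖ ((StdForm.antidiagonal 3).over K)).Adj v c ∧ (latticeGraph σ ϖ ((StdForm.antidiagonal 3).over K)).dist ⟨stdLattice K 3, 0, isSelfDualLattice_stdLattice_three_of_v hϖ⟩ c = (latticeGraph σ ϖ ((StdForm.antidiagonal 3).over K)).dist ⟨stdLattice K 3, 0, isSelfDualLattice_stdLattice_three_of_v hϖ⟩ v + 1 ∧ latticeGraphIso σ ϖ ((StdForm.antidiagonal 3).over K) γ c = c) ∧ ((latticeGraph σ ϖ ((StdForm.antidiagonal 3).over K)).Adj c w ∧ (latticeGraph σ ϖ ((StdForm.antidiagonal 3).over K)).dist ⟨stdLattice K 3, 0, isSelfDualLattice_stdLattice_three_of_v hϖ⟩ w = (latticeGraph σ ϖ ((StdForm.antidiagonal 3).over K)).dist ⟨stdLattice K 3, 0, isSelfDualLattice_stdLattice_three_of_v hϖ⟩ c + 1 ∧ latticeGraphIso σ ϖ ((StdForm.antidiagonal 3).over K) γ w = w)} ∧ (¬ w.1.map ((Matrix.toLin' (((γ : GL (Fin 3) K) : Matrix (Fin 3) (Fin 3)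 K) - 1)).restrictScalars 𝒪[K]) ≤ scaleLattice (ϖ ^ d₀) w.1 ∧ (w.1.map ((Matrix.toLin' (((γ : GL (Fin 3) K) : Matrix (Fin 3) (Fin 3) K) - 1)).restrictScalars 𝒪[K]) ≤ scaleLattice (ϖ ^ (d₀ - 2)) w.1 ∧ ¬ w.1.map ((Matrix.toLin' (((γ : GL (Fin 3) K) : Matrix (Fin 3) (Fin 3) K) - 1)).restrictScalars 𝒪[K]) ≤ scaleLattice (ϖ ^ (d₀ - 1)) w.1) ∧ ¬ (∃ y ∈ w.1, ∃ a : K, Valued.v a = 1 ∧ Valued.v ((ϖ ^ (d₀ - 2))⁻¹ * pairing σ ((StdForm.antidiagonal 3).over K) y ((((γ : GL (Fin 3) K) : Matrix (Fin 3) (Fin 3) K) - 1) *ᵥ y) - (c₁) * a ^ 2) < 1))}).ncard = q * (if (∃ a : K, Valued.v a = 1 ∧ Valued.v (((ϖ ^ d₀)⁻¹ * (s i₀ - s j) * (d i₀ * (-(Matrix.diagonal d).det)⁻¹)) + c₁ * a ^ 2) < 1) then 0 else q + 1))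
    (hconf : ¬ (N₁ = N ∧ N₂ = N)) :
    ∀ j : Fin 5,
        ∑ b : Fin 2 × Fin 2, (-1 : ℚ) ^ (b.2 : ℕ) *
          (({M : Submodule (Valued.integer K) (Fin 3 → K) |
              IsSelfDualLattice σ ϖ (Matrix.diagonal ![((ε : K)) ^ (b.1 : ℕ) * (u₀ : K), (ε : K) ^ (b.2 : ℕ) * (u₁ : K), (ε : K) ^ ((b.1 : ℕ) + (b.2 : ℕ)) * (u₂ : K)]) M ∧ mapGL T M = M ∧
                (![-- bd : `¬ (T − 1)M ⊆ ϖM`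
                    ¬ M.map ((Matrix.toLin' ((T : Matrix (Fin 3) (Fin 3) K) - 1)).restrictScalars (Valued.integer K)) ≤ scaleLattice ϖ M,
                  -- reg : depth 1, rank 2
                    M.map ((Matrix.toLin' ((T : Matrix (Fin 3) (Fin 3) K) - 1)).restrictScalars (Valued.integer K)) ≤ scaleLattice ϖ M ∧
                      ¬ M.map ((Matrix.toLin' ((T : Matrix (Fin 3) (Fin 3) K) - 1)).restrictScalars (Valued.integer K)) ≤ scaleLattice (ϖ ^ 2) M ∧
                      ¬ M.map ((Matrix.toLin' (((T : Matrix (Fin 3) (Fin 3) K) - 1) ^ 2)).restrictScalars (Valued.integer K)) ≤ scaleLattice (ϖ ^ 3) M,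
                  -- 1s : depth 1, rank 1, class `c₀`
                    M.map ((Matrix.toLin' ((T : Matrix (Fin 3) (Fin 3) K) - 1)).restrictScalars (Valued.integer K)) ≤ scaleLattice ϖ M ∧
                      ¬ M.map ((Matrix.toLin' ((T : Matrix (Fin 3) (Fin 3) K) - 1)).restrictScalars (Valued.integer K)) ≤ scaleLattice (ϖ ^ 2) M ∧
                      M.map ((Matrix.toLin' (((T : Matrix (Fin 3) (Fin 3) K) - 1) ^ 2)).restrictScalars (Valued.integer K)) ≤ scaleLattice (ϖ ^ 3) M ∧
                      ∃ y ∈ M, ∃ a : K, Valued.v a = 1 ∧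
                        Valued.v (ϖ⁻¹ * pairing σ (Matrix.diagonal ![((ε : K)) ^ (b.1 : ℕ) * (u₀ : K), (ε : K) ^ (b.2 : ℕ) * (u₁ : K), (ε : K) ^ ((b.1 : ℕ) + (b.2 : ℕ)) * (u₂ : K)]) y
                          (((T : Matrix (Fin 3) (Fin 3) K) - 1) *ᵥ y) - (c₀ : K) * a ^ 2) < 1,
                  -- 1n : depth 1, rank 1, class `c₀·ε`
                    M.map ((Matrix.toLin' ((T : Matrix (Fin 3) (Fin 3) K) - 1)).restrictScalars (Valued.integer K)) ≤ scaleLattice ϖ M ∧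
                      ¬ M.map ((Matrix.toLin' ((T : Matrix (Fin 3) (Fin 3) K) - 1)).restrictScalars (Valued.integer K)) ≤ scaleLattice (ϖ ^ 2) M ∧
                      M.map ((Matrix.toLin' (((T : Matrix (Fin 3) (Fin 3) K) - 1) ^ 2)).restrictScalars (Valued.integer K)) ≤ scaleLattice (ϖ ^ 3) M ∧
                      ∃ y ∈ M, ∃ a : K, Valued.v a = 1 ∧
                        Valued.v (ϖ⁻¹ * pairing σ (Matrix.diagonal ![((ε : K)) ^ (b.1 : ℕ) * (u₀ : K), (ε : K) ^ (b.2 : ℕ) * (u₁ : K), (ε : K) ^ ((b.1 : ℕ) + (b.2 : ℕ)) * (u₂ : K)]) y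
                          (((T : Matrix (Fin 3) (Fin 3) K) - 1) *ᵥ y) - (c₀ : K) * (ε : K) * a ^ 2) < 1,
                  -- 0 : depth ≥ 2
                    M.map ((Matrix.toLin' ((T : Matrix (Fin 3) (Fin 3) K) - 1)).restrictScalars (Valued.integer K)) ≤ scaleLattice (ϖ ^ 2) M] : Fin 5 → Prop) j}.ncard : ℕ) : ℚ) =
          ((quadraticChar (Valued.ResidueField K) (IsLocalRing.residue (Valued.integer K) ((-1) ^ m * (u₀ * u₂ * A * C))) : ℤ) : ℚ) * (Fintype.card (Valued.ResidueField K) : ℚ) ^ m *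
            (![4 * (Fintype.card (Valued.ResidueField K) : ℚ) ^ n, 4 * (Fintype.card (Valued.ResidueField K) : ℚ) ^ (n - 1), (2 * ((Fintype.card (Valued.ResidueField K) : ℚ) ^ n - Fintype.card (Valued.ResidueField K) - 1)) / (Fintype.card (Valued.ResidueField K) : ℚ) ^ 2,
                (2 * ((Fintype.card (Valued.ResidueField K) : ℚ) ^ n - Fintype.card (Valued.ResidueField K) - 1)) / (Fintype.card (Valued.ResidueField K) : ℚ) ^ 2,
                (4 * ((Fintype.card (Valued.ResidueField K) : ℚ) ^ n - 1)) / (((Fintype.card (Valued.ResidueField K) : ℚ) - 1) * (Fintype.card (Valued.ResidueField K) : ℚ) ^ 2)] : Fin 5 → ℚ) j := by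
  classical
  intro j
  letI : ValuativeRel K := ValuativeRel.ofValuation (Valued.v : Valuation K ℤᵐ⁰)
  haveI : (Valued.v : Valuation K ℤᵐ⁰).Compatible := Valuation.Compatible.ofValuation _
  -- basic facts
  have hϖ0 : ϖ ≠ 0 := fun h0 => by rw [h0, map_zero] at hϖ; exact WithZero.coe_ne_zero hϖ.symm
  have hvϖ0 : Valued.v ϖ ≠ 0 := (Valuation.ne_zero_iff _).2 hϖ0
  have hk2 : ringChar 𝓀[K] ≠ 2 := ringChar_residueField_ne_two h2
  have hres0 : ∀ x : 𝒪[K], Valued.v (x : K) = 1 → IsLocalRing.residue 𝒪[K] x ≠ 0 := fun x hx h => by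
    rw [residue_eq_zero_iff_v_lt_one, hx] at h
    exact lt_irrefl _ h
  have hu₀' := hres0 u₀ hu₀
  have hu₁' := hres0 u₁ hu₁
  have hu₂' := hres0 u₂ hu₂
  have hc₀' := hres0 c₀ hc₀
  have hε' := hres0 ε hεv
  have hεχ : quadraticChar 𝓀[K] (IsLocalRing.residue 𝒪[K] ε) = -1 := (quadraticChar_neg_one_iff_not_isSquare).2 hε
  have huv : Valued.v u = 1 := v_eq_one_of_mul_map_eq_one hvσ hu
  have hu0 : u ≠ 0 := fun h => by rw [h, map_zero] at huv; exact zero_ne_one huv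
  have huinv : Valued.v u⁻¹ = 1 := by rw [map_inv₀, huv, inv_one]
  let uinv : 𝒪[K] := ⟨u⁻¹, (Valuation.mem_integer_iff _ _).2 huinv.le⟩
  have huinvK : ((uinv : 𝒪[K]) : K) = u⁻¹ := rfl
  have huinv' : IsLocalRing.residue 𝒪[K] uinv ≠ 0 := hres0 uinv huinv
  have hAv : Valued.v (A : K) = 1 := by
    have h := hN₁
    rw [hA, map_mul, map_pow] at h
    exact (mul_eq_right₀ (pow_ne_zero _ hvϖ0)).1 h
  have hCv : Valued.v (C : K) = 1 := by
    have h := hN₂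
    rw [← Valuation.map_neg, neg_sub, hC, map_mul, map_pow] at h
    exact (mul_eq_right₀ (pow_ne_zero _ hvϖ0)).1 h
  have hA' := hres0 A hAv
  have hC' := hres0 C hCv
  have hq2 : 2 ≤ Fintype.card 𝓀[K] := Fintype.one_lt_card
  -- the spectrum `S = (α∕u, 1, γ∕u)` and its depths
  obtain ⟨hS0, hS2, hS02⟩ := v_spectrum_div_sub (α := α) (γ := γ) hvσ hu
  have hS0' : Valued.v ((![α / u, 1, γ / u] : Fin 3 → K) 0 - 1) = Valued.v ϖ ^ N₁ := hS0.trans hN₁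
  have hS2' : Valued.v ((![α / u, 1, γ / u] : Fin 3 → K) 2 - 1) = Valued.v ϖ ^ N₂ := hS2.trans hN₂
  have hS02' : Valued.v ((![α / u, 1, γ / u] : Fin 3 → K) 0 - (![α / u, 1, γ / u] : Fin 3 → K) 2) = Valued.v ϖ ^ N := hS02.trans hN
  have hS1 : (![α / u, 1, γ / u] : Fin 3 → K) 1 = 1 := rfl
  have hsw : ∀ a b' : Fin 3, Valued.v ((![α / u, 1, γ / u] : Fin 3 → K) a - (![α / u, 1, γ / u] : Fin 3 → K) b') =
      Valued.v ((![α / u, 1, γ / u] : Fin 3 → K) b' - (![α / u, 1, γ / u] : Fin 3 → K) a) := fun a b' => Valuation.map_sub_swap _ _ _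
  have hS10 : Valued.v ((![α / u, 1, γ / u] : Fin 3 → K) 1 - (![α / u, 1, γ / u] : Fin 3 → K) 0) = Valued.v ϖ ^ N₁ := by rw [hsw, hS1]; exact hS0'
  have hS12 : Valued.v ((![α / u, 1, γ / u] : Fin 3 → K) 1 - (![α / u, 1, γ / u] : Fin 3 → K) 2) = Valued.v ϖ ^ N₂ := by rw [hsw, hS1]; exact hS2'
  -- `N₁ ≥ 2`, `N₁` and `N₂` odd
  have hN₁2 : 2 ≤ N₁ := by
    have h : Valued.v (α - u) ≤ Valued.v ϖ ^ 2 := by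
      have e : α - u = (α - 1) - (u - 1) := by ring
      rw [e]; exact (Valuation.map_sub _ _ _).trans (max_le hα2 hu2)
    rw [hN₁] at h
    exact (v_pow_le_iff hϖ).1 h
  have hN₂2 : 2 ≤ N₂ := by
    have h : Valued.v (u - γ) ≤ Valued.v ϖ ^ 2 := by
      have e : u - γ = (u - 1) - (γ - 1) := by ring
      rw [e]; exact (Valuation.map_sub _ _ _).trans (max_le hu2 hγ2)
    rw [hN₂] at h
    exact (v_pow_le_iff hϖ).1 h
  have hoddN₁ : Odd N₁ :=
    odd_of_norm_one_of_v_sub_one hvσ hσϖ hϖ hres h2 (div_mul_map_div_eq_one hα hu) (by omega) hS0'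
  have hoddN₂ : Odd N₂ := by
    refine odd_of_norm_one_of_v_sub_one hvσ hσϖ hϖ hres h2 (div_mul_map_div_eq_one hγ hu) (by omega) ?_
    exact hS2'
  -- the sign character of the head
  have hq1 : 1 ≤ Fintype.card 𝓀[K] := by omega
  rcases lt_trichotomy N₁ N₂ with hlt | heq | hgt
  · -- N₁ < N₂
    -- CONFIGURATION B (`N₁ < N₂`, `α` isolated)
    have hNN₁ : N = N₁ := by
      have h : Valued.v (α - γ) = Valued.v ϖ ^ N₁ := by
        have e : α - γ = (α - u) + (u - γ) := by ring
        rw [e, Valuation.map_add_eq_of_lt_left]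
        · exact hN₁
        · rw [hN₁, hN₂]; exact (v_pow_lt_iff hϖ).2 hlt
      rw [hN] at h
      exact eq_of_v_pow_eq hϖ h
    obtain ⟨s', hs'def⟩ : ∃ s', N₂ = N₁ + 2 * s' := ⟨m - N₁, by omega⟩
    have hs' : 1 ≤ s' := by omega
    obtain ⟨mA, hmA⟩ : ∃ mA, N₁ = 2 * mA + 3 := ⟨n - 1, by omega⟩
    have hd3 : 3 ≤ N₁ := by omega
    have hmN : m = N₁ + s' := by omega
    have hnk : n = mA + 1 := by omega
    -- τ and e′ as elements of 𝒪
    let τ : 𝒪[K] := A * uinv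
    have hτ : ((τ : 𝒪[K]) : K) = (ϖ ^ N₁)⁻¹ * ((![α / u, 1, γ / u] : Fin 3 → K) 0 - (![α / u, 1, γ / u] : Fin 3 → K) 1) := by
      show ((A * uinv : 𝒪[K]) : K) = (ϖ ^ N₁)⁻¹ * (α / u - 1)
      push_cast
      rw [huinvK, div_sub_one hu0, hA]
      field_simp
    have hτv : Valued.v ((τ : 𝒪[K]) : K) = 1 := by
      show Valued.v ((A * uinv : 𝒪[K]) : K) = 1
      push_cast; rw [map_mul, hAv, huinvK, huinv, one_mul]
    let e' : 𝒪[K] := C * uinv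
    have he' : ((e' : 𝒪[K]) : K) = (ϖ ^ (N₁ + 2 * s'))⁻¹ * ((![α / u, 1, γ / u] : Fin 3 → K) 2 - (![α / u, 1, γ / u] : Fin 3 → K) 1) := by
      show ((C * uinv : 𝒪[K]) : K) = (ϖ ^ (N₁ + 2 * s'))⁻¹ * (γ / u - 1)
      push_cast
      rw [huinvK, div_sub_one hu0, hC, ← hs'def]
      field_simp
    have he'v : Valued.v ((e' : 𝒪[K]) : K) = 1 := by
      show Valued.v ((C * uinv : 𝒪[K]) : K) = 1
      push_cast; rw [map_mul, hCv, huinvK, huinv, one_mul]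
    have hsgv : Valued.v ((-1 : K) ^ (s' + 1)) ≤ 1 := by rw [map_pow, Valuation.map_neg, map_one, one_pow]
    let sg : 𝒪[K] := ⟨(-1) ^ (s' + 1), (Valuation.mem_integer_iff _ _).2 hsgv⟩
    have hsg : ((sg : 𝒪[K]) : K) = (-1) ^ (s' + 1) := rfl
    have hsgO : sg = (-1) ^ (s' + 1) := Subtype.ext (by push_cast; rfl)
    have hsgres : IsLocalRing.residue 𝒪[K] sg = (-1) ^ (s' + 1) := by rw [hsgO, map_pow, map_neg, map_one]
    -- eigen data of the configuration
    have hN2le : Valued.v ϖ ^ N₂ ≤ Valued.v ϖ ^ N₁ := (v_pow_le_iff hϖ).2 hlt.le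
    have hN2le' : Valued.v ϖ ^ N₂ ≤ Valued.v ϖ ^ (N₁ + 2) := (v_pow_le_iff hϖ).2 (by omega)
    have he : ∀ i, Valued.v ((![α / u, 1, γ / u] : Fin 3 → K) i - 1) ≤ Valued.v ϖ ^ N₁ := by
      intro i; fin_cases i
      · exact le_of_eq hS0'
      · show Valued.v ((![α / u, 1, γ / u] : Fin 3 → K) 1 - 1) ≤ _
        rw [hS1, sub_self, map_zero]; exact zero_le
      · show Valued.v ((![α / u, 1, γ / u] : Fin 3 → K) 2 - 1) ≤ _
        rw [hS2']; exact hN2le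
    have hiso : ∀ j', j' ≠ (0 : Fin 3) → Valued.v ((![α / u, 1, γ / u] : Fin 3 → K) 0 - (![α / u, 1, γ / u] : Fin 3 → K) j') = Valued.v ϖ ^ N₁ := by
      intro j' hj'; fin_cases j'
      · exact absurd rfl hj'
      · show Valued.v ((![α / u, 1, γ / u] : Fin 3 → K) 0 - (![α / u, 1, γ / u] : Fin 3 → K) 1) = _
        rw [hsw, hS10]
      · show Valued.v ((![α / u, 1, γ / u] : Fin 3 → K) 0 - (![α / u, 1, γ / u] : Fin 3 → K) 2) = _
        rw [hS02', hNN₁]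
    have hclose : ∀ j' k', j' ≠ (0 : Fin 3) → k' ≠ (0 : Fin 3) →
        Valued.v ((![α / u, 1, γ / u] : Fin 3 → K) j' - (![α / u, 1, γ / u] : Fin 3 → K) k') ≤ Valued.v ϖ ^ (N₁ + 2) := by
      intro j' k' hj' hk'
      fin_cases j' <;> fin_cases k'
      all_goals first | exact absurd rfl hj' | exact absurd rfl hk' | skip
      · show Valued.v ((![α / u, 1, γ / u] : Fin 3 → K) 1 - (![α / u, 1, γ / u] : Fin 3 → K) 1) ≤ _
        rw [sub_self, map_zero]; exact zero_le
      · show Valued.v ((![α / u, 1, γ / u] : Fin 3 → K) 1 - (![α / u, 1, γ / u] : Fin 3 → K) 2) ≤ _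
        rw [hS12]; exact hN2le'
      · show Valued.v ((![α / u, 1, γ / u] : Fin 3 → K) 2 - (![α / u, 1, γ / u] : Fin 3 → K) 1) ≤ _
        rw [hsw, hS12]; exact hN2le'
      · show Valued.v ((![α / u, 1, γ / u] : Fin 3 → K) 2 - (![α / u, 1, γ / u] : Fin 3 → K) 2) ≤ _
        rw [sub_self, map_zero]; exact zero_le
    have hgap : ∀ j' k', j' ≠ (0 : Fin 3) → k' ≠ (0 : Fin 3) → j' ≠ k' →
        Valued.v ((![α / u, 1, γ / u] : Fin 3 → K) j' - (![α / u, 1, γ / u] : Fin 3 → K) k') = Valued.v ϖ ^ (N₁ + 2 * s') := by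
      intro j' k' hj' hk' hjk
      fin_cases j' <;> fin_cases k'
      all_goals first | exact absurd rfl hj' | exact absurd rfl hk' | exact absurd rfl hjk | skip
      · show Valued.v ((![α / u, 1, γ / u] : Fin 3 → K) 1 - (![α / u, 1, γ / u] : Fin 3 → K) 2) = _
        rw [hS12, hs'def]
      · show Valued.v ((![α / u, 1, γ / u] : Fin 3 → K) 2 - (![α / u, 1, γ / u] : Fin 3 → K) 1) = _
        rw [hsw, hS12, hs'def]
    have hreg : ∀ i j', i ≠ j' → (![α / u, 1, γ / u] : Fin 3 → K) i ≠ (![α / u, 1, γ / u] : Fin 3 → K) j' := by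
      intro i j' hij h
      have h0 : Valued.v ((![α / u, 1, γ / u] : Fin 3 → K) i - (![α / u, 1, γ / u] : Fin 3 → K) j') = 0 := by rw [h, sub_self, map_zero]
      fin_cases i <;> fin_cases j'
      all_goals first | exact absurd rfl hij | skip
      · change Valued.v ((![α / u, 1, γ / u] : Fin 3 → K) 0 - (![α / u, 1, γ / u] : Fin 3 → K) 1) = 0 at h0
        rw [hsw, hS10] at h0; exact pow_ne_zero _ hvϖ0 h0
      · change Valued.v ((![α / u, 1, γ / u] : Fin 3 → K) 0 - (![α / u, 1, γ / u] : Fin 3 → K) 2) = 0 at h0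
        rw [hS02'] at h0; exact pow_ne_zero _ hvϖ0 h0
      · change Valued.v ((![α / u, 1, γ / u] : Fin 3 → K) 1 - (![α / u, 1, γ / u] : Fin 3 → K) 0) = 0 at h0
        rw [hS10] at h0; exact pow_ne_zero _ hvϖ0 h0
      · change Valued.v ((![α / u, 1, γ / u] : Fin 3 → K) 1 - (![α / u, 1, γ / u] : Fin 3 → K) 2) = 0 at h0
        rw [hS12] at h0; exact pow_ne_zero _ hvϖ0 h0
      · change Valued.v ((![α / u, 1, γ / u] : Fin 3 → K) 2 - (![α / u, 1, γ / u] : Fin 3 → K) 0) = 0 at h0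
        rw [hsw, hS02'] at h0; exact pow_ne_zero _ hvϖ0 h0
      · change Valued.v ((![α / u, 1, γ / u] : Fin 3 → K) 2 - (![α / u, 1, γ / u] : Fin 3 → K) 1) = 0 at h0
        rw [hsw, hS12] at h0; exact pow_ne_zero _ hvϖ0 h0
    -- the per-literal closed forms
    have hlit := fun b : Fin 2 × Fin 2 =>
      literal_count_isoceles (ϖ := ϖ) hσ hvσ hϖ hσϖ hres h2 hnorm u₀ u₁ u₂ ε c₀ hu₀ hu₁ hu₂ hεv hc₀ hσu₀ hσu₁ hσu₂ hσε _hσc₀ hε α u γ hα hu hγ hα2 hu2 hγ2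
        T hT N₁ N₂ N m n hN₁ hN₂ hN hm hn h1n A C hA hC hIso hHyp hBare 0 1 2 (by decide) (by decide) (by decide) hd3 mA hmA s' hs'
        he hiso hclose hreg hgap τ e' sg hτ hτv he' he'v hsg b j
    -- the three sign characters
    set Hχ : ℤ := quadraticChar 𝓀[K] (-(IsLocalRing.residue 𝒪[K] u₁ * IsLocalRing.residue 𝒪[K] u₂)) with hHχ
    set Bχ : ℤ := quadraticChar 𝓀[K] (IsLocalRing.residue 𝒪[K] (sg * τ * e') * (IsLocalRing.residue 𝒪[K] u₀ * IsLocalRing.residue 𝒪[K] u₂)) with hBχ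
    set Λχ : ℤ := quadraticChar 𝓀[K] (-(IsLocalRing.residue 𝒪[K] τ * IsLocalRing.residue 𝒪[K] u₀ * (IsLocalRing.residue 𝒪[K] c₀)⁻¹)) with hΛχ
    have hτ' := hres0 τ hτv
    have he'' := hres0 e' he'v
    have hsg' : IsLocalRing.residue 𝒪[K] sg ≠ 0 := by rw [hsgres]; exact pow_ne_zero _ (neg_ne_zero.2 one_ne_zero)
    have hH : Hχ = 1 ∨ Hχ = -1 := quadraticChar_dichotomy (neg_ne_zero.2 (mul_ne_zero hu₁' hu₂'))
    have hB : Bχ = 1 ∨ Bχ = -1 := quadraticChar_dichotomy (mul_ne_zero (by rw [map_mul, map_mul]; exact mul_ne_zero (mul_ne_zero hsg' hτ') he'') (mul_ne_zero hu₀' hu₂'))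
    have hΛ : Λχ = 1 ∨ Λχ = -1 := quadraticChar_dichotomy (neg_ne_zero.2 (mul_ne_zero (mul_ne_zero hτ' hu₀') (inv_ne_zero hc₀')))
    -- the literals' raw tokens as sign patterns
    have hD0 : ∀ b : Fin 2 × Fin 2, (![ε ^ (b.1 : ℕ) * u₀, ε ^ (b.2 : ℕ) * u₁, ε ^ ((b.1 : ℕ) + (b.2 : ℕ)) * u₂] : Fin 3 → 𝒪[K]) 0 = ε ^ (b.1 : ℕ) * u₀ := fun b => rfl
    have hD1 : ∀ b : Fin 2 × Fin 2, (![ε ^ (b.1 : ℕ) * u₀, ε ^ (b.2 : ℕ) * u₁, ε ^ ((b.1 : ℕ) + (b.2 : ℕ)) * u₂] : Fin 3 → 𝒪[K]) 1 = ε ^ (b.2 : ℕ) * u₁ := fun b => rfl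
    have hD2 : ∀ b : Fin 2 × Fin 2, (![ε ^ (b.1 : ℕ) * u₀, ε ^ (b.2 : ℕ) * u₁, ε ^ ((b.1 : ℕ) + (b.2 : ℕ)) * u₂] : Fin 3 → 𝒪[K]) 2 = ε ^ ((b.1 : ℕ) + (b.2 : ℕ)) * u₂ := fun b => rfl
    have hhyp : ∀ b : Fin 2 × Fin 2, (quadraticChar 𝓀[K] (-(IsLocalRing.residue 𝒪[K] ((![ε ^ (b.1 : ℕ) * u₀, ε ^ (b.2 : ℕ) * u₁, ε ^ ((b.1 : ℕ) + (b.2 : ℕ)) * u₂] : Fin 3 → 𝒪[K]) 1) * IsLocalRing.residue 𝒪[K] ((![ε ^ (b.1 : ℕ) * u₀, ε ^ (b.2 : ℕ) * u₁, ε ^ ((b.1 : ℕ) + (b.2 : ℕ)) * u₂] : Fin 3 → 𝒪[K]) 2))) = 1) ↔ (-1 : ℤ) ^ (b.1 : ℕ) * Hχ = 1 := by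
      intro b
      rw [hD1 b, hD2 b, hHχ]
      rw [show -(IsLocalRing.residue 𝒪[K] (ε ^ (b.2 : ℕ) * u₁) * IsLocalRing.residue 𝒪[K] (ε ^ ((b.1 : ℕ) + (b.2 : ℕ)) * u₂)) =
        IsLocalRing.residue 𝒪[K] (ε ^ ((b.2 : ℕ) + ((b.1 : ℕ) + (b.2 : ℕ)))) * (-(IsLocalRing.residue 𝒪[K] u₁ * IsLocalRing.residue 𝒪[K] u₂)) by
          simp only [map_mul, map_pow, pow_add]; ring,
        quadraticChar_residue_pow_mul ε hεχ]
      rw [show (-1 : ℤ) ^ ((b.2 : ℕ) + ((b.1 : ℕ) + (b.2 : ℕ))) = (-1) ^ (b.1 : ℕ) from by rw [show (b.2 : ℕ) + ((b.1 : ℕ) + (b.2 : ℕ)) = 2 * (b.2 : ℕ) + (b.1 : ℕ) by ring, pow_add, pow_mul, neg_one_sq, one_pow, one_mul]]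
    have hbig : ∀ b : Fin 2 × Fin 2, (quadraticChar 𝓀[K] (IsLocalRing.residue 𝒪[K] (sg * τ * e' * (![ε ^ (b.1 : ℕ) * u₀, ε ^ (b.2 : ℕ) * u₁, ε ^ ((b.1 : ℕ) + (b.2 : ℕ)) * u₂] : Fin 3 → 𝒪[K]) 0 * (![ε ^ (b.1 : ℕ) * u₀, ε ^ (b.2 : ℕ) * u₁, ε ^ ((b.1 : ℕ) + (b.2 : ℕ)) * u₂] : Fin 3 → 𝒪[K]) 2)) = 1) ↔ (-1 : ℤ) ^ (b.2 : ℕ) * Bχ = 1 := by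
      intro b
      rw [hD0 b, hD2 b, hBχ]
      rw [show IsLocalRing.residue 𝒪[K] (sg * τ * e' * (ε ^ (b.1 : ℕ) * u₀) * (ε ^ ((b.1 : ℕ) + (b.2 : ℕ)) * u₂)) =
        IsLocalRing.residue 𝒪[K] (ε ^ ((b.1 : ℕ) + ((b.1 : ℕ) + (b.2 : ℕ)))) * (IsLocalRing.residue 𝒪[K] (sg * τ * e') * (IsLocalRing.residue 𝒪[K] u₀ * IsLocalRing.residue 𝒪[K] u₂)) by
          rw [pow_add]; simp only [map_mul, map_pow]; ring,
        quadraticChar_residue_pow_mul ε hεχ]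
      rw [show (-1 : ℤ) ^ ((b.1 : ℕ) + ((b.1 : ℕ) + (b.2 : ℕ))) = (-1) ^ (b.2 : ℕ) from by rw [show (b.1 : ℕ) + ((b.1 : ℕ) + (b.2 : ℕ)) = 2 * (b.1 : ℕ) + (b.2 : ℕ) by ring, pow_add, pow_mul, neg_one_sq, one_pow, one_mul]]
    have hlock : ∀ b : Fin 2 × Fin 2, (quadraticChar 𝓀[K] (-(IsLocalRing.residue 𝒪[K] (τ * (![ε ^ (b.1 : ℕ) * u₀, ε ^ (b.2 : ℕ) * u₁, ε ^ ((b.1 : ℕ) + (b.2 : ℕ)) * u₂] : Fin 3 → 𝒪[K]) 0) * (IsLocalRing.residue 𝒪[K] c₀)⁻¹)) = 1) ↔ (-1 : ℤ) ^ (b.1 : ℕ) * Λχ = 1 := by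
      intro b
      rw [hD0 b, hΛχ]
      rw [show -(IsLocalRing.residue 𝒪[K] (τ * (ε ^ (b.1 : ℕ) * u₀)) * (IsLocalRing.residue 𝒪[K] c₀)⁻¹) =
        IsLocalRing.residue 𝒪[K] (ε ^ (b.1 : ℕ)) * (-(IsLocalRing.residue 𝒪[K] τ * IsLocalRing.residue 𝒪[K] u₀ * (IsLocalRing.residue 𝒪[K] c₀)⁻¹)) by
          simp only [map_mul, map_pow]; ring,
        quadraticChar_residue_pow_mul ε hεχ]
    -- the sign of the head
    have hsign : (quadraticChar 𝓀[K] (IsLocalRing.residue 𝒪[K] ((-1) ^ m * (u₀ * u₂ * A * C))) : ℤ) = Bχ := by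
      have hodm : (-1 : 𝓀[K]) ^ m = (-1) ^ (s' + 1) := by
        rw [hmN]
        obtain ⟨a, ha⟩ := hoddN₁
        rw [ha, show 2 * a + 1 + s' = (s' + 1) + 2 * a by ring, pow_add, pow_mul, neg_one_sq, one_pow, mul_one]
      have e : IsLocalRing.residue 𝒪[K] (sg * τ * e') * (IsLocalRing.residue 𝒪[K] u₀ * IsLocalRing.residue 𝒪[K] u₂) =
          IsLocalRing.residue 𝒪[K] ((-1) ^ m * (u₀ * u₂ * A * C)) * (IsLocalRing.residue 𝒪[K] uinv) ^ 2 := by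
        rw [show τ = A * uinv from rfl, show e' = C * uinv from rfl, hsgO]
        simp only [map_mul, map_pow, map_neg, map_one, hodm]
        ring
      rw [hBχ, e, map_mul (quadraticChar 𝓀[K]), quadraticChar_sq_one' huinv', mul_one]

    -- rewrite the goal through the closed forms and the pooled sums
    have hf0 : (∑ b : Fin 2 × Fin 2, (-1 : ℚ) ^ (b.2 : ℕ) * ((({M : Submodule (Valued.integer K) (Fin 3 → K) |
              IsSelfDualLattice σ ϖ (Matrix.diagonal ![((ε : K)) ^ (b.1 : ℕ) * (u₀ : K), (ε : K) ^ (b.2 : ℕ) * (u₁ : K), (ε : K) ^ ((b.1 : ℕ) + (b.2 : ℕ)) * (u₂ : K)]) M ∧ mapGL T M = M ∧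
                (![-- bd : `¬ (T − 1)M ⊆ ϖM`
                    ¬ M.map ((Matrix.toLin' ((T : Matrix (Fin 3) (Fin 3) K) - 1)).restrictScalars (Valued.integer K)) ≤ scaleLattice ϖ M,
                  -- reg : depth 1, rank 2
                    M.map ((Matrix.toLin' ((T : Matrix (Fin 3) (Fin 3) K) - 1)).restrictScalars (Valued.integer K)) ≤ scaleLattice ϖ M ∧
                      ¬ M.map ((Matrix.toLin' ((T : Matrix (Fin 3) (Fin 3) K) - 1)).restrictScalars (Valued.integer K)) ≤ scaleLattice (ϖ ^ 2) M ∧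
                      ¬ M.map ((Matrix.toLin' (((T : Matrix (Fin 3) (Fin 3) K) - 1) ^ 2)).restrictScalars (Valued.integer K)) ≤ scaleLattice (ϖ ^ 3) M,
                  -- 1s : depth 1, rank 1, class `c₀`
                    M.map ((Matrix.toLin' ((T : Matrix (Fin 3) (Fin 3) K) - 1)).restrictScalars (Valued.integer K)) ≤ scaleLattice ϖ M ∧
                      ¬ M.map ((Matrix.toLin' ((T : Matrix (Fin 3) (Fin 3) K) - 1)).restrictScalars (Valued.integer K)) ≤ scaleLattice (ϖ ^ 2) M ∧
                      M.map ((Matrix.toLin' (((T : Matrix (Fin 3) (Fin 3) K) - 1) ^ 2)).restrictScalars (Valued.integer K)) ≤ scaleLattice (ϖ ^ 3) M ∧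
                      ∃ y ∈ M, ∃ a : K, Valued.v a = 1 ∧
                        Valued.v (ϖ⁻¹ * pairing σ (Matrix.diagonal ![((ε : K)) ^ (b.1 : ℕ) * (u₀ : K), (ε : K) ^ (b.2 : ℕ) * (u₁ : K), (ε : K) ^ ((b.1 : ℕ) + (b.2 : ℕ)) * (u₂ : K)]) y
                          (((T : Matrix (Fin 3) (Fin 3) K) - 1) *ᵥ y) - (c₀ : K) * a ^ 2) < 1,
                  -- 1n : depth 1, rank 1, class `c₀·ε`
                    M.map ((Matrix.toLin' ((T : Matrix (Fin 3) (Fin 3) K) - 1)).restrictScalars (Valued.integer K)) ≤ scaleLattice ϖ M ∧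
                      ¬ M.map ((Matrix.toLin' ((T : Matrix (Fin 3) (Fin 3) K) - 1)).restrictScalars (Valued.integer K)) ≤ scaleLattice (ϖ ^ 2) M ∧
                      M.map ((Matrix.toLin' (((T : Matrix (Fin 3) (Fin 3) K) - 1) ^ 2)).restrictScalars (Valued.integer K)) ≤ scaleLattice (ϖ ^ 3) M ∧
                      ∃ y ∈ M, ∃ a : K, Valued.v a = 1 ∧
                        Valued.v (ϖ⁻¹ * pairing σ (Matrix.diagonal ![((ε : K)) ^ (b.1 : ℕ) * (u₀ : K), (ε : K) ^ (b.2 : ℕ) * (u₁ : K), (ε : K) ^ ((b.1 : ℕ) + (b.2 : ℕ)) * (u₂ : K)]) y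
                          (((T : Matrix (Fin 3) (Fin 3) K) - 1) *ᵥ y) - (c₀ : K) * (ε : K) * a ^ 2) < 1,
                  -- 0 : depth ≥ 2
                    M.map ((Matrix.toLin' ((T : Matrix (Fin 3) (Fin 3) K) - 1)).restrictScalars (Valued.integer K)) ≤ scaleLattice (ϖ ^ 2) M] : Fin 5 → Prop) j}).ncard : ℕ) : ℚ)) =
        ∑ b : Fin 2 × Fin 2, (-1 : ℚ) ^ (b.2 : ℕ) * (fun b : Fin 2 × Fin 2 => ((({M : Submodule (Valued.integer K) (Fin 3 → K) |
              IsSelfDualLattice σ ϖ (Matrix.diagonal ![((ε : K)) ^ (b.1 : ℕ) * (u₀ : K), (ε : K) ^ (b.2 : ℕ) * (u₁ : K), (ε : K) ^ ((b.1 : ℕ) + (b.2 : ℕ)) * (u₂ : K)]) M ∧ mapGL T M = M ∧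
                (![-- bd : `¬ (T − 1)M ⊆ ϖM`
                    ¬ M.map ((Matrix.toLin' ((T : Matrix (Fin 3) (Fin 3) K) - 1)).restrictScalars (Valued.integer K)) ≤ scaleLattice ϖ M,
                  -- reg : depth 1, rank 2
                    M.map ((Matrix.toLin' ((T : Matrix (Fin 3) (Fin 3) K) - 1)).restrictScalars (Valued.integer K)) ≤ scaleLattice ϖ M ∧
                      ¬ M.map ((Matrix.toLin' ((T : Matrix (Fin 3) (Fin 3) K) - 1)).restrictScalars (Valued.integer K)) ≤ scaleLattice (ϖ ^ 2) M ∧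
                      ¬ M.map ((Matrix.toLin' (((T : Matrix (Fin 3) (Fin 3) K) - 1) ^ 2)).restrictScalars (Valued.integer K)) ≤ scaleLattice (ϖ ^ 3) M,
                  -- 1s : depth 1, rank 1, class `c₀`
                    M.map ((Matrix.toLin' ((T : Matrix (Fin 3) (Fin 3) K) - 1)).restrictScalars (Valued.integer K)) ≤ scaleLattice ϖ M ∧
                      ¬ M.map ((Matrix.toLin' ((T : Matrix (Fin 3) (Fin 3) K) - 1)).restrictScalars (Valued.integer K)) ≤ scaleLattice (ϖ ^ 2) M ∧
                      M.map ((Matrix.toLin' (((T : Matrix (Fin 3) (Fin 3) K) - 1) ^ 2)).restrictScalars (Valued.integer K)) ≤ scaleLattice (ϖ ^ 3) M ∧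
                      ∃ y ∈ M, ∃ a : K, Valued.v a = 1 ∧
                        Valued.v (ϖ⁻¹ * pairing σ (Matrix.diagonal ![((ε : K)) ^ (b.1 : ℕ) * (u₀ : K), (ε : K) ^ (b.2 : ℕ) * (u₁ : K), (ε : K) ^ ((b.1 : ℕ) + (b.2 : ℕ)) * (u₂ : K)]) y
                          (((T : Matrix (Fin 3) (Fin 3) K) - 1) *ᵥ y) - (c₀ : K) * a ^ 2) < 1,
                  -- 1n : depth 1, rank 1, class `c₀·ε`
                    M.map ((Matrix.toLin' ((T : Matrix (Fin 3) (Fin 3) K) - 1)).restrictScalars (Valued.integer K)) ≤ scaleLattice ϖ M ∧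
                      ¬ M.map ((Matrix.toLin' ((T : Matrix (Fin 3) (Fin 3) K) - 1)).restrictScalars (Valued.integer K)) ≤ scaleLattice (ϖ ^ 2) M ∧
                      M.map ((Matrix.toLin' (((T : Matrix (Fin 3) (Fin 3) K) - 1) ^ 2)).restrictScalars (Valued.integer K)) ≤ scaleLattice (ϖ ^ 3) M ∧
                      ∃ y ∈ M, ∃ a : K, Valued.v a = 1 ∧
                        Valued.v (ϖ⁻¹ * pairing σ (Matrix.diagonal ![((ε : K)) ^ (b.1 : ℕ) * (u₀ : K), (ε : K) ^ (b.2 : ℕ) * (u₁ : K), (ε : K) ^ ((b.1 : ℕ) + (b.2 : ℕ)) * (u₂ : K)]) y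
                          (((T : Matrix (Fin 3) (Fin 3) K) - 1) *ᵥ y) - (c₀ : K) * (ε : K) * a ^ 2) < 1,
                  -- 0 : depth ≥ 2
                    M.map ((Matrix.toLin' ((T : Matrix (Fin 3) (Fin 3) K) - 1)).restrictScalars (Valued.integer K)) ≤ scaleLattice (ϖ ^ 2) M] : Fin 5 → Prop) j}).ncard : ℕ) : ℚ)) b := rfl
    rw [hf0]
    by_cases hsq : IsSquare (-1 : 𝓀[K])
    · simp only [if_pos hsq] at hlit
      have hS := signedSum_isoTokens_opposite (Fintype.card 𝓀[K]) s' Hχ Bχ Λχ hH hB hΛ (((![0, 0, 0, 0, 1] : Fin 5 → ℕ) j : ℕ) : ℚ) (((![(Fintype.card 𝓀[K]) ^ (3 * mA + 3), (Fintype.card 𝓀[K]) ^ (3 * mA + 2), (Fintype.card 𝓀[K]).choose 2 * (Fintype.card 𝓀[K]) ^ (2 * mA) * ∑ i ∈ Finset.range mA, (Fintype.card 𝓀[K]) ^ i, (Fintype.card 𝓀[K]).choose 2 * (Fintype.card 𝓀[K]) ^ (2 * mA) * ∑ i ∈ Finset.range mA, (Fintype.card 𝓀[K]) ^ i,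
          ∑ i ∈ Finset.range (mA + 1), (Fintype.card 𝓀[K]) ^ (2 * i) + ∑ i ∈ Finset.range mA, (Fintype.card 𝓀[K]) ^ (2 * mA + 1 + i)] : Fin 5 → ℕ) j : ℕ) : ℚ) (((![0, 0, (Fintype.card 𝓀[K]) ^ (2 * mA), 0, ∑ i ∈ Finset.range mA, (Fintype.card 𝓀[K]) ^ (2 * i)] : Fin 5 → ℕ) j : ℕ) : ℚ) (((![0, 0, 0, (Fintype.card 𝓀[K]) ^ (2 * mA), ∑ i ∈ Finset.range mA, (Fintype.card 𝓀[K]) ^ (2 * i)] : Fin 5 → ℕ) j : ℕ) : ℚ)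
        _ _ _ hhyp hbig hlock _ hlit
      have hPM : (((![0, 0, (Fintype.card 𝓀[K]) ^ (2 * mA), 0, ∑ i ∈ Finset.range mA, (Fintype.card 𝓀[K]) ^ (2 * i)] : Fin 5 → ℕ) j : ℕ) : ℚ) + (((![0, 0, 0, (Fintype.card 𝓀[K]) ^ (2 * mA), ∑ i ∈ Finset.range mA, (Fintype.card 𝓀[K]) ^ (2 * i)] : Fin 5 → ℕ) j : ℕ) : ℚ) = (((![0, 0, (Fintype.card 𝓀[K]) ^ (2 * mA), (Fintype.card 𝓀[K]) ^ (2 * mA), 2 * ∑ i ∈ Finset.range mA, (Fintype.card 𝓀[K]) ^ (2 * i)] : Fin 5 → ℕ) j : ℕ) : ℚ) := by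
        have h := congrFun (shellSum_P_pos_add_neg_keep (Fintype.card 𝓀[K]) mA) j
        rw [Pi.add_apply] at h
        exact_mod_cast h
      have hX := kappaSum_isoceles_opposite_eq (Fintype.card 𝓀[K]) mA s' hq2 j
      rw [hsign, hmN, hmA, hnk, show 2 * mA + 3 + s' = 2 * mA + 3 + s' from rfl]
      linear_combination hS + (Bχ : ℚ) * hX - ((Bχ : ℚ) * (2 * (Fintype.card 𝓀[K] : ℚ) ^ (s' + 1))) * hPM
    · simp only [if_neg hsq] at hlit
      have hS := signedSum_isoTokens_opposite (Fintype.card 𝓀[K]) s' Hχ Bχ Λχ hH hB hΛ (((![0, 0, 0, 0, 1] : Fin 5 → ℕ) j : ℕ) : ℚ) (((![(Fintype.card 𝓀[K]) ^ (3 * mA + 3), (Fintype.card 𝓀[K]) ^ (3 * mA + 2), (Fintype.card 𝓀[K]).choose 2 * (Fintype.card 𝓀[K]) ^ (2 * mA) * ∑ i ∈ Finset.range mA, (Fintype.card 𝓀[K]) ^ i, (Fintype.card 𝓀[K]).choose 2 * (Fintype.card 𝓀[K]) ^ (2 * mA) * ∑ i ∈ Finset.range mA, (Fintype.card 𝓀[K])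 ^ i,
          ∑ i ∈ Finset.range (mA + 1), (Fintype.card 𝓀[K]) ^ (2 * i) + ∑ i ∈ Finset.range mA, (Fintype.card 𝓀[K]) ^ (2 * mA + 1 + i)] : Fin 5 → ℕ) j : ℕ) : ℚ) (((![0, 0, if Even mA then (Fintype.card 𝓀[K]) ^ (2 * mA) else 0, if Even mA then 0 else (Fintype.card 𝓀[K]) ^ (2 * mA), ∑ i ∈ Finset.range mA, (Fintype.card 𝓀[K]) ^ (2 * i)] : Fin 5 → ℕ) j : ℕ) : ℚ) (((![0, 0, if Even mA then 0 else (Fintype.card 𝓀[K]) ^ (2 * mA), if Even mA then (Fintype.card 𝓀[K]) ^ (2 * mA) else 0, ∑ i ∈ Finset.range mA, (Fintype.card 𝓀[K]) ^ (2 * i)] : Fin 5 → ℕ) j : ℕ) : ℚ)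
        _ _ _ hhyp hbig hlock _ hlit
      have hPM : (((![0, 0, if Even mA then (Fintype.card 𝓀[K]) ^ (2 * mA) else 0, if Even mA then 0 else (Fintype.card 𝓀[K]) ^ (2 * mA), ∑ i ∈ Finset.range mA, (Fintype.card 𝓀[K]) ^ (2 * i)] : Fin 5 → ℕ) j : ℕ) : ℚ) + (((![0, 0, if Even mA then 0 else (Fintype.card 𝓀[K]) ^ (2 * mA), if Even mA then (Fintype.card 𝓀[K]) ^ (2 * mA) else 0, ∑ i ∈ Finset.range mA, (Fintype.card 𝓀[K]) ^ (2 * i)] : Fin 5 → ℕ) j : ℕ) : ℚ) = (((![0, 0, (Fintype.card 𝓀[K]) ^ (2 * mA), (Fintype.card 𝓀[K]) ^ (2 * mA), 2 * ∑ i ∈ Finset.range mA, (Fintype.card 𝓀[K]) ^ (2 * i)] : Fin 5 → ℕ) j : ℕ) : ℚ) := by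
        have h := congrFun (shellSum_P_pos_add_neg_flip (Fintype.card 𝓀[K]) mA) j
        rw [Pi.add_apply] at h
        exact_mod_cast h
      have hX := kappaSum_isoceles_opposite_eq (Fintype.card 𝓀[K]) mA s' hq2 j
      rw [hsign, hmN, hmA, hnk, show 2 * mA + 3 + s' = 2 * mA + 3 + s' from rfl]
      linear_combination hS + (Bχ : ℚ) * hX - ((Bχ : ℚ) * (2 * (Fintype.card 𝓀[K] : ℚ) ^ (s' + 1))) * hPM
  · -- N₁ = N₂ (< N)
    -- CONFIGURATION A (`N₁ = N₂ < N`, `u` isolated)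
    have hN₁N : N₁ ≠ N := fun h => hconf ⟨h, heq ▸ h⟩
    have hNge : N₁ ≤ N := by
      have h : Valued.v (α - γ) ≤ Valued.v ϖ ^ N₁ := by
        have e : α - γ = (α - u) + (u - γ) := by ring
        rw [e]; refine (Valuation.map_add _ _ _).trans (max_le (le_of_eq hN₁) ?_)
        rw [hN₂, ← heq]
      rw [hN] at h
      exact (v_pow_le_iff hϖ).1 h
    have hoddN : Odd N := ⟨n, by omega⟩
    obtain ⟨s', hs'def⟩ : ∃ s', N = N₁ + 2 * s' := by
      obtain ⟨a, ha⟩ := hoddN₁; obtain ⟨c, hc⟩ := hoddN; exact ⟨c - a, by omega⟩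
    have hs' : 1 ≤ s' := by omega
    obtain ⟨mA, hmA⟩ : ∃ mA, N₁ = 2 * mA + 3 := by obtain ⟨a, ha⟩ := hoddN₁; exact ⟨a - 1, by omega⟩
    have hd3 : 3 ≤ N₁ := by omega
    have hmN : m = N₁ := by omega
    have hnk : n = mA + 1 + s' := by omega
    -- τ and e′ as elements of 𝒪
    have hτv0 : Valued.v ((ϖ ^ N₁)⁻¹ * ((![α / u, 1, γ / u] : Fin 3 → K) 1 - (![α / u, 1, γ / u] : Fin 3 → K) 0)) = 1 := by
      rw [map_mul, map_inv₀, map_pow, hS10, inv_mul_cancel₀ (pow_ne_zero _ hvϖ0)]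
    let τ : 𝒪[K] := ⟨(ϖ ^ N₁)⁻¹ * ((![α / u, 1, γ / u] : Fin 3 → K) 1 - (![α / u, 1, γ / u] : Fin 3 → K) 0), (Valuation.mem_integer_iff _ _).2 hτv0.le⟩
    have hτ : ((τ : 𝒪[K]) : K) = (ϖ ^ N₁)⁻¹ * ((![α / u, 1, γ / u] : Fin 3 → K) 1 - (![α / u, 1, γ / u] : Fin 3 → K) 0) := rfl
    have hτv : Valued.v ((τ : 𝒪[K]) : K) = 1 := hτv0
    have he'v0 : Valued.v ((ϖ ^ (N₁ + 2 * s'))⁻¹ * ((![α / u, 1, γ / u] : Fin 3 → K) 2 - (![α / u, 1, γ / u] : Fin 3 → K) 0)) = 1 := by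
      rw [map_mul, map_inv₀, map_pow, hsw, hS02', ← hs'def, inv_mul_cancel₀ (pow_ne_zero _ hvϖ0)]
    let e' : 𝒪[K] := ⟨(ϖ ^ (N₁ + 2 * s'))⁻¹ * ((![α / u, 1, γ / u] : Fin 3 → K) 2 - (![α / u, 1, γ / u] : Fin 3 → K) 0), (Valuation.mem_integer_iff _ _).2 he'v0.le⟩
    have he' : ((e' : 𝒪[K]) : K) = (ϖ ^ (N₁ + 2 * s'))⁻¹ * ((![α / u, 1, γ / u] : Fin 3 → K) 2 - (![α / u, 1, γ / u] : Fin 3 → K) 0) := rfl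
    have he'v : Valued.v ((e' : 𝒪[K]) : K) = 1 := he'v0
    have hsgv : Valued.v ((-1 : K) ^ (s' + 1)) ≤ 1 := by rw [map_pow, Valuation.map_neg, map_one, one_pow]
    let sg : 𝒪[K] := ⟨(-1) ^ (s' + 1), (Valuation.mem_integer_iff _ _).2 hsgv⟩
    have hsg : ((sg : 𝒪[K]) : K) = (-1) ^ (s' + 1) := rfl
    have hsgO : sg = (-1) ^ (s' + 1) := Subtype.ext (by push_cast; rfl)
    have hsgres : IsLocalRing.residue 𝒪[K] sg = (-1) ^ (s' + 1) := by rw [hsgO, map_pow, map_neg, map_one]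
    -- eigen data of the configuration
    have he : ∀ i, Valued.v ((![α / u, 1, γ / u] : Fin 3 → K) i - 1) ≤ Valued.v ϖ ^ N₁ := by
      intro i; fin_cases i
      · exact le_of_eq hS0'
      · show Valued.v ((![α / u, 1, γ / u] : Fin 3 → K) 1 - 1) ≤ _
        rw [hS1, sub_self, map_zero]; exact zero_le
      · show Valued.v ((![α / u, 1, γ / u] : Fin 3 → K) 2 - 1) ≤ _
        rw [hS2', heq]
    have hiso : ∀ j', j' ≠ (1 : Fin 3) → Valued.v ((![α / u, 1, γ / u] : Fin 3 → K) 1 - (![α / u, 1, γ / u] : Fin 3 → K) j') = Valued.v ϖ ^ N₁ := by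
      intro j' hj'; fin_cases j'
      · exact hS10
      · exact absurd rfl hj'
      · show Valued.v ((![α / u, 1, γ / u] : Fin 3 → K) 1 - (![α / u, 1, γ / u] : Fin 3 → K) 2) = _
        rw [hS12, heq]
    have hN2le : Valued.v ϖ ^ N ≤ Valued.v ϖ ^ (N₁ + 2) := (v_pow_le_iff hϖ).2 (by omega)
    have hclose : ∀ j' k', j' ≠ (1 : Fin 3) → k' ≠ (1 : Fin 3) →
        Valued.v ((![α / u, 1, γ / u] : Fin 3 → K) j' - (![α / u, 1, γ / u] : Fin 3 → K) k') ≤ Valued.v ϖ ^ (N₁ + 2) := by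
      intro j' k' hj' hk'
      fin_cases j' <;> fin_cases k'
      all_goals first | exact absurd rfl hj' | exact absurd rfl hk' | skip
      · show Valued.v ((![α / u, 1, γ / u] : Fin 3 → K) 0 - (![α / u, 1, γ / u] : Fin 3 → K) 0) ≤ _
        rw [sub_self, map_zero]; exact zero_le
      · show Valued.v ((![α / u, 1, γ / u] : Fin 3 → K) 0 - (![α / u, 1, γ / u] : Fin 3 → K) 2) ≤ _
        rw [hS02']; exact hN2le
      · show Valued.v ((![α / u, 1, γ / u] : Fin 3 → K) 2 - (![α / u, 1, γ / u] : Fin 3 → K) 0) ≤ _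
        rw [hsw, hS02']; exact hN2le
      · show Valued.v ((![α / u, 1, γ / u] : Fin 3 → K) 2 - (![α / u, 1, γ / u] : Fin 3 → K) 2) ≤ _
        rw [sub_self, map_zero]; exact zero_le
    have hgap : ∀ j' k', j' ≠ (1 : Fin 3) → k' ≠ (1 : Fin 3) → j' ≠ k' →
        Valued.v ((![α / u, 1, γ / u] : Fin 3 → K) j' - (![α / u, 1, γ / u] : Fin 3 → K) k') = Valued.v ϖ ^ (N₁ + 2 * s') := by
      intro j' k' hj' hk' hjk
      fin_cases j' <;> fin_cases k'
      all_goals first | exact absurd rfl hj' | exact absurd rfl hk' | exact absurd rfl hjk | skip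
      · show Valued.v ((![α / u, 1, γ / u] : Fin 3 → K) 0 - (![α / u, 1, γ / u] : Fin 3 → K) 2) = _
        rw [hS02', hs'def]
      · show Valued.v ((![α / u, 1, γ / u] : Fin 3 → K) 2 - (![α / u, 1, γ / u] : Fin 3 → K) 0) = _
        rw [hsw, hS02', hs'def]
    have hreg : ∀ i j', i ≠ j' → (![α / u, 1, γ / u] : Fin 3 → K) i ≠ (![α / u, 1, γ / u] : Fin 3 → K) j' := by
      intro i j' hij h
      have h0 : Valued.v ((![α / u, 1, γ / u] : Fin 3 → K) i - (![α / u, 1, γ / u] : Fin 3 → K) j') = 0 := by rw [h, sub_self, map_zero]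
      fin_cases i <;> fin_cases j'
      all_goals first | exact absurd rfl hij | skip
      · change Valued.v ((![α / u, 1, γ / u] : Fin 3 → K) 0 - (![α / u, 1, γ / u] : Fin 3 → K) 1) = 0 at h0
        rw [hsw, hS10] at h0; exact pow_ne_zero _ hvϖ0 h0
      · change Valued.v ((![α / u, 1, γ / u] : Fin 3 → K) 0 - (![α / u, 1, γ / u] : Fin 3 → K) 2) = 0 at h0
        rw [hS02'] at h0; exact pow_ne_zero _ hvϖ0 h0
      · change Valued.v ((![α / u, 1, γ / u] : Fin 3 → K) 1 - (![α / u, 1, γ / u] : Fin 3 → K) 0) = 0 at h0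
        rw [hS10] at h0; exact pow_ne_zero _ hvϖ0 h0
      · change Valued.v ((![α / u, 1, γ / u] : Fin 3 → K) 1 - (![α / u, 1, γ / u] : Fin 3 → K) 2) = 0 at h0
        rw [hS12] at h0; exact pow_ne_zero _ hvϖ0 h0
      · change Valued.v ((![α / u, 1, γ / u] : Fin 3 → K) 2 - (![α / u, 1, γ / u] : Fin 3 → K) 0) = 0 at h0
        rw [hsw, hS02'] at h0; exact pow_ne_zero _ hvϖ0 h0
      · change Valued.v ((![α / u, 1, γ / u] : Fin 3 → K) 2 - (![α / u, 1, γ / u] : Fin 3 → K) 1) = 0 at h0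
        rw [hsw, hS12] at h0; exact pow_ne_zero _ hvϖ0 h0
    -- the per-literal closed forms
    have hlit := fun b : Fin 2 × Fin 2 =>
      literal_count_isoceles (ϖ := ϖ) hσ hvσ hϖ hσϖ hres h2 hnorm u₀ u₁ u₂ ε c₀ hu₀ hu₁ hu₂ hεv hc₀ hσu₀ hσu₁ hσu₂ hσε _hσc₀ hε α u γ hα hu hγ hα2 hu2 hγ2
        T hT N₁ N₂ N m n hN₁ hN₂ hN hm hn h1n A C hA hC hIso hHyp hBare 1 0 2 (by decide) (by decide) (by decide) hd3 mA hmA s' hs'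
        he hiso hclose hreg hgap τ e' sg hτ hτv he' he'v hsg b j
    -- the three sign characters
    set Hχ : ℤ := quadraticChar 𝓀[K] (-(IsLocalRing.residue 𝒪[K] u₀ * IsLocalRing.residue 𝒪[K] u₂)) with hHχ
    set Bχ : ℤ := quadraticChar 𝓀[K] (IsLocalRing.residue 𝒪[K] (sg * τ * e') * (IsLocalRing.residue 𝒪[K] u₁ * IsLocalRing.residue 𝒪[K] u₂)) with hBχ
    set Λχ : ℤ := quadraticChar 𝓀[K] (-(IsLocalRing.residue 𝒪[K] τ * IsLocalRing.residue 𝒪[K] u₁ * (IsLocalRing.residue 𝒪[K] c₀)⁻¹)) with hΛχ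
    have hτ' := hres0 τ hτv
    have he'' := hres0 e' he'v
    have hsg' : IsLocalRing.residue 𝒪[K] sg ≠ 0 := by rw [hsgres]; exact pow_ne_zero _ (neg_ne_zero.2 one_ne_zero)
    have hH : Hχ = 1 ∨ Hχ = -1 := quadraticChar_dichotomy (neg_ne_zero.2 (mul_ne_zero hu₀' hu₂'))
    have hB : Bχ = 1 ∨ Bχ = -1 := quadraticChar_dichotomy (mul_ne_zero (by rw [map_mul, map_mul]; exact mul_ne_zero (mul_ne_zero hsg' hτ') he'') (mul_ne_zero hu₁' hu₂'))
    have hΛ : Λχ = 1 ∨ Λχ = -1 := quadraticChar_dichotomy (neg_ne_zero.2 (mul_ne_zero (mul_ne_zero hτ' hu₁') (inv_ne_zero hc₀')))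
    -- the literals' raw tokens as sign patterns
    have hD0 : ∀ b : Fin 2 × Fin 2, (![ε ^ (b.1 : ℕ) * u₀, ε ^ (b.2 : ℕ) * u₁, ε ^ ((b.1 : ℕ) + (b.2 : ℕ)) * u₂] : Fin 3 → 𝒪[K]) 0 = ε ^ (b.1 : ℕ) * u₀ := fun b => rfl
    have hD1 : ∀ b : Fin 2 × Fin 2, (![ε ^ (b.1 : ℕ) * u₀, ε ^ (b.2 : ℕ) * u₁, ε ^ ((b.1 : ℕ) + (b.2 : ℕ)) * u₂] : Fin 3 → 𝒪[K]) 1 = ε ^ (b.2 : ℕ) * u₁ := fun b => rfl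
    have hD2 : ∀ b : Fin 2 × Fin 2, (![ε ^ (b.1 : ℕ) * u₀, ε ^ (b.2 : ℕ) * u₁, ε ^ ((b.1 : ℕ) + (b.2 : ℕ)) * u₂] : Fin 3 → 𝒪[K]) 2 = ε ^ ((b.1 : ℕ) + (b.2 : ℕ)) * u₂ := fun b => rfl
    have hhyp : ∀ b : Fin 2 × Fin 2, (quadraticChar 𝓀[K] (-(IsLocalRing.residue 𝒪[K] ((![ε ^ (b.1 : ℕ) * u₀, ε ^ (b.2 : ℕ) * u₁, ε ^ ((b.1 : ℕ) + (b.2 : ℕ)) * u₂] : Fin 3 → 𝒪[K]) 0) * IsLocalRing.residue 𝒪[K] ((![ε ^ (b.1 : ℕ) * u₀, ε ^ (b.2 : ℕ) * u₁, ε ^ ((b.1 : ℕ) + (b.2 : ℕ)) * u₂] : Fin 3 → 𝒪[K]) 2))) = 1) ↔ (-1 : ℤ) ^ (b.2 : ℕ) * Hχ = 1 := by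
      intro b
      rw [hD0 b, hD2 b, hHχ]
      rw [show -(IsLocalRing.residue 𝒪[K] (ε ^ (b.1 : ℕ) * u₀) * IsLocalRing.residue 𝒪[K] (ε ^ ((b.1 : ℕ) + (b.2 : ℕ)) * u₂)) =
        IsLocalRing.residue 𝒪[K] (ε ^ ((b.1 : ℕ) + ((b.1 : ℕ) + (b.2 : ℕ)))) * (-(IsLocalRing.residue 𝒪[K] u₀ * IsLocalRing.residue 𝒪[K] u₂)) by
          simp only [map_mul, map_pow, pow_add]; ring,
        quadraticChar_residue_pow_mul ε hεχ]
      rw [show (-1 : ℤ) ^ ((b.1 : ℕ) + ((b.1 : ℕ) + (b.2 : ℕ))) = (-1) ^ (b.2 : ℕ) from by rw [show (b.1 : ℕ) + ((b.1 : ℕ) + (b.2 : ℕ)) = 2 * (b.1 : ℕ) + (b.2 : ℕ) by ring, pow_add, pow_mul, neg_one_sq, one_pow, one_mul]]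
    have hbig : ∀ b : Fin 2 × Fin 2, (quadraticChar 𝓀[K] (IsLocalRing.residue 𝒪[K] (sg * τ * e' * (![ε ^ (b.1 : ℕ) * u₀, ε ^ (b.2 : ℕ) * u₁, ε ^ ((b.1 : ℕ) + (b.2 : ℕ)) * u₂] : Fin 3 → 𝒪[K]) 1 * (![ε ^ (b.1 : ℕ) * u₀, ε ^ (b.2 : ℕ) * u₁, ε ^ ((b.1 : ℕ) + (b.2 : ℕ)) * u₂] : Fin 3 → 𝒪[K]) 2)) = 1) ↔ (-1 : ℤ) ^ (b.1 : ℕ) * Bχ = 1 := by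
      intro b
      rw [hD1 b, hD2 b, hBχ]
      rw [show IsLocalRing.residue 𝒪[K] (sg * τ * e' * (ε ^ (b.2 : ℕ) * u₁) * (ε ^ ((b.1 : ℕ) + (b.2 : ℕ)) * u₂)) =
        IsLocalRing.residue 𝒪[K] (ε ^ ((b.2 : ℕ) + ((b.1 : ℕ) + (b.2 : ℕ)))) * (IsLocalRing.residue 𝒪[K] (sg * τ * e') * (IsLocalRing.residue 𝒪[K] u₁ * IsLocalRing.residue 𝒪[K] u₂)) by
          rw [pow_add]; simp only [map_mul, map_pow]; ring,
        quadraticChar_residue_pow_mul ε hεχ]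
      rw [show (-1 : ℤ) ^ ((b.2 : ℕ) + ((b.1 : ℕ) + (b.2 : ℕ))) = (-1) ^ (b.1 : ℕ) from by rw [show (b.2 : ℕ) + ((b.1 : ℕ) + (b.2 : ℕ)) = 2 * (b.2 : ℕ) + (b.1 : ℕ) by ring, pow_add, pow_mul, neg_one_sq, one_pow, one_mul]]
    have hlock : ∀ b : Fin 2 × Fin 2, (quadraticChar 𝓀[K] (-(IsLocalRing.residue 𝒪[K] (τ * (![ε ^ (b.1 : ℕ) * u₀, ε ^ (b.2 : ℕ) * u₁, ε ^ ((b.1 : ℕ) + (b.2 : ℕ)) * u₂] : Fin 3 → 𝒪[K]) 1) * (IsLocalRing.residue 𝒪[K] c₀)⁻¹)) = 1) ↔ (-1 : ℤ) ^ (b.2 : ℕ) * Λχ = 1 := by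
      intro b
      rw [hD1 b, hΛχ]
      rw [show -(IsLocalRing.residue 𝒪[K] (τ * (ε ^ (b.2 : ℕ) * u₁)) * (IsLocalRing.residue 𝒪[K] c₀)⁻¹) =
        IsLocalRing.residue 𝒪[K] (ε ^ (b.2 : ℕ)) * (-(IsLocalRing.residue 𝒪[K] τ * IsLocalRing.residue 𝒪[K] u₁ * (IsLocalRing.residue 𝒪[K] c₀)⁻¹)) by
          simp only [map_mul, map_pow]; ring,
        quadraticChar_residue_pow_mul ε hεχ]
    -- the sign of the head
    have hsign : (quadraticChar 𝓀[K] (IsLocalRing.residue 𝒪[K] ((-1) ^ m * (u₀ * u₂ * A * C))) : ℤ) = Hχ := by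
      -- `Ā = C̄` (the close pair) and `m = N₁` odd
      have hAC : IsLocalRing.residue 𝒪[K] A = IsLocalRing.residue 𝒪[K] C := by
        rw [← sub_eq_zero, ← map_sub, residue_eq_zero_iff_v_lt_one]
        have e : ((A - C : 𝒪[K]) : K) * ϖ ^ N₁ = α - γ := by
          push_cast
          have e1 : α - γ = (α - u) - (γ - u) := by ring
          rw [e1, hA, hC, heq]; ring
        have h : Valued.v (((A - C : 𝒪[K]) : K)) * Valued.v ϖ ^ N₁ = Valued.v ϖ ^ N := by
          rw [← map_pow, ← map_mul, e, hN]
        by_contra hge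
        have h1 : Valued.v (((A - C : 𝒪[K]) : K)) = 1 := le_antisymm (A - C).2 (not_lt.1 hge)
        rw [h1, one_mul] at h
        exact hN₁N (eq_of_v_pow_eq hϖ h)
      have hodm : Odd m := by rw [hmN]; exact hoddN₁
      rw [hHχ, map_mul, map_pow, map_neg, map_one, hodm.neg_one_pow, neg_one_mul, map_mul, map_mul, map_mul, hAC]
      rw [show -(IsLocalRing.residue 𝒪[K] u₀ * IsLocalRing.residue 𝒪[K] u₂ * IsLocalRing.residue 𝒪[K] C * IsLocalRing.residue 𝒪[K] C) =
        -(IsLocalRing.residue 𝒪[K] u₀ * IsLocalRing.residue 𝒪[K] u₂) * IsLocalRing.residue 𝒪[K] C ^ 2 by ring, map_mul, quadraticChar_sq_one' hC', mul_one]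
    -- rewrite the goal through the closed forms and the pooled sums
    have hf0 : (∑ b : Fin 2 × Fin 2, (-1 : ℚ) ^ (b.2 : ℕ) * ((({M : Submodule (Valued.integer K) (Fin 3 → K) |
              IsSelfDualLattice σ ϖ (Matrix.diagonal ![((ε : K)) ^ (b.1 : ℕ) * (u₀ : K), (ε : K) ^ (b.2 : ℕ) * (u₁ : K), (ε : K) ^ ((b.1 : ℕ) + (b.2 : ℕ)) * (u₂ : K)]) M ∧ mapGL T M = M ∧
                (![-- bd : `¬ (T − 1)M ⊆ ϖM`
                    ¬ M.map ((Matrix.toLin' ((T : Matrix (Fin 3) (Fin 3) K) - 1)).restrictScalars (Valued.integer K)) ≤ scaleLattice ϖ M,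
                  -- reg : depth 1, rank 2
                    M.map ((Matrix.toLin' ((T : Matrix (Fin 3) (Fin 3) K) - 1)).restrictScalars (Valued.integer K)) ≤ scaleLattice ϖ M ∧
                      ¬ M.map ((Matrix.toLin' ((T : Matrix (Fin 3) (Fin 3) K) - 1)).restrictScalars (Valued.integer K)) ≤ scaleLattice (ϖ ^ 2) M ∧
                      ¬ M.map ((Matrix.toLin' (((T : Matrix (Fin 3) (Fin 3) K) - 1) ^ 2)).restrictScalars (Valued.integer K)) ≤ scaleLattice (ϖ ^ 3) M,
                  -- 1s : depth 1, rank 1, class `c₀`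
                    M.map ((Matrix.toLin' ((T : Matrix (Fin 3) (Fin 3) K) - 1)).restrictScalars (Valued.integer K)) ≤ scaleLattice ϖ M ∧
                      ¬ M.map ((Matrix.toLin' ((T : Matrix (Fin 3) (Fin 3) K) - 1)).restrictScalars (Valued.integer K)) ≤ scaleLattice (ϖ ^ 2) M ∧
                      M.map ((Matrix.toLin' (((T : Matrix (Fin 3) (Fin 3) K) - 1) ^ 2)).restrictScalars (Valued.integer K)) ≤ scaleLattice (ϖ ^ 3) M ∧
                      ∃ y ∈ M, ∃ a : K, Valued.v a = 1 ∧
                        Valued.v (ϖ⁻¹ * pairing σ (Matrix.diagonal ![((ε : K)) ^ (b.1 : ℕ) * (u₀ : K), (ε : K) ^ (b.2 : ℕ) * (u₁ : K), (ε : K) ^ ((b.1 : ℕ) + (b.2 : ℕ)) * (u₂ : K)]) y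
                          (((T : Matrix (Fin 3) (Fin 3) K) - 1) *ᵥ y) - (c₀ : K) * a ^ 2) < 1,
                  -- 1n : depth 1, rank 1, class `c₀·ε`
                    M.map ((Matrix.toLin' ((T : Matrix (Fin 3) (Fin 3) K) - 1)).restrictScalars (Valued.integer K)) ≤ scaleLattice ϖ M ∧
                      ¬ M.map ((Matrix.toLin' ((T : Matrix (Fin 3) (Fin 3) K) - 1)).restrictScalars (Valued.integer K)) ≤ scaleLattice (ϖ ^ 2) M ∧
                      M.map ((Matrix.toLin' (((T : Matrix (Fin 3) (Fin 3) K) - 1) ^ 2)).restrictScalars (Valued.integer K)) ≤ scaleLattice (ϖ ^ 3) M ∧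
                      ∃ y ∈ M, ∃ a : K, Valued.v a = 1 ∧
                        Valued.v (ϖ⁻¹ * pairing σ (Matrix.diagonal ![((ε : K)) ^ (b.1 : ℕ) * (u₀ : K), (ε : K) ^ (b.2 : ℕ) * (u₁ : K), (ε : K) ^ ((b.1 : ℕ) + (b.2 : ℕ)) * (u₂ : K)]) y
                          (((T : Matrix (Fin 3) (Fin 3) K) - 1) *ᵥ y) - (c₀ : K) * (ε : K) * a ^ 2) < 1,
                  -- 0 : depth ≥ 2
                    M.map ((Matrix.toLin' ((T : Matrix (Fin 3) (Fin 3) K) - 1)).restrictScalars (Valued.integer K)) ≤ scaleLattice (ϖ ^ 2) M] : Fin 5 → Prop) j}).ncard : ℕ) : ℚ)) =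
        ∑ b : Fin 2 × Fin 2, (-1 : ℚ) ^ (b.2 : ℕ) * (fun b : Fin 2 × Fin 2 => ((({M : Submodule (Valued.integer K) (Fin 3 → K) |
              IsSelfDualLattice σ ϖ (Matrix.diagonal ![((ε : K)) ^ (b.1 : ℕ) * (u₀ : K), (ε : K) ^ (b.2 : ℕ) * (u₁ : K), (ε : K) ^ ((b.1 : ℕ) + (b.2 : ℕ)) * (u₂ : K)]) M ∧ mapGL T M = M ∧
                (![-- bd : `¬ (T − 1)M ⊆ ϖM`
                    ¬ M.map ((Matrix.toLin' ((T : Matrix (Fin 3) (Fin 3) K) - 1)).restrictScalars (Valued.integer K)) ≤ scaleLattice ϖ M,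
                  -- reg : depth 1, rank 2
                    M.map ((Matrix.toLin' ((T : Matrix (Fin 3) (Fin 3) K) - 1)).restrictScalars (Valued.integer K)) ≤ scaleLattice ϖ M ∧
                      ¬ M.map ((Matrix.toLin' ((T : Matrix (Fin 3) (Fin 3) K) - 1)).restrictScalars (Valued.integer K)) ≤ scaleLattice (ϖ ^ 2) M ∧
                      ¬ M.map ((Matrix.toLin' (((T : Matrix (Fin 3) (Fin 3) K) - 1) ^ 2)).restrictScalars (Valued.integer K)) ≤ scaleLattice (ϖ ^ 3) M,
                  -- 1s : depth 1, rank 1, class `c₀`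
                    M.map ((Matrix.toLin' ((T : Matrix (Fin 3) (Fin 3) K) - 1)).restrictScalars (Valued.integer K)) ≤ scaleLattice ϖ M ∧
                      ¬ M.map ((Matrix.toLin' ((T : Matrix (Fin 3) (Fin 3) K) - 1)).restrictScalars (Valued.integer K)) ≤ scaleLattice (ϖ ^ 2) M ∧
                      M.map ((Matrix.toLin' (((T : Matrix (Fin 3) (Fin 3) K) - 1) ^ 2)).restrictScalars (Valued.integer K)) ≤ scaleLattice (ϖ ^ 3) M ∧
                      ∃ y ∈ M, ∃ a : K, Valued.v a = 1 ∧
                        Valued.v (ϖ⁻¹ * pairing σ (Matrix.diagonal ![((ε : K)) ^ (b.1 : ℕ) * (u₀ : K), (ε : K) ^ (b.2 : ℕ) * (u₁ : K), (ε : K) ^ ((b.1 : ℕ) + (b.2 : ℕ)) * (u₂ : K)]) y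
                          (((T : Matrix (Fin 3) (Fin 3) K) - 1) *ᵥ y) - (c₀ : K) * a ^ 2) < 1,
                  -- 1n : depth 1, rank 1, class `c₀·ε`
                    M.map ((Matrix.toLin' ((T : Matrix (Fin 3) (Fin 3) K) - 1)).restrictScalars (Valued.integer K)) ≤ scaleLattice ϖ M ∧
                      ¬ M.map ((Matrix.toLin' ((T : Matrix (Fin 3) (Fin 3) K) - 1)).restrictScalars (Valued.integer K)) ≤ scaleLattice (ϖ ^ 2) M ∧
                      M.map ((Matrix.toLin' (((T : Matrix (Fin 3) (Fin 3) K) - 1) ^ 2)).restrictScalars (Valued.integer K)) ≤ scaleLattice (ϖ ^ 3) M ∧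
                      ∃ y ∈ M, ∃ a : K, Valued.v a = 1 ∧
                        Valued.v (ϖ⁻¹ * pairing σ (Matrix.diagonal ![((ε : K)) ^ (b.1 : ℕ) * (u₀ : K), (ε : K) ^ (b.2 : ℕ) * (u₁ : K), (ε : K) ^ ((b.1 : ℕ) + (b.2 : ℕ)) * (u₂ : K)]) y
                          (((T : Matrix (Fin 3) (Fin 3) K) - 1) *ᵥ y) - (c₀ : K) * (ε : K) * a ^ 2) < 1,
                  -- 0 : depth ≥ 2
                    M.map ((Matrix.toLin' ((T : Matrix (Fin 3) (Fin 3) K) - 1)).restrictScalars (Valued.integer K)) ≤ scaleLattice (ϖ ^ 2) M] : Fin 5 → Prop) j}).ncard : ℕ) : ℚ)) b := rfl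
    rw [hf0]
    by_cases hsq : IsSquare (-1 : 𝓀[K])
    · simp only [if_pos hsq] at hlit
      have hS := signedSum_isoTokens_shared (Fintype.card 𝓀[K]) s' hs' Hχ Bχ Λχ hH hB hΛ (((![0, 0, 0, 0, 1] : Fin 5 → ℕ) j : ℕ) : ℚ) (((![(Fintype.card 𝓀[K]) ^ (3 * mA + 3), (Fintype.card 𝓀[K]) ^ (3 * mA + 2), (Fintype.card 𝓀[K]).choose 2 * (Fintype.card 𝓀[K]) ^ (2 * mA) * ∑ i ∈ Finset.range mA, (Fintype.card 𝓀[K]) ^ i, (Fintype.card 𝓀[K]).choose 2 * (Fintype.card 𝓀[K]) ^ (2 * mA) * ∑ i ∈ Finset.range mA, (Fintype.card 𝓀[K]) ^ i,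
          ∑ i ∈ Finset.range (mA + 1), (Fintype.card 𝓀[K]) ^ (2 * i) + ∑ i ∈ Finset.range mA, (Fintype.card 𝓀[K]) ^ (2 * mA + 1 + i)] : Fin 5 → ℕ) j : ℕ) : ℚ) (((![0, 0, (Fintype.card 𝓀[K]) ^ (2 * mA), 0, ∑ i ∈ Finset.range mA, (Fintype.card 𝓀[K]) ^ (2 * i)] : Fin 5 → ℕ) j : ℕ) : ℚ) (((![0, 0, 0, (Fintype.card 𝓀[K]) ^ (2 * mA), ∑ i ∈ Finset.range mA, (Fintype.card 𝓀[K]) ^ (2 * i)] : Fin 5 → ℕ) j : ℕ) : ℚ)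
        _ _ _ hhyp hbig hlock _ hlit
      have hPM : (((![0, 0, (Fintype.card 𝓀[K]) ^ (2 * mA), 0, ∑ i ∈ Finset.range mA, (Fintype.card 𝓀[K]) ^ (2 * i)] : Fin 5 → ℕ) j : ℕ) : ℚ) + (((![0, 0, 0, (Fintype.card 𝓀[K]) ^ (2 * mA), ∑ i ∈ Finset.range mA, (Fintype.card 𝓀[K]) ^ (2 * i)] : Fin 5 → ℕ) j : ℕ) : ℚ) = (((![0, 0, (Fintype.card 𝓀[K]) ^ (2 * mA), (Fintype.card 𝓀[K]) ^ (2 * mA), 2 * ∑ i ∈ Finset.range mA, (Fintype.card 𝓀[K]) ^ (2 * i)] : Fin 5 → ℕ) j : ℕ) : ℚ) := by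
        have h := congrFun (shellSum_P_pos_add_neg_keep (Fintype.card 𝓀[K]) mA) j
        rw [Pi.add_apply] at h
        exact_mod_cast h
      have hX := kappaSum_isoceles_eq (Fintype.card 𝓀[K]) mA s' hq2 j
      rw [hsign, hmN, hmA, hnk]
      linear_combination hS + (Hχ : ℚ) * hX +
        ((Hχ : ℚ) * (2 * (Fintype.card 𝓀[K] : ℚ) ^ (s' + 2) - 2 * (Fintype.card 𝓀[K] : ℚ) ^ 2 - 2 * (Fintype.card 𝓀[K] : ℚ))) * hPM
    · simp only [if_neg hsq] at hlit
      have hS := signedSum_isoTokens_shared (Fintype.card 𝓀[K]) s' hs' Hχ Bχ Λχ hH hB hΛ (((![0, 0, 0, 0, 1] : Fin 5 → ℕ) j : ℕ) : ℚ) (((![(Fintype.card 𝓀[K]) ^ (3 * mA + 3), (Fintype.card 𝓀[K]) ^ (3 * mA + 2), (Fintype.card 𝓀[K]).choose 2 * (Fintype.card 𝓀[K]) ^ (2 * mA) * ∑ i ∈ Finset.range mA, (Fintype.card 𝓀[K]) ^ i, (Fintype.card 𝓀[K]).choose 2 * (Fintype.card 𝓀[K]) ^ (2 * mA) * ∑ i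 ∈ Finset.range mA, (Fintype.card 𝓀[K]) ^ i,
          ∑ i ∈ Finset.range (mA + 1), (Fintype.card 𝓀[K]) ^ (2 * i) + ∑ i ∈ Finset.range mA, (Fintype.card 𝓀[K]) ^ (2 * mA + 1 + i)] : Fin 5 → ℕ) j : ℕ) : ℚ) (((![0, 0, if Even mA then (Fintype.card 𝓀[K]) ^ (2 * mA) else 0, if Even mA then 0 else (Fintype.card 𝓀[K]) ^ (2 * mA), ∑ i ∈ Finset.range mA, (Fintype.card 𝓀[K]) ^ (2 * i)] : Fin 5 → ℕ) j : ℕ) : ℚ) (((![0, 0, if Even mA then 0 else (Fintype.card 𝓀[K]) ^ (2 * mA), if Even mA then (Fintype.card 𝓀[K]) ^ (2 * mA) else 0, ∑ i ∈ Finset.range mA, (Fintype.card 𝓀[K]) ^ (2 * i)] : Fin 5 → ℕ) j : ℕ) : ℚ)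
        _ _ _ hhyp hbig hlock _ hlit
      have hPM : (((![0, 0, if Even mA then (Fintype.card 𝓀[K]) ^ (2 * mA) else 0, if Even mA then 0 else (Fintype.card 𝓀[K]) ^ (2 * mA), ∑ i ∈ Finset.range mA, (Fintype.card 𝓀[K]) ^ (2 * i)] : Fin 5 → ℕ) j : ℕ) : ℚ) + (((![0, 0, if Even mA then 0 else (Fintype.card 𝓀[K]) ^ (2 * mA), if Even mA then (Fintype.card 𝓀[K]) ^ (2 * mA) else 0, ∑ i ∈ Finset.range mA, (Fintype.card 𝓀[K]) ^ (2 * i)] : Fin 5 → ℕ) j : ℕ) : ℚ) = (((![0, 0, (Fintype.card 𝓀[K]) ^ (2 * mA), (Fintype.card 𝓀[K]) ^ (2 * mA), 2 * ∑ i ∈ Finset.range mA, (Fintype.card 𝓀[K]) ^ (2 * i)] : Fin 5 → ℕ) j : ℕ) : ℚ) := by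
        have h := congrFun (shellSum_P_pos_add_neg_flip (Fintype.card 𝓀[K]) mA) j
        rw [Pi.add_apply] at h
        exact_mod_cast h
      have hX := kappaSum_isoceles_eq (Fintype.card 𝓀[K]) mA s' hq2 j
      rw [hsign, hmN, hmA, hnk]
      linear_combination hS + (Hχ : ℚ) * hX +
        ((Hχ : ℚ) * (2 * (Fintype.card 𝓀[K] : ℚ) ^ (s' + 2) - 2 * (Fintype.card 𝓀[K] : ℚ) ^ 2 - 2 * (Fintype.card 𝓀[K] : ℚ))) * hPM
  · -- N₂ < N₁
    -- CONFIGURATION B' (`N₂ < N₁`, `γ` isolated)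
    have hNN₂ : N = N₂ := by
      have h : Valued.v (α - γ) = Valued.v ϖ ^ N₂ := by
        have e : α - γ = (α - u) + (u - γ) := by ring
        rw [e, Valuation.map_add_eq_of_lt_right]
        · exact hN₂
        · rw [hN₁, hN₂]; exact (v_pow_lt_iff hϖ).2 hgt
      rw [hN] at h
      exact eq_of_v_pow_eq hϖ h
    obtain ⟨s', hs'def⟩ : ∃ s', N₁ = N₂ + 2 * s' := ⟨m - N₂, by omega⟩
    have hs' : 1 ≤ s' := by omega
    obtain ⟨mA, hmA⟩ : ∃ mA, N₂ = 2 * mA + 3 := ⟨n - 1, by omega⟩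
    have hd3 : 3 ≤ N₂ := by omega
    have hmN : m = N₂ + s' := by omega
    have hnk : n = mA + 1 := by omega
    -- τ and e′ as elements of 𝒪
    let τ : 𝒪[K] := C * uinv
    have hτ : ((τ : 𝒪[K]) : K) = (ϖ ^ N₂)⁻¹ * ((![α / u, 1, γ / u] : Fin 3 → K) 2 - (![α / u, 1, γ / u] : Fin 3 → K) 1) := by
      show ((C * uinv : 𝒪[K]) : K) = (ϖ ^ N₂)⁻¹ * (γ / u - 1)
      push_cast
      rw [huinvK, div_sub_one hu0, hC]
      field_simp
    have hτv : Valued.v ((τ : 𝒪[K]) : K) = 1 := by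
      show Valued.v ((C * uinv : 𝒪[K]) : K) = 1
      push_cast; rw [map_mul, hCv, huinvK, huinv, one_mul]
    let e' : 𝒪[K] := A * uinv
    have he' : ((e' : 𝒪[K]) : K) = (ϖ ^ (N₂ + 2 * s'))⁻¹ * ((![α / u, 1, γ / u] : Fin 3 → K) 0 - (![α / u, 1, γ / u] : Fin 3 → K) 1) := by
      show ((A * uinv : 𝒪[K]) : K) = (ϖ ^ (N₂ + 2 * s'))⁻¹ * (α / u - 1)
      push_cast
      rw [huinvK, div_sub_one hu0, hA, ← hs'def]
      field_simp
    have he'v : Valued.v ((e' : 𝒪[K]) : K) = 1 := by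
      show Valued.v ((A * uinv : 𝒪[K]) : K) = 1
      push_cast; rw [map_mul, hAv, huinvK, huinv, one_mul]
    have hsgv : Valued.v ((-1 : K) ^ (s' + 1)) ≤ 1 := by rw [map_pow, Valuation.map_neg, map_one, one_pow]
    let sg : 𝒪[K] := ⟨(-1) ^ (s' + 1), (Valuation.mem_integer_iff _ _).2 hsgv⟩
    have hsg : ((sg : 𝒪[K]) : K) = (-1) ^ (s' + 1) := rfl
    have hsgO : sg = (-1) ^ (s' + 1) := Subtype.ext (by push_cast; rfl)
    have hsgres : IsLocalRing.residue 𝒪[K] sg = (-1) ^ (s' + 1) := by rw [hsgO, map_pow, map_neg, map_one]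
    -- eigen data of the configuration
    have hN1le : Valued.v ϖ ^ N₁ ≤ Valued.v ϖ ^ N₂ := (v_pow_le_iff hϖ).2 hgt.le
    have hN1le' : Valued.v ϖ ^ N₁ ≤ Valued.v ϖ ^ (N₂ + 2) := (v_pow_le_iff hϖ).2 (by omega)
    have he : ∀ i, Valued.v ((![α / u, 1, γ / u] : Fin 3 → K) i - 1) ≤ Valued.v ϖ ^ N₂ := by
      intro i; fin_cases i
      · show Valued.v ((![α / u, 1, γ / u] : Fin 3 → K) 0 - 1) ≤ _
        rw [hS0']; exact hN1le
      · show Valued.v ((![α / u, 1, γ / u] : Fin 3 → K) 1 - 1) ≤ _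
        rw [hS1, sub_self, map_zero]; exact zero_le
      · exact le_of_eq hS2'
    have hiso : ∀ j', j' ≠ (2 : Fin 3) → Valued.v ((![α / u, 1, γ / u] : Fin 3 → K) 2 - (![α / u, 1, γ / u] : Fin 3 → K) j') = Valued.v ϖ ^ N₂ := by
      intro j' hj'; fin_cases j'
      · show Valued.v ((![α / u, 1, γ / u] : Fin 3 → K) 2 - (![α / u, 1, γ / u] : Fin 3 → K) 0) = _
        rw [hsw, hS02', hNN₂]
      · show Valued.v ((![α / u, 1, γ / u] : Fin 3 → K) 2 - (![α / u, 1, γ / u] : Fin 3 → K) 1) = _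
        rw [hsw, hS12]
      · exact absurd rfl hj'
    have hclose : ∀ j' k', j' ≠ (2 : Fin 3) → k' ≠ (2 : Fin 3) →
        Valued.v ((![α / u, 1, γ / u] : Fin 3 → K) j' - (![α / u, 1, γ / u] : Fin 3 → K) k') ≤ Valued.v ϖ ^ (N₂ + 2) := by
      intro j' k' hj' hk'
      fin_cases j' <;> fin_cases k'
      all_goals first | exact absurd rfl hj' | exact absurd rfl hk' | skip
      · show Valued.v ((![α / u, 1, γ / u] : Fin 3 → K) 0 - (![α / u, 1, γ / u] : Fin 3 → K) 0) ≤ _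
        rw [sub_self, map_zero]; exact zero_le
      · show Valued.v ((![α / u, 1, γ / u] : Fin 3 → K) 0 - (![α / u, 1, γ / u] : Fin 3 → K) 1) ≤ _
        rw [hsw, hS10]; exact hN1le'
      · show Valued.v ((![α / u, 1, γ / u] : Fin 3 → K) 1 - (![α / u, 1, γ / u] : Fin 3 → K) 0) ≤ _
        rw [hS10]; exact hN1le'
      · show Valued.v ((![α / u, 1, γ / u] : Fin 3 → K) 1 - (![α / u, 1, γ / u] : Fin 3 → K) 1) ≤ _
        rw [sub_self, map_zero]; exact zero_le
    have hgap : ∀ j' k', j' ≠ (2 : Fin 3) → k' ≠ (2 : Fin 3) → j' ≠ k' →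
        Valued.v ((![α / u, 1, γ / u] : Fin 3 → K) j' - (![α / u, 1, γ / u] : Fin 3 → K) k') = Valued.v ϖ ^ (N₂ + 2 * s') := by
      intro j' k' hj' hk' hjk
      fin_cases j' <;> fin_cases k'
      all_goals first | exact absurd rfl hj' | exact absurd rfl hk' | exact absurd rfl hjk | skip
      · show Valued.v ((![α / u, 1, γ / u] : Fin 3 → K) 0 - (![α / u, 1, γ / u] : Fin 3 → K) 1) = _
        rw [hsw, hS10, hs'def]
      · show Valued.v ((![α / u, 1, γ / u] : Fin 3 → K) 1 - (![α / u, 1, γ / u] : Fin 3 → K) 0) = _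
        rw [hS10, hs'def]
    have hreg : ∀ i j', i ≠ j' → (![α / u, 1, γ / u] : Fin 3 → K) i ≠ (![α / u, 1, γ / u] : Fin 3 → K) j' := by
      intro i j' hij h
      have h0 : Valued.v ((![α / u, 1, γ / u] : Fin 3 → K) i - (![α / u, 1, γ / u] : Fin 3 → K) j') = 0 := by rw [h, sub_self, map_zero]
      fin_cases i <;> fin_cases j'
      all_goals first | exact absurd rfl hij | skip
      · change Valued.v ((![α / u, 1, γ / u] : Fin 3 → K) 0 - (![α / u, 1, γ / u] : Fin 3 → K) 1) = 0 at h0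
        rw [hsw, hS10] at h0; exact pow_ne_zero _ hvϖ0 h0
      · change Valued.v ((![α / u, 1, γ / u] : Fin 3 → K) 0 - (![α / u, 1, γ / u] : Fin 3 → K) 2) = 0 at h0
        rw [hS02'] at h0; exact pow_ne_zero _ hvϖ0 h0
      · change Valued.v ((![α / u, 1, γ / u] : Fin 3 → K) 1 - (![α / u, 1, γ / u] : Fin 3 → K) 0) = 0 at h0
        rw [hS10] at h0; exact pow_ne_zero _ hvϖ0 h0
      · change Valued.v ((![α / u, 1, γ / u] : Fin 3 → K) 1 - (![α / u, 1, γ / u] : Fin 3 → K) 2) = 0 at h0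
        rw [hS12] at h0; exact pow_ne_zero _ hvϖ0 h0
      · change Valued.v ((![α / u, 1, γ / u] : Fin 3 → K) 2 - (![α / u, 1, γ / u] : Fin 3 → K) 0) = 0 at h0
        rw [hsw, hS02'] at h0; exact pow_ne_zero _ hvϖ0 h0
      · change Valued.v ((![α / u, 1, γ / u] : Fin 3 → K) 2 - (![α / u, 1, γ / u] : Fin 3 → K) 1) = 0 at h0
        rw [hsw, hS12] at h0; exact pow_ne_zero _ hvϖ0 h0
    -- the per-literal closed forms
    have hlit := fun b : Fin 2 × Fin 2 =>
      literal_count_isoceles (ϖ := ϖ) hσ hvσ hϖ hσϖ hres h2 hnorm u₀ u₁ u₂ ε c₀ hu₀ hu₁ hu₂ hεv hc₀ hσu₀ hσu₁ hσu₂ hσε _hσc₀ hε α u γ hα hu hγ hα2 hu2 hγ2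
        T hT N₁ N₂ N m n hN₁ hN₂ hN hm hn h1n A C hA hC hIso hHyp hBare 2 1 0 (by decide) (by decide) (by decide) hd3 mA hmA s' hs'
        he hiso hclose hreg hgap τ e' sg hτ hτv he' he'v hsg b j
    -- the three sign characters
    set Hχ : ℤ := quadraticChar 𝓀[K] (-(IsLocalRing.residue 𝒪[K] u₁ * IsLocalRing.residue 𝒪[K] u₀)) with hHχ
    set Bχ : ℤ := quadraticChar 𝓀[K] (IsLocalRing.residue 𝒪[K] (sg * τ * e') * (IsLocalRing.residue 𝒪[K] u₂ * IsLocalRing.residue 𝒪[K] u₀)) with hBχ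
    set Λχ : ℤ := quadraticChar 𝓀[K] (-(IsLocalRing.residue 𝒪[K] τ * IsLocalRing.residue 𝒪[K] u₂ * (IsLocalRing.residue 𝒪[K] c₀)⁻¹)) with hΛχ
    have hτ' := hres0 τ hτv
    have he'' := hres0 e' he'v
    have hsg' : IsLocalRing.residue 𝒪[K] sg ≠ 0 := by rw [hsgres]; exact pow_ne_zero _ (neg_ne_zero.2 one_ne_zero)
    have hH : Hχ = 1 ∨ Hχ = -1 := quadraticChar_dichotomy (neg_ne_zero.2 (mul_ne_zero hu₁' hu₀'))
    have hB : Bχ = 1 ∨ Bχ = -1 := quadraticChar_dichotomy (mul_ne_zero (by rw [map_mul, map_mul]; exact mul_ne_zero (mul_ne_zero hsg' hτ') he'') (mul_ne_zero hu₂' hu₀'))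
    have hΛ : Λχ = 1 ∨ Λχ = -1 := quadraticChar_dichotomy (neg_ne_zero.2 (mul_ne_zero (mul_ne_zero hτ' hu₂') (inv_ne_zero hc₀')))
    -- the literals' raw tokens as sign patterns
    have hD0 : ∀ b : Fin 2 × Fin 2, (![ε ^ (b.1 : ℕ) * u₀, ε ^ (b.2 : ℕ) * u₁, ε ^ ((b.1 : ℕ) + (b.2 : ℕ)) * u₂] : Fin 3 → 𝒪[K]) 0 = ε ^ (b.1 : ℕ) * u₀ := fun b => rfl
    have hD1 : ∀ b : Fin 2 × Fin 2, (![ε ^ (b.1 : ℕ) * u₀, ε ^ (b.2 : ℕ) * u₁, ε ^ ((b.1 : ℕ) + (b.2 : ℕ)) * u₂] : Fin 3 → 𝒪[K]) 1 = ε ^ (b.2 : ℕ) * u₁ := fun b => rfl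
    have hD2 : ∀ b : Fin 2 × Fin 2, (![ε ^ (b.1 : ℕ) * u₀, ε ^ (b.2 : ℕ) * u₁, ε ^ ((b.1 : ℕ) + (b.2 : ℕ)) * u₂] : Fin 3 → 𝒪[K]) 2 = ε ^ ((b.1 : ℕ) + (b.2 : ℕ)) * u₂ := fun b => rfl
    have hhyp : ∀ b : Fin 2 × Fin 2, (quadraticChar 𝓀[K] (-(IsLocalRing.residue 𝒪[K] ((![ε ^ (b.1 : ℕ) * u₀, ε ^ (b.2 : ℕ) * u₁, ε ^ ((b.1 : ℕ) + (b.2 : ℕ)) * u₂] : Fin 3 → 𝒪[K]) 1) * IsLocalRing.residue 𝒪[K] ((![ε ^ (b.1 : ℕ) * u₀, ε ^ (b.2 : ℕ) * u₁, ε ^ ((b.1 : ℕ) + (b.2 : ℕ)) * u₂] : Fin 3 → 𝒪[K]) 0))) = 1) ↔ (-1 : ℤ) ^ ((b.1 : ℕ) + (b.2 : ℕ)) * Hχ = 1 := by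
      intro b
      rw [hD1 b, hD0 b, hHχ]
      rw [show -(IsLocalRing.residue 𝒪[K] (ε ^ (b.2 : ℕ) * u₁) * IsLocalRing.residue 𝒪[K] (ε ^ (b.1 : ℕ) * u₀)) =
        IsLocalRing.residue 𝒪[K] (ε ^ ((b.2 : ℕ) + (b.1 : ℕ))) * (-(IsLocalRing.residue 𝒪[K] u₁ * IsLocalRing.residue 𝒪[K] u₀)) by
          simp only [map_mul, map_pow, pow_add]; ring,
        quadraticChar_residue_pow_mul ε hεχ]
      rw [show (-1 : ℤ) ^ ((b.2 : ℕ) + (b.1 : ℕ)) = (-1) ^ ((b.1 : ℕ) + (b.2 : ℕ)) from by rw [add_comm]]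
    have hbig : ∀ b : Fin 2 × Fin 2, (quadraticChar 𝓀[K] (IsLocalRing.residue 𝒪[K] (sg * τ * e' * (![ε ^ (b.1 : ℕ) * u₀, ε ^ (b.2 : ℕ) * u₁, ε ^ ((b.1 : ℕ) + (b.2 : ℕ)) * u₂] : Fin 3 → 𝒪[K]) 2 * (![ε ^ (b.1 : ℕ) * u₀, ε ^ (b.2 : ℕ) * u₁, ε ^ ((b.1 : ℕ) + (b.2 : ℕ)) * u₂] : Fin 3 → 𝒪[K]) 0)) = 1) ↔ (-1 : ℤ) ^ (b.2 : ℕ) * Bχ = 1 := by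
      intro b
      rw [hD2 b, hD0 b, hBχ]
      rw [show IsLocalRing.residue 𝒪[K] (sg * τ * e' * (ε ^ ((b.1 : ℕ) + (b.2 : ℕ)) * u₂) * (ε ^ (b.1 : ℕ) * u₀)) =
        IsLocalRing.residue 𝒪[K] (ε ^ (((b.1 : ℕ) + (b.2 : ℕ)) + (b.1 : ℕ))) * (IsLocalRing.residue 𝒪[K] (sg * τ * e') * (IsLocalRing.residue 𝒪[K] u₂ * IsLocalRing.residue 𝒪[K] u₀)) by
          rw [pow_add]; simp only [map_mul, map_pow]; ring,
        quadraticChar_residue_pow_mul ε hεχ]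
      rw [show (-1 : ℤ) ^ (((b.1 : ℕ) + (b.2 : ℕ)) + (b.1 : ℕ)) = (-1) ^ (b.2 : ℕ) from by rw [show ((b.1 : ℕ) + (b.2 : ℕ)) + (b.1 : ℕ) = 2 * (b.1 : ℕ) + (b.2 : ℕ) by ring, pow_add, pow_mul, neg_one_sq, one_pow, one_mul]]
    have hlock : ∀ b : Fin 2 × Fin 2, (quadraticChar 𝓀[K] (-(IsLocalRing.residue 𝒪[K] (τ * (![ε ^ (b.1 : ℕ) * u₀, ε ^ (b.2 : ℕ) * u₁, ε ^ ((b.1 : ℕ) + (b.2 : ℕ)) * u₂] : Fin 3 → 𝒪[K]) 2) * (IsLocalRing.residue 𝒪[K] c₀)⁻¹)) = 1) ↔ (-1 : ℤ) ^ ((b.1 : ℕ) + (b.2 : ℕ)) * Λχ = 1 := by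
      intro b
      rw [hD2 b, hΛχ]
      rw [show -(IsLocalRing.residue 𝒪[K] (τ * (ε ^ ((b.1 : ℕ) + (b.2 : ℕ)) * u₂)) * (IsLocalRing.residue 𝒪[K] c₀)⁻¹) =
        IsLocalRing.residue 𝒪[K] (ε ^ ((b.1 : ℕ) + (b.2 : ℕ))) * (-(IsLocalRing.residue 𝒪[K] τ * IsLocalRing.residue 𝒪[K] u₂ * (IsLocalRing.residue 𝒪[K] c₀)⁻¹)) by
          simp only [map_mul, map_pow]; ring,
        quadraticChar_residue_pow_mul ε hεχ]
    -- the sign of the head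
    have hsign : (quadraticChar 𝓀[K] (IsLocalRing.residue 𝒪[K] ((-1) ^ m * (u₀ * u₂ * A * C))) : ℤ) = Bχ := by
      have hodm : (-1 : 𝓀[K]) ^ m = (-1) ^ (s' + 1) := by
        rw [hmN]
        obtain ⟨a, ha⟩ := hoddN₂
        rw [ha, show 2 * a + 1 + s' = (s' + 1) + 2 * a by ring, pow_add, pow_mul, neg_one_sq, one_pow, mul_one]
      have e : IsLocalRing.residue 𝒪[K] (sg * τ * e') * (IsLocalRing.residue 𝒪[K] u₂ * IsLocalRing.residue 𝒪[K] u₀) =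
          IsLocalRing.residue 𝒪[K] ((-1) ^ m * (u₀ * u₂ * A * C)) * (IsLocalRing.residue 𝒪[K] uinv) ^ 2 := by
        rw [show τ = C * uinv from rfl, show e' = A * uinv from rfl, hsgO]
        simp only [map_mul, map_pow, map_neg, map_one, hodm]
        ring
      rw [hBχ, e, map_mul (quadraticChar 𝓀[K]), quadraticChar_sq_one' huinv', mul_one]

    -- rewrite the goal through the closed forms and the pooled sums
    have hf0 : (∑ b : Fin 2 × Fin 2, (-1 : ℚ) ^ (b.2 : ℕ) * ((({M : Submodule (Valued.integer K) (Fin 3 → K) |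
              IsSelfDualLattice σ ϖ (Matrix.diagonal ![((ε : K)) ^ (b.1 : ℕ) * (u₀ : K), (ε : K) ^ (b.2 : ℕ) * (u₁ : K), (ε : K) ^ ((b.1 : ℕ) + (b.2 : ℕ)) * (u₂ : K)]) M ∧ mapGL T M = M ∧
                (![-- bd : `¬ (T − 1)M ⊆ ϖM`
                    ¬ M.map ((Matrix.toLin' ((T : Matrix (Fin 3) (Fin 3) K) - 1)).restrictScalars (Valued.integer K)) ≤ scaleLattice ϖ M,
                  -- reg : depth 1, rank 2
                    M.map ((Matrix.toLin' ((T : Matrix (Fin 3) (Fin 3) K) - 1)).restrictScalars (Valued.integer K)) ≤ scaleLattice ϖ M ∧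
                      ¬ M.map ((Matrix.toLin' ((T : Matrix (Fin 3) (Fin 3) K) - 1)).restrictScalars (Valued.integer K)) ≤ scaleLattice (ϖ ^ 2) M ∧
                      ¬ M.map ((Matrix.toLin' (((T : Matrix (Fin 3) (Fin 3) K) - 1) ^ 2)).restrictScalars (Valued.integer K)) ≤ scaleLattice (ϖ ^ 3) M,
                  -- 1s : depth 1, rank 1, class `c₀`
                    M.map ((Matrix.toLin' ((T : Matrix (Fin 3) (Fin 3) K) - 1)).restrictScalars (Valued.integer K)) ≤ scaleLattice ϖ M ∧
                      ¬ M.map ((Matrix.toLin' ((T : Matrix (Fin 3) (Fin 3) K) - 1)).restrictScalars (Valued.integer K)) ≤ scaleLattice (ϖ ^ 2) M ∧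
                      M.map ((Matrix.toLin' (((T : Matrix (Fin 3) (Fin 3) K) - 1) ^ 2)).restrictScalars (Valued.integer K)) ≤ scaleLattice (ϖ ^ 3) M ∧
                      ∃ y ∈ M, ∃ a : K, Valued.v a = 1 ∧
                        Valued.v (ϖ⁻¹ * pairing σ (Matrix.diagonal ![((ε : K)) ^ (b.1 : ℕ) * (u₀ : K), (ε : K) ^ (b.2 : ℕ) * (u₁ : K), (ε : K) ^ ((b.1 : ℕ) + (b.2 : ℕ)) * (u₂ : K)]) y
                          (((T : Matrix (Fin 3) (Fin 3) K) - 1) *ᵥ y) - (c₀ : K) * a ^ 2) < 1,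
                  -- 1n : depth 1, rank 1, class `c₀·ε`
                    M.map ((Matrix.toLin' ((T : Matrix (Fin 3) (Fin 3) K) - 1)).restrictScalars (Valued.integer K)) ≤ scaleLattice ϖ M ∧
                      ¬ M.map ((Matrix.toLin' ((T : Matrix (Fin 3) (Fin 3) K) - 1)).restrictScalars (Valued.integer K)) ≤ scaleLattice (ϖ ^ 2) M ∧
                      M.map ((Matrix.toLin' (((T : Matrix (Fin 3) (Fin 3) K) - 1) ^ 2)).restrictScalars (Valued.integer K)) ≤ scaleLattice (ϖ ^ 3) M ∧
                      ∃ y ∈ M, ∃ a : K, Valued.v a = 1 ∧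
                        Valued.v (ϖ⁻¹ * pairing σ (Matrix.diagonal ![((ε : K)) ^ (b.1 : ℕ) * (u₀ : K), (ε : K) ^ (b.2 : ℕ) * (u₁ : K), (ε : K) ^ ((b.1 : ℕ) + (b.2 : ℕ)) * (u₂ : K)]) y
                          (((T : Matrix (Fin 3) (Fin 3) K) - 1) *ᵥ y) - (c₀ : K) * (ε : K) * a ^ 2) < 1,
                  -- 0 : depth ≥ 2
                    M.map ((Matrix.toLin' ((T : Matrix (Fin 3) (Fin 3) K) - 1)).restrictScalars (Valued.integer K)) ≤ scaleLattice (ϖ ^ 2) M] : Fin 5 → Prop) j}).ncard : ℕ) : ℚ)) =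
        ∑ b : Fin 2 × Fin 2, (-1 : ℚ) ^ (b.2 : ℕ) * (fun b : Fin 2 × Fin 2 => ((({M : Submodule (Valued.integer K) (Fin 3 → K) |
              IsSelfDualLattice σ ϖ (Matrix.diagonal ![((ε : K)) ^ (b.1 : ℕ) * (u₀ : K), (ε : K) ^ (b.2 : ℕ) * (u₁ : K), (ε : K) ^ ((b.1 : ℕ) + (b.2 : ℕ)) * (u₂ : K)]) M ∧ mapGL T M = M ∧
                (![-- bd : `¬ (T − 1)M ⊆ ϖM`
                    ¬ M.map ((Matrix.toLin' ((T : Matrix (Fin 3) (Fin 3) K) - 1)).restrictScalars (Valued.integer K)) ≤ scaleLattice ϖ M,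
                  -- reg : depth 1, rank 2
                    M.map ((Matrix.toLin' ((T : Matrix (Fin 3) (Fin 3) K) - 1)).restrictScalars (Valued.integer K)) ≤ scaleLattice ϖ M ∧
                      ¬ M.map ((Matrix.toLin' ((T : Matrix (Fin 3) (Fin 3) K) - 1)).restrictScalars (Valued.integer K)) ≤ scaleLattice (ϖ ^ 2) M ∧
                      ¬ M.map ((Matrix.toLin' (((T : Matrix (Fin 3) (Fin 3) K) - 1) ^ 2)).restrictScalars (Valued.integer K)) ≤ scaleLattice (ϖ ^ 3) M,
                  -- 1s : depth 1, rank 1, class `c₀`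
                    M.map ((Matrix.toLin' ((T : Matrix (Fin 3) (Fin 3) K) - 1)).restrictScalars (Valued.integer K)) ≤ scaleLattice ϖ M ∧
                      ¬ M.map ((Matrix.toLin' ((T : Matrix (Fin 3) (Fin 3) K) - 1)).restrictScalars (Valued.integer K)) ≤ scaleLattice (ϖ ^ 2) M ∧
                      M.map ((Matrix.toLin' (((T : Matrix (Fin 3) (Fin 3) K) - 1) ^ 2)).restrictScalars (Valued.integer K)) ≤ scaleLattice (ϖ ^ 3) M ∧
                      ∃ y ∈ M, ∃ a : K, Valued.v a = 1 ∧
                        Valued.v (ϖ⁻¹ * pairing σ (Matrix.diagonal ![((ε : K)) ^ (b.1 : ℕ) * (u₀ : K), (ε : K) ^ (b.2 : ℕ) * (u₁ : K), (ε : K) ^ ((b.1 : ℕ) + (b.2 : ℕ)) * (u₂ : K)]) y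
                          (((T : Matrix (Fin 3) (Fin 3) K) - 1) *ᵥ y) - (c₀ : K) * a ^ 2) < 1,
                  -- 1n : depth 1, rank 1, class `c₀·ε`
                    M.map ((Matrix.toLin' ((T : Matrix (Fin 3) (Fin 3) K) - 1)).restrictScalars (Valued.integer K)) ≤ scaleLattice ϖ M ∧
                      ¬ M.map ((Matrix.toLin' ((T : Matrix (Fin 3) (Fin 3) K) - 1)).restrictScalars (Valued.integer K)) ≤ scaleLattice (ϖ ^ 2) M ∧
                      M.map ((Matrix.toLin' (((T : Matrix (Fin 3) (Fin 3) K) - 1) ^ 2)).restrictScalars (Valued.integer K)) ≤ scaleLattice (ϖ ^ 3) M ∧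
                      ∃ y ∈ M, ∃ a : K, Valued.v a = 1 ∧
                        Valued.v (ϖ⁻¹ * pairing σ (Matrix.diagonal ![((ε : K)) ^ (b.1 : ℕ) * (u₀ : K), (ε : K) ^ (b.2 : ℕ) * (u₁ : K), (ε : K) ^ ((b.1 : ℕ) + (b.2 : ℕ)) * (u₂ : K)]) y
                          (((T : Matrix (Fin 3) (Fin 3) K) - 1) *ᵥ y) - (c₀ : K) * (ε : K) * a ^ 2) < 1,
                  -- 0 : depth ≥ 2
                    M.map ((Matrix.toLin' ((T : Matrix (Fin 3) (Fin 3) K) - 1)).restrictScalars (Valued.integer K)) ≤ scaleLattice (ϖ ^ 2) M] : Fin 5 → Prop) j}).ncard : ℕ) : ℚ)) b := rfl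
    rw [hf0]
    by_cases hsq : IsSquare (-1 : 𝓀[K])
    · simp only [if_pos hsq] at hlit
      have hS := signedSum_isoTokens_opposite' (Fintype.card 𝓀[K]) s' Hχ Bχ Λχ hH hB hΛ (((![0, 0, 0, 0, 1] : Fin 5 → ℕ) j : ℕ) : ℚ) (((![(Fintype.card 𝓀[K]) ^ (3 * mA + 3), (Fintype.card 𝓀[K]) ^ (3 * mA + 2), (Fintype.card 𝓀[K]).choose 2 * (Fintype.card 𝓀[K]) ^ (2 * mA) * ∑ i ∈ Finset.range mA, (Fintype.card 𝓀[K]) ^ i, (Fintype.card 𝓀[K]).choose 2 * (Fintype.card 𝓀[K]) ^ (2 * mA) * ∑ i ∈ Finset.range mA, (Fintype.card 𝓀[K]) ^ i,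
          ∑ i ∈ Finset.range (mA + 1), (Fintype.card 𝓀[K]) ^ (2 * i) + ∑ i ∈ Finset.range mA, (Fintype.card 𝓀[K]) ^ (2 * mA + 1 + i)] : Fin 5 → ℕ) j : ℕ) : ℚ) (((![0, 0, (Fintype.card 𝓀[K]) ^ (2 * mA), 0, ∑ i ∈ Finset.range mA, (Fintype.card 𝓀[K]) ^ (2 * i)] : Fin 5 → ℕ) j : ℕ) : ℚ) (((![0, 0, 0, (Fintype.card 𝓀[K]) ^ (2 * mA), ∑ i ∈ Finset.range mA, (Fintype.card 𝓀[K]) ^ (2 * i)] : Fin 5 → ℕ) j : ℕ) : ℚ)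
        _ _ _ hhyp hbig hlock _ hlit
      have hPM : (((![0, 0, (Fintype.card 𝓀[K]) ^ (2 * mA), 0, ∑ i ∈ Finset.range mA, (Fintype.card 𝓀[K]) ^ (2 * i)] : Fin 5 → ℕ) j : ℕ) : ℚ) + (((![0, 0, 0, (Fintype.card 𝓀[K]) ^ (2 * mA), ∑ i ∈ Finset.range mA, (Fintype.card 𝓀[K]) ^ (2 * i)] : Fin 5 → ℕ) j : ℕ) : ℚ) = (((![0, 0, (Fintype.card 𝓀[K]) ^ (2 * mA), (Fintype.card 𝓀[K]) ^ (2 * mA), 2 * ∑ i ∈ Finset.range mA, (Fintype.card 𝓀[K]) ^ (2 * i)] : Fin 5 → ℕ) j : ℕ) : ℚ) := by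
        have h := congrFun (shellSum_P_pos_add_neg_keep (Fintype.card 𝓀[K]) mA) j
        rw [Pi.add_apply] at h
        exact_mod_cast h
      have hX := kappaSum_isoceles_opposite_eq (Fintype.card 𝓀[K]) mA s' hq2 j
      rw [hsign, hmN, hmA, hnk, show 2 * mA + 3 + s' = 2 * mA + 3 + s' from rfl]
      linear_combination hS + (Bχ : ℚ) * hX - ((Bχ : ℚ) * (2 * (Fintype.card 𝓀[K] : ℚ) ^ (s' + 1))) * hPM
    · simp only [if_neg hsq] at hlit
      have hS := signedSum_isoTokens_opposite' (Fintype.card 𝓀[K]) s' Hχ Bχ Λχ hH hB hΛ (((![0, 0, 0, 0, 1] : Fin 5 → ℕ) j : ℕ) : ℚ) (((![(Fintype.card 𝓀[K]) ^ (3 * mA + 3), (Fintype.card 𝓀[K]) ^ (3 * mA + 2), (Fintype.card 𝓀[K]).choose 2 * (Fintype.card 𝓀[K]) ^ (2 * mA) * ∑ i ∈ Finset.range mA, (Fintype.card 𝓀[K]) ^ i, (Fintype.card 𝓀[K]).choose 2 * (Fintype.card 𝓀[K]) ^ (2 * mA) * ∑ i ∈ Finset.range mA, (Fintype.card 𝓀[K])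 ^ i,
          ∑ i ∈ Finset.range (mA + 1), (Fintype.card 𝓀[K]) ^ (2 * i) + ∑ i ∈ Finset.range mA, (Fintype.card 𝓀[K]) ^ (2 * mA + 1 + i)] : Fin 5 → ℕ) j : ℕ) : ℚ) (((![0, 0, if Even mA then (Fintype.card 𝓀[K]) ^ (2 * mA) else 0, if Even mA then 0 else (Fintype.card 𝓀[K]) ^ (2 * mA), ∑ i ∈ Finset.range mA, (Fintype.card 𝓀[K]) ^ (2 * i)] : Fin 5 → ℕ) j : ℕ) : ℚ) (((![0, 0, if Even mA then 0 else (Fintype.card 𝓀[K]) ^ (2 * mA), if Even mA then (Fintype.card 𝓀[K]) ^ (2 * mA) else 0, ∑ i ∈ Finset.range mA, (Fintype.card 𝓀[K]) ^ (2 * i)] : Fin 5 → ℕ) j : ℕ) : ℚ)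
        _ _ _ hhyp hbig hlock _ hlit
      have hPM : (((![0, 0, if Even mA then (Fintype.card 𝓀[K]) ^ (2 * mA) else 0, if Even mA then 0 else (Fintype.card 𝓀[K]) ^ (2 * mA), ∑ i ∈ Finset.range mA, (Fintype.card 𝓀[K]) ^ (2 * i)] : Fin 5 → ℕ) j : ℕ) : ℚ) + (((![0, 0, if Even mA then 0 else (Fintype.card 𝓀[K]) ^ (2 * mA), if Even mA then (Fintype.card 𝓀[K]) ^ (2 * mA) else 0, ∑ i ∈ Finset.range mA, (Fintype.card 𝓀[K]) ^ (2 * i)] : Fin 5 → ℕ) j : ℕ) : ℚ) = (((![0, 0, (Fintype.card 𝓀[K]) ^ (2 * mA), (Fintype.card 𝓀[K]) ^ (2 * mA), 2 * ∑ i ∈ Finset.range mA, (Fintype.card 𝓀[K]) ^ (2 * i)] : Fin 5 → ℕ) j : ℕ) : ℚ) := by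
        have h := congrFun (shellSum_P_pos_add_neg_flip (Fintype.card 𝓀[K]) mA) j
        rw [Pi.add_apply] at h
        exact_mod_cast h
      have hX := kappaSum_isoceles_opposite_eq (Fintype.card 𝓀[K]) mA s' hq2 j
      rw [hsign, hmN, hmA, hnk, show 2 * mA + 3 + s' = 2 * mA + 3 + s' from rfl]
      linear_combination hS + (Bχ : ℚ) * hX - ((Bχ : ℚ) * (2 * (Fintype.card 𝓀[K] : ℚ) ^ (s' + 1))) * hPM


end Literature.NumberTheory.Rogawski1990

end
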